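import Literature.NumberTheory.LFunctions.CriticalLineTwoThirdsPrimeSideSetup
import HarnessLib

/-!
# RH-FREE — «nothing here bears on the truth of RH»: Alpöge–Furman 2026 (arXiv:2608.13637) Proposition 5.2 (reduction of `‖G̃+Ẽ‖²_HS` to the double integral `𝓜`) for the typed model of Theorem 5.7 — PROVED, with the error `O(N/L)` the typed statement needs

Topic `Literature/NumberTheory/LFunctions` (namespace `Literature.NumberTheory.LFunctions.AlpogeFurman2026`).
Cell `rh-columns/lit`, unit `rh-lit-frontier-1` (gen 7). Source: **[AF26]** L. Alpöge, R. Furman,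
*More than two thirds of the zeros of the Riemann zeta function are simple and on the critical
line*, arXiv:2608.13637v2 (19 Aug 2026), UNREFEREED preprint (D-0012); locators = printed
equation / proposition numbers and pages of v2. NO claim, NO `sorry`, no new named fact: every
statement below is a `theorem` with a proof from Mathlib and the companion files
`CriticalLineTwoThirdsPrimeSideSetup` (`φ̂ʳ = hatR`, `Φ = PhiR`, the Lorentzian majorant `lorentz M A`,
the kernel `kerK` (5.8), the entries `s_{kk′} = sEntry`, `sum_step_le_integral`),
`CriticalLineTwoThirdsExplicitFormula` (`ν_X = weilDensity X`, `archDensity`, `primeDensity`,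
`polarDensity`) and `CriticalLineTwoThirdsMatrix` (`grid`, `gridDim`, `logHeight`, `phi`, `IsWindow`).

## What the source prints (§5.1–5.2, pp. 8–9)

* (5.7): "`|ν_X(τ)| ≤ B + log⁺(|τ|/4T)` (`τ ∈ ℝ`), `|ν_X(τ)| ≤ B` (`|τ| ≤ 4T`), `B := l + 4√X`,
  `B² ≪ l² + X`", from (5.5) "`Σ_{n≤x} Λ(n)/√n ≤ 3√x (x ≥ x₀)`" ([MV07, §2.2]).
* (5.8): "`K(τ,τ′) := Σ_{0≤k<d} φ̂(τ−α_k)φ̂(τ′−α_k) = LΦ(τ−τ′) − K_out(τ,τ′)`", (5.9):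
  "`|K|, L|Φ| ≤ aL²`, `|K_out(τ,τ′)| ≤ Σ_{k∉[0,d)} ϑ(τ−α_k)ϑ(τ′−α_k)`".
* **Proposition 5.2** (Reduction to the double integral):
  "`‖G̃+Ẽ‖²_HS = (a²L²)⁻¹ ∬_{I×I} (φ²)^(τ−τ′)² ν_X(τ)ν_X(τ′) dτ dτ′ + O_χ(N log L/L²)`."
  Proof: "`(aL²)²‖G̃+Ẽ‖²_HS = ∬_{I×I} K_∞² νν′ + 𝓔₁ + 𝓔₂`", `𝓔₁ := ∬_{I×I}(K² − K_∞²)νν′`,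
  `𝓔₂ := ∬_{(I×I)ᶜ} K²νν′`, "`∬_{I×I} K_∞²νν′ = L²𝓜`"; "`|K² − K_∞²| = |K_out||K + K_∞| ≤ 2aL²|K_out|`
  … `|𝓔₁| ≤ 2L²B² Σ_{k∉[0,d)} (∫_I ϑ(τ−α_k)dτ)²` … for `k = −j` (`j ≥ 1`) `dist(α_k, I) = jh`; for
  `k = d+1+j` … `α_k ≥ 2T + jh` because `T + (d+1)h > 2T` … `≤ 10Θ₀² + 6C_χΘ₀/h ≪ L log L`";
  and for `𝓔₂`: "`K² ≤ aL²|K| ≤ L² Σ_{k<d} ϑ(τ−α_k)ϑ(τ′−α_k)` … `σ(τ) ≤ Σ_{j≥0} ϑ(Δ+jh) ≤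
  ϑ(Δ) + h⁻¹∫_Δ^∞ ϑ` … `|𝓔₂| ≪ L³B²l log L`."

## What is here, and where it deviates

For the typed model (`CriticalLineTwoThirdsMatrix`: `φ_T = √ψ(·/L)`, `X = T/2π`, no `εw`-taper) the
file proves **`AlpogeFurman2026_reduction`**: for a window `ψ` there is `C ≥ 0` with
`|Σ_{k,k′<d} s_{kk′}² − L²𝓜| ≤ C·T·L⁴` for all `T ≥ 300`, `L ≥ 10`, where
`𝓜 = formM ψ T := ∫_{τ′∈[T,2T]} ν_X(τ′) ∫_{τ∈[T,2T]} Φ(τ−τ′)² ν_X(τ)` and `(L∫φ²)⁻² Σ s² = tr(G̃+Ẽ)²`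
(`trace_fullMatrix_sq` of the Setup file). Since `(L∫φ²)² ≍ L⁴` and `N ≍ TL`, this is the printed
statement with error `O(N/L)`. REMARK ON THE RATE (no endorsement either way): the source *states*
`O_χ(N log L/L²)` but its proof gives `|𝓔₂| ≪ L³B²l log L`, i.e. `O(N log L/L)` after division by
`(aL²)²` (this is "the log log T from Proposition 5.2" of its Remark 6.1); the typed Theorem 5.7
(`AlpogeFurman2026_hilbertSchmidt`, error `C·N/L`) needs `O(N/L)`. The file therefore does NOT follow
the printed `𝓔₂` argument (`K² ≤ aL²|K|` loses a factor `L/Θ₀`); instead (§R4) it uses the kernel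
estimate `∫ K(τ,τ′)² ω(τ) dτ ≤ S₁ Θ_ω Σ_k φ̂(τ′−α_k)²` (weighted Cauchy–Schwarz in `k`, `S₁ = sup_τ Σ_k
ϑ(τ−α_k)`, `Θ_ω = sup_k ∫ϑ(τ−α_k)ω(τ)dτ`) on the off-window region, which is where the gain comes from;
the window block `I×I` (§R6) follows the printed `𝓔₁` argument literally (left family at distances
`jh`, right family at `> (j−1)h`, the point `α_d`, `U_k² ≤ min(Θ, 2A/D_k)²`). Other deviations, all
absorbed by the final constant: the majorant is the two-branch Lorentzian `ϑ_{M,A}` of the Setup file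
(`Θ = ∫ϑ = 2π√(AM) ≍ √L` in place of `Θ₀ ≪ log L`); the density bound is
`|ν_X(τ)| ≤ β√T(1 + √(|τ|/T))` for `T ≥ 4π` (§R1, from `|μ(τ)| ≤ (log(3+|τ|) + 12 + log π)/2π`,
`|Π_X| ≤ (2/π)√X` and `|P_X| ≤ (1/π)Σ_{n≤X}Λ(n)/√n ≤ (2(log 4+4)/π)√X`, the last by Abel summation of
Mathlib's `Chebyshev.psi` bound `ψ(x) ≤ (log 4 + 4)x`), so that the weight `ω(τ) = 1 + √(|τ|/T)`
replaces the source's `B + log⁺(|τ|/4T)`; the far part of `K_out` (indices outside `[−N, d+N]`,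
`Nh ≥ T²`) is bounded by `4M(ϑ(T²) + (L/2π)∫_{T²}^∞ϑ)` instead of being summed exactly.

Contents: §R1 `sum_vonMangoldt_div_sqrt_le`, `exists_abs_weilDensity_le`; §R2 weighted integrals of
`ϑ` (`integral_lorentz_weight_le`, `integral_lorentz_sq_mul_self`, constants `jb p = ∫(1+|s|)^{−p}`);
§R3 sums of `ϑ` over the grid (`sum_lattice_le`, `sum_grid_lorentz_le`, `offBlock_sum_le`, the weight
`wt`); §R4 `kerK_sq_le`, `integral_kerK_sq_wt_le`; §R5 `sEntryI` (`s^I_{kk′} = ∫_I φ̂φ̂ν`),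
`offBlock_le`; §R6 `abs_kerK_le` ((5.9)), `kerKfin`/`abs_kerKtail_le` (the split of `K_out`),
`sum_sq_intervalIntegral_le` (`Σ U_k²`), `formM`, `inBlock_le`; §R7 `offG_facts`,
`sEntry_sq_sub_sEntryI_sq_le` (`𝓔₂`-part `≤ C T L⁴`), `sEntryI_sq_sub_formM_le` (`𝓔₁`-part
`≤ C T L⁴`), `AlpogeFurman2026_reduction`.

STATUS NOTE (no endorsement). Elementary real analysis on the source's auxiliary objects; nothing
here evaluates `𝓜` (Propositions 5.3–5.5 of the source) and nothing asserts Theorem 5.7, Theorem A,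
or RH.

## References
* [AlpogeFurman2026] as above: §5.1 eqs. (5.3)–(5.7) (pp. 7–8); §5.2 eqs. (5.8)–(5.9) and
  Proposition 5.2 with its proof (pp. 8–9); Remark 6.1 (p. 12).
* [MontgomeryVaughan2007] H. L. Montgomery, R. C. Vaughan, *Multiplicative Number Theory I*, CUP 2007,
  §2.2 (Chebyshev's estimates) — cited by the source for (5.5).
-/

noncomputable section

open Complex Filter Set MeasureTheory
open scoped Real Topology ComplexConjugate ArithmeticFunction.vonMangoldt

namespace Literature.NumberTheory.LFunctions

namespace AlpogeFurman2026

variable {ψ : ℝ → ℝ}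

/-! ## §R1. A pointwise bound for the density `ν_X` -/

/-- **Chebyshev by partial summation**: `Σ_{n≤x} Λ(n)/√n ≤ 2(log 4 + 4)√x` for `x ≥ 2`
(Abel summation against `t^{−1/2}` of Mathlib's `ψ(x) ≤ (log 4 + 4)x`). This is the printed
"`Σ_{n≤x} Λ(n)/√n ≤ 3√x (x ≥ x₀)`" of [AF26] Lemma 5.1 (5.5) with a cruder constant.
[cite: AlpogeFurman2026, Lemma 5.1 eq. (5.5) (p. 7)] -/
theorem sum_vonMangoldt_div_sqrt_le {x : ℝ} (hx : 2 ≤ x) :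
    ∑ n ∈ Finset.Icc 0 ⌊x⌋₊, (Λ n : ℝ) / Real.sqrt n ≤ 2 * (Real.log 4 + 4) * Real.sqrt x := by
  set c : ℝ := Real.log 4 + 4 with hc
  have hc0 : 0 < c := by have := Real.log_nonneg (by norm_num : (1:ℝ) ≤ 4); positivity
  have hx0 : 0 < x := by linarith
  -- Abel summation with `f(t) = t^{-1/2}`
  set f : ℝ → ℝ := fun t ↦ t ^ (-(1 / 2 : ℝ)) with hf
  have hdiff : ∀ t ∈ Set.Icc 2 x, DifferentiableAt ℝ f t := fun t ht ↦
    (Real.hasDerivAt_rpow_const (Or.inl (by linarith [ht.1] : t ≠ 0))).differentiableAt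
  have hderiv : ∀ t : ℝ, deriv f t = -(1 / 2) * t ^ (-(1 / 2 : ℝ) - 1) := fun t ↦
    Real.deriv_rpow_const t _
  have hint : IntegrableOn (deriv f) (Set.Icc 2 x) := by
    have : ContinuousOn (fun t : ℝ ↦ -(1 / 2) * t ^ (-(1 / 2 : ℝ) - 1)) (Set.Icc 2 x) :=
      ContinuousOn.mul continuousOn_const (continuousOn_id.rpow_const fun t ht ↦
        Or.inl (by linarith [ht.1] : (t : ℝ) ≠ 0))
    exact (this.integrableOn_compact isCompact_Icc).congr_fun (fun t _ ↦ (hderiv t).symm)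
      measurableSet_Icc
  have habel := sum_mul_eq_sub_integral_mul₁ (c := fun n ↦ (Λ n : ℝ)) (f := f) (by simp)
    (by simp) x hdiff hint
  -- identify the pieces
  have hlhs : ∑ n ∈ Finset.Icc 0 ⌊x⌋₊, (Λ n : ℝ) / Real.sqrt n = ∑ k ∈ Finset.Icc 0 ⌊x⌋₊, f k * Λ k := by
    refine Finset.sum_congr rfl fun n _ ↦ ?_
    rw [hf]; dsimp only
    rw [Real.rpow_neg (Nat.cast_nonneg n), ← Real.sqrt_eq_rpow, div_eq_mul_inv, mul_comm]
  have hpsi : ∀ t : ℝ, ∑ k ∈ Finset.Icc 0 ⌊t⌋₊, (Λ k : ℝ) = Chebyshev.psi t :=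
    fun t ↦ (Chebyshev.psi_eq_sum_Icc t).symm
  rw [hlhs, habel]
  simp_rw [hpsi]
  -- first term `x^{-1/2} ψ(x) ≤ c √x`
  have h1 : f x * Chebyshev.psi x ≤ c * Real.sqrt x := by
    rw [hf]; dsimp only
    have hψ := Chebyshev.psi_le_const_mul_self hx0.le
    calc x ^ (-(1 / 2 : ℝ)) * Chebyshev.psi x ≤ x ^ (-(1 / 2 : ℝ)) * ((Real.log 4 + 4) * x) :=
          mul_le_mul_of_nonneg_left hψ (Real.rpow_nonneg hx0.le _)
      _ = c * (x ^ (-(1 / 2 : ℝ)) * x) := by rw [hc]; ring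
      _ = c * Real.sqrt x := by
          congr 1
          rw [Real.sqrt_eq_rpow, Real.rpow_neg hx0.le]
          have : x = x ^ (1 / 2 : ℝ) * x ^ (1 / 2 : ℝ) := by
            rw [← Real.rpow_add hx0]; norm_num
          nth_rw 2 [this]
          field_simp
  -- the integral `−∫ f′ ψ = ∫ ½ t^{-3/2} ψ(t) ≤ (c/2) ∫ t^{-1/2} ≤ c √x`
  have h2 : -∫ t in Set.Ioc 2 x, deriv f t * Chebyshev.psi t ≤ c * Real.sqrt x := by
    rw [← integral_neg]
    have hle : ∀ t ∈ Set.Ioc 2 x, -(deriv f t * Chebyshev.psi t) ≤ c / 2 * t ^ (-(1 / 2 : ℝ)) := by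
      intro t ht
      have ht0 : 0 < t := by linarith [ht.1]
      rw [hderiv]
      have hψ := Chebyshev.psi_le_const_mul_self ht0.le
      have e : -(-(1 / 2) * t ^ (-(1 / 2 : ℝ) - 1) * Chebyshev.psi t) =
          1 / 2 * t ^ (-(1 / 2 : ℝ) - 1) * Chebyshev.psi t := by ring
      rw [e]
      calc 1 / 2 * t ^ (-(1 / 2 : ℝ) - 1) * Chebyshev.psi t
          ≤ 1 / 2 * t ^ (-(1 / 2 : ℝ) - 1) * ((Real.log 4 + 4) * t) :=
            mul_le_mul_of_nonneg_left hψ (by positivity)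
        _ = c / 2 * (t ^ (-(1 / 2 : ℝ) - 1) * t) := by rw [hc]; ring
        _ = c / 2 * t ^ (-(1 / 2 : ℝ)) := by
            rw [show -(1 / 2 : ℝ) - 1 = -(1 / 2 : ℝ) + (-1) by ring, Real.rpow_add ht0,
              Real.rpow_neg_one]
            field_simp
    have hint2 : IntegrableOn (fun t : ℝ ↦ c / 2 * t ^ (-(1 / 2 : ℝ))) (Set.Ioc 2 x) := by
      have : ContinuousOn (fun t : ℝ ↦ c / 2 * t ^ (-(1 / 2 : ℝ))) (Set.Icc 2 x) :=
        ContinuousOn.mul continuousOn_const (continuousOn_id.rpow_const fun t ht ↦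
          Or.inl (by linarith [ht.1] : (t : ℝ) ≠ 0))
      exact (this.integrableOn_compact isCompact_Icc).mono_set Set.Ioc_subset_Icc_self
    have hint1 : IntegrableOn (fun t : ℝ ↦ -(deriv f t * Chebyshev.psi t)) (Set.Ioc 2 x) := by
      have hm : IntegrableOn (fun t : ℝ ↦ deriv f t * Chebyshev.psi t) (Set.Icc 2 x) := by
        refine hint.mul_bdd (c := c * x) Chebyshev.psi_mono.measurable.aestronglyMeasurable ?_
        refine ae_restrict_of_forall_mem measurableSet_Icc fun t ht ↦ ?_
        rw [Real.norm_eq_abs, abs_of_nonneg (Chebyshev.psi_nonneg t)]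
        exact (Chebyshev.psi_mono ht.2).trans ((Chebyshev.psi_le_const_mul_self hx0.le).trans le_rfl)
      exact (hm.mono_set Set.Ioc_subset_Icc_self).neg
    calc ∫ t in Set.Ioc 2 x, -(deriv f t * Chebyshev.psi t)
        ≤ ∫ t in Set.Ioc 2 x, c / 2 * t ^ (-(1 / 2 : ℝ)) :=
          setIntegral_mono_on hint1 hint2 measurableSet_Ioc hle
      _ = c / 2 * ∫ t in (2:ℝ)..x, t ^ (-(1 / 2 : ℝ)) := by
          rw [integral_const_mul, intervalIntegral.integral_of_le hx]
      _ = c / 2 * ((x ^ (-(1 / 2 : ℝ) + 1) - 2 ^ (-(1 / 2 : ℝ) + 1)) / (-(1 / 2 : ℝ) + 1)) := by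
          rw [integral_rpow (Or.inl (by norm_num))]
      _ ≤ c * Real.sqrt x := by
          rw [show -(1 / 2 : ℝ) + 1 = 1 / 2 by norm_num, ← Real.sqrt_eq_rpow, ← Real.sqrt_eq_rpow]
          have : 0 ≤ Real.sqrt 2 := Real.sqrt_nonneg _
          have : 0 ≤ Real.sqrt x := Real.sqrt_nonneg _
          nlinarith
  linarith

/-- `log y ≤ 2√y` (`y ≥ 0`). [folklore] -/
private theorem log_le_two_sqrt {y : ℝ} (hy : 0 ≤ y) : Real.log y ≤ 2 * Real.sqrt y := by
  rcases hy.eq_or_lt with rfl | hy0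
  · simp
  · have h := Real.log_le_sub_one_of_pos (Real.sqrt_pos.2 hy0)
    rw [Real.log_sqrt hy0.le] at h
    linarith [Real.sqrt_nonneg y]

/-- `√(1+u) ≤ 1 + √u` (`u ≥ 0`). [folklore] -/
private theorem sqrt_one_add_le {u : ℝ} (hu : 0 ≤ u) : Real.sqrt (1 + u) ≤ 1 + Real.sqrt u := by
  rw [Real.sqrt_le_left (by positivity)]
  nlinarith [Real.sq_sqrt hu, Real.sqrt_nonneg u]

/-- **[AF26] (2.3)–(2.4)/(5.7), a pointwise bound for `ν_X`** (`X = T/2π`): there is an absolute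
`β > 0` with `|ν_X(τ)| ≤ β √T (1 + √(|τ|/T))` for all `T ≥ 4π` and all real `τ` — from
`|μ(τ)| ≤ (log(3+|τ|) + 12 + log π)/2π`, `|Π_X| ≤ (2/π)√X`, `|P_X| ≤ (1/π)Σ_{n≤X}Λ(n)/√n ≤ (2(log 4+4)/π)√X`
(the printed "`|ν_X(τ)| ≤ B + log⁺(|τ|/4T)`, `B := l + 4√X`", with the logarithm dominated by a
square root). [cite: AlpogeFurman2026, §5.1 eq. (5.7) (p. 8)] -/
theorem exists_abs_weilDensity_le :
    ∃ β : ℝ, 0 < β ∧ ∀ T : ℝ, 4 * π ≤ T → ∀ τ : ℝ,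
      |weilDensity (T / (2 * π)) τ| ≤ β * Real.sqrt T * (1 + Real.sqrt (|τ| / T)) := by
  set c : ℝ := Real.log 4 + 4 with hc
  have hlog4 : 0 ≤ Real.log 4 := Real.log_nonneg (by norm_num)
  have hπ := Real.pi_gt_three
  have hπ4 := Real.pi_lt_d4
  refine ⟨8 + c, by positivity, fun T hT τ ↦ ?_⟩
  have hT0 : 0 < T := by linarith
  set X := T / (2 * π) with hX
  have hX2 : 2 ≤ X := by rw [hX, le_div_iff₀ (by positivity)]; linarith
  have hX0 : 0 < X := by linarith
  have hXT : X ≤ T := by rw [hX, div_le_iff₀ (by positivity)]; nlinarith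
  set s := Real.sqrt (|τ| / T) with hs
  have hs0 : 0 ≤ s := Real.sqrt_nonneg _
  have hsT : 1 ≤ Real.sqrt T := by
    rw [show (1 : ℝ) = Real.sqrt 1 by simp]; exact Real.sqrt_le_sqrt (by linarith)
  have hsX : Real.sqrt X ≤ Real.sqrt T := Real.sqrt_le_sqrt hXT
  -- `μ`
  have hμ := abs_archDensity_le τ
  have hlog : Real.log (3 + |τ|) ≤ Real.log T + 2 * (1 + s) := by
    have h1 : Real.log (3 + |τ|) ≤ Real.log (T * (1 + |τ| / T)) := by
      refine Real.log_le_log (by positivity) ?_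
      rw [mul_add, mul_one, mul_div_cancel₀ _ hT0.ne']
      linarith
    rw [Real.log_mul hT0.ne' (by positivity)] at h1
    have h2 := log_le_two_sqrt (show 0 ≤ 1 + |τ| / T by positivity)
    have h3 := sqrt_one_add_le (show 0 ≤ |τ| / T by positivity)
    rw [← hs] at h3
    linarith
  have hlogT : Real.log T ≤ 2 * Real.sqrt T := log_le_two_sqrt hT0.le
  have hlogπ : Real.log π ≤ 2 := by
    have h1 : Real.log π ≤ Real.log 4 := Real.log_le_log (by linarith) (by linarith)
    have h2 : Real.log 4 = 2 * Real.log 2 := by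
      rw [show (4 : ℝ) = 2 ^ 2 by norm_num, Real.log_pow]; norm_num
    linarith [Real.log_two_lt_d9]
  have hlog3 : 0 ≤ Real.log (3 + |τ|) := Real.log_nonneg (by linarith [abs_nonneg τ])
  have hlogπ0 : 0 ≤ Real.log π := Real.log_nonneg (by linarith)
  have hμ' : |archDensity τ| ≤ (Real.sqrt T + s + 8) / 3 := by
    have e : (Real.log (3 + |τ|) + 12) / (2 * π) + Real.log π / (2 * π) =
        (Real.log (3 + |τ|) + 12 + Real.log π) / (2 * π) := by ring
    rw [e] at hμ
    refine hμ.trans ?_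
    calc (Real.log (3 + |τ|) + 12 + Real.log π) / (2 * π)
        ≤ (Real.log (3 + |τ|) + 12 + Real.log π) / 6 :=
          div_le_div_of_nonneg_left (by positivity) (by norm_num) (by linarith)
      _ ≤ (Real.sqrt T + s + 8) / 3 := by linarith
  -- `Π_X`
  have hPi : |polarDensity X τ| ≤ 2 / 3 * Real.sqrt T := by
    have h := abs_polarDensity_le X τ
    have e : Real.exp (Real.log X / 2) = Real.sqrt X := by
      rw [Real.sqrt_eq_rpow, Real.rpow_def_of_pos hX0]; ring_nf
    rw [e] at h
    refine h.trans ?_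
    calc 2 / π * Real.sqrt X ≤ 2 / 3 * Real.sqrt X := by gcongr
      _ ≤ 2 / 3 * Real.sqrt T := by gcongr
  -- `P_X`
  have hP : |primeDensity X τ| ≤ 2 * c / 3 * Real.sqrt T := by
    have h := abs_primeDensity_le X τ
    rw [Finset.range_eq_Ico, Finset.Ico_add_one_right_eq_Icc] at h
    have h2 := sum_vonMangoldt_div_sqrt_le hX2
    rw [← hc] at h2
    refine h.trans ?_
    calc 1 / π * ∑ n ∈ Finset.Icc 0 ⌊X⌋₊, (Λ n : ℝ) / Real.sqrt n ≤ 1 / 3 * (2 * c * Real.sqrt X) := by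
          gcongr
      _ ≤ 1 / 3 * (2 * c * Real.sqrt T) := by gcongr
      _ = 2 * c / 3 * Real.sqrt T := by ring
  -- assemble
  have hν : |weilDensity X τ| ≤ |archDensity τ| + |polarDensity X τ| + |primeDensity X τ| := by
    rw [weilDensity_def]
    exact (abs_add_le _ _).trans (by gcongr; exact abs_add_le _ _)
  have hc0 : 0 ≤ c := by positivity
  calc |weilDensity X τ| ≤ (Real.sqrt T + s + 8) / 3 + 2 / 3 * Real.sqrt T + 2 * c / 3 * Real.sqrt T := by
        linarith
    _ ≤ (8 + c) * Real.sqrt T * (1 + s) := by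
        have h3 : 3 ≤ Real.sqrt T := by
          rw [show (3 : ℝ) = Real.sqrt (3 ^ 2) by rw [Real.sqrt_sq (by norm_num)]]
          exact Real.sqrt_le_sqrt (by nlinarith)
        nlinarith [mul_nonneg hc0 hs0, mul_nonneg hc0 (Real.sqrt_nonneg T),
          mul_nonneg (mul_nonneg hc0 (Real.sqrt_nonneg T)) hs0, mul_nonneg (Real.sqrt_nonneg T) hs0]

/-! ## §R2. Weighted integrals of the majorant

The density grows like `log|τ|` (`|ν_X| ≤ β√T·ω`, `ω(τ) = 1 + √(|τ|/T)`); against the majorant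
`ϑ ≍ min(L, A/r²)` the weight costs only constants. Tail integrals whose exact value is
irrelevant are dominated by `∫(1+|s|)^{−p} ds` (`p = 3/2, 5/2`), a finite absolute constant. -/

/-- `J_p := ∫_ℝ (1+|s|)^{−p} ds` (finite for `p > 1`; only its finiteness is used): the constant through
which the polynomial tails of `ϑ` against the growth `1 + √(|τ|/T)` of `ν_X` are bounded (the source's
"on `|τ′−α_k| =: r > 2T` … `ϑ(r) ≤ C_χ r^{−2}`, contributing `≪ B/T`").
[cite: AlpogeFurman2026, Proposition 5.2 (proof, bound for `𝓔₂`), p. 9] -/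
def jb (p : ℝ) : ℝ := ∫ s : ℝ, (1 + ‖s‖) ^ (-p)

/-- `(1+|s|)^{−p}` is integrable for `p > 1`, and `J_p ≥ 0` (Mathlib `integrable_one_add_norm`).
[cite: AlpogeFurman2026, Proposition 5.2 (proof, bound for `𝓔₂`), p. 9] -/
theorem integrable_jb {p : ℝ} (hp : 1 < p) :
    Integrable (fun s : ℝ ↦ (1 + ‖s‖) ^ (-p)) ∧ 0 ≤ jb p := by
  refine ⟨integrable_one_add_norm (by simpa [Module.finrank_self] using hp),
    integral_nonneg fun s ↦ Real.rpow_nonneg (by positivity) _⟩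

/-- `|r|^{−p} ≤ 2^q (1+|r|)^{−p}` for `|r| ≥ 1`, `0 ≤ p ≤ q`... in the concrete form
`x^{−p} ≤ 2^{n} (1+x)^{−p}` for `x ≥ 1`, `0 ≤ p ≤ n` (`n` a natural number). [folklore] -/
private theorem rpow_neg_le_two_pow_mul {x p : ℝ} {n : ℕ} (hx : 1 ≤ x) (hp0 : 0 ≤ p) (hpn : p ≤ n) :
    x ^ (-p) ≤ 2 ^ n * (1 + x) ^ (-p) := by
  have hx0 : 0 < x := by linarith
  have h1 : (1 + x) ^ (-p) ≥ (2 * x) ^ (-p) :=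
    Real.rpow_le_rpow_of_nonpos (by positivity) (by linarith) (by linarith)
  have h2 : (2 * x) ^ (-p) = 2 ^ (-p) * x ^ (-p) := Real.mul_rpow (by norm_num) hx0.le
  have h3 : (1 : ℝ) ≤ (2 : ℝ) ^ (-p) * 2 ^ n := by
    have h := Real.one_le_rpow (x := 2) (z := -p + n) (by norm_num) (by linarith)
    rwa [Real.rpow_add (by norm_num), Real.rpow_natCast] at h
  have hxp : 0 ≤ x ^ (-p) := Real.rpow_nonneg hx0.le _
  calc x ^ (-p) = 1 * x ^ (-p) := by ring
    _ ≤ (2 ^ (-p) * 2 ^ n) * x ^ (-p) := mul_le_mul_of_nonneg_right h3 hxp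
    _ = 2 ^ n * (2 * x) ^ (-p) := by rw [h2]; ring
    _ ≤ 2 ^ n * (1 + x) ^ (-p) := mul_le_mul_of_nonneg_left h1 (by positivity)

/-- `(1+x)^{−p} ≥ 2^{−n}` for `0 ≤ x ≤ 1`, `0 ≤ p ≤ n`. [folklore] -/
private theorem two_pow_inv_le_rpow_neg {x p : ℝ} {n : ℕ} (hx0 : 0 ≤ x) (hx : x ≤ 1) (hp0 : 0 ≤ p)
    (hpn : p ≤ n) : (2 ^ n : ℝ)⁻¹ ≤ (1 + x) ^ (-p) := by
  have h1 : (2 : ℝ) ^ (-p) ≤ (1 + x) ^ (-p) :=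
    Real.rpow_le_rpow_of_nonpos (by positivity) (by linarith) (by linarith)
  have h2 : (2 : ℝ) ^ (-(n : ℝ)) ≤ 2 ^ (-p) :=
    Real.rpow_le_rpow_of_exponent_le (by norm_num) (by linarith)
  rw [Real.rpow_neg (by norm_num), Real.rpow_natCast] at h2
  exact h2.trans h1

/-- `ϑ(r)√|r| ≤ 8(M+A)(1+|r|)^{−3/2}`. [cite: AlpogeFurman2026, §5.1 eq. (5.3) (p. 7)] -/
theorem lorentz_mul_sqrt_le {M A : ℝ} (hM : 0 < M) (hA : 0 < A) (r : ℝ) :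
    lorentz M A r * Real.sqrt |r| ≤ 8 * (M + A) * (1 + ‖r‖) ^ (-(3 / 2 : ℝ)) := by
  rw [Real.norm_eq_abs]
  have hϑ0 := (lorentz_pos hM hA r).le
  rcases le_or_gt |r| 1 with hr | hr
  · -- `|r| ≤ 1`: `ϑ√|r| ≤ 2M ≤ 8(M+A)/4 ≤ 8(M+A)(1+|r|)^{-3/2}`
    have h1 : lorentz M A r * Real.sqrt |r| ≤ 2 * M := by
      calc lorentz M A r * Real.sqrt |r| ≤ 2 * M * 1 :=
            mul_le_mul (lorentz_le_two_mul hM hA r) (Real.sqrt_le_one.mpr hr) (Real.sqrt_nonneg _)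
              (by positivity)
        _ = 2 * M := mul_one _
    have h2 := two_pow_inv_le_rpow_neg (n := 2) (abs_nonneg r) hr (by norm_num) (by norm_num)
      (p := 3 / 2)
    calc lorentz M A r * Real.sqrt |r| ≤ 2 * M := h1
      _ ≤ 8 * (M + A) * (2 ^ 2 : ℝ)⁻¹ := by nlinarith
      _ ≤ 8 * (M + A) * (1 + |r|) ^ (-(3 / 2 : ℝ)) :=
          mul_le_mul_of_nonneg_left h2 (by positivity)
  · -- `|r| ≥ 1`: `ϑ√|r| ≤ 2A|r|^{-3/2} ≤ 8A(1+|r|)^{-3/2}`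
    have hr0 : 0 < |r| := by linarith
    have hrne : r ≠ 0 := abs_pos.1 hr0
    have h1 : lorentz M A r * Real.sqrt |r| ≤ 2 * A * |r| ^ (-(3 / 2 : ℝ)) := by
      calc lorentz M A r * Real.sqrt |r| ≤ 2 * A / r ^ 2 * Real.sqrt |r| :=
            mul_le_mul_of_nonneg_right (lorentz_le_div_sq hM hA hrne) (Real.sqrt_nonneg _)
        _ = 2 * A * |r| ^ (-(3 / 2 : ℝ)) := by
            rw [Real.sqrt_eq_rpow, show r ^ 2 = |r| ^ (2 : ℝ) by
              rw [← sq_abs, ← Real.rpow_natCast]; norm_num, div_mul_eq_mul_div, mul_div_assoc,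
              ← Real.rpow_sub hr0]
            norm_num
    have h2 := rpow_neg_le_two_pow_mul (n := 2) hr.le (by norm_num : (0 : ℝ) ≤ 3 / 2) (by norm_num)
    calc lorentz M A r * Real.sqrt |r| ≤ 2 * A * |r| ^ (-(3 / 2 : ℝ)) := h1
      _ ≤ 2 * A * (2 ^ 2 * (1 + |r|) ^ (-(3 / 2 : ℝ))) := mul_le_mul_of_nonneg_left h2 (by positivity)
      _ ≤ 8 * (M + A) * (1 + |r|) ^ (-(3 / 2 : ℝ)) := by
          have : 0 ≤ (1 + |r|) ^ (-(3 / 2 : ℝ)) := Real.rpow_nonneg (by positivity) _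
          nlinarith

/-- `ϑ(r)²|r|^{3/2} ≤ 32(M²+A²)(1+|r|)^{−5/2}`. [cite: AlpogeFurman2026, §5.1 eq. (5.3) (p. 7)] -/
theorem lorentz_sq_mul_rpow_le {M A : ℝ} (hM : 0 < M) (hA : 0 < A) (r : ℝ) :
    lorentz M A r ^ 2 * |r| ^ (3 / 2 : ℝ) ≤ 32 * (M ^ 2 + A ^ 2) * (1 + ‖r‖) ^ (-(5 / 2 : ℝ)) := by
  rw [Real.norm_eq_abs]
  have hϑ0 := (lorentz_pos hM hA r).le
  rcases le_or_gt |r| 1 with hr | hr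
  · have h1 : lorentz M A r ^ 2 * |r| ^ (3 / 2 : ℝ) ≤ (2 * M) ^ 2 := by
      calc lorentz M A r ^ 2 * |r| ^ (3 / 2 : ℝ) ≤ (2 * M) ^ 2 * 1 :=
            mul_le_mul (pow_le_pow_left₀ hϑ0 (lorentz_le_two_mul hM hA r) 2)
              (Real.rpow_le_one (abs_nonneg r) hr (by norm_num)) (Real.rpow_nonneg (abs_nonneg r) _)
              (by positivity)
        _ = (2 * M) ^ 2 := mul_one _
    have h2 := two_pow_inv_le_rpow_neg (n := 3) (abs_nonneg r) hr (by norm_num) (by norm_num)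
      (p := 5 / 2)
    calc lorentz M A r ^ 2 * |r| ^ (3 / 2 : ℝ) ≤ (2 * M) ^ 2 := h1
      _ ≤ 32 * (M ^ 2 + A ^ 2) * (2 ^ 3 : ℝ)⁻¹ := by nlinarith [sq_nonneg A]
      _ ≤ 32 * (M ^ 2 + A ^ 2) * (1 + |r|) ^ (-(5 / 2 : ℝ)) :=
          mul_le_mul_of_nonneg_left h2 (by positivity)
  · have hr0 : 0 < |r| := by linarith
    have hrne : r ≠ 0 := abs_pos.1 hr0
    have h1 : lorentz M A r ^ 2 * |r| ^ (3 / 2 : ℝ) ≤ 4 * A ^ 2 * |r| ^ (-(5 / 2 : ℝ)) := by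
      have h := pow_le_pow_left₀ hϑ0 (lorentz_le_div_sq hM hA hrne) 2
      calc lorentz M A r ^ 2 * |r| ^ (3 / 2 : ℝ) ≤ (2 * A / r ^ 2) ^ 2 * |r| ^ (3 / 2 : ℝ) :=
            mul_le_mul_of_nonneg_right h (Real.rpow_nonneg (abs_nonneg r) _)
        _ = 4 * A ^ 2 * |r| ^ (-(5 / 2 : ℝ)) := by
            rw [div_pow, show (r ^ 2) ^ 2 = |r| ^ (4 : ℝ) by
              rw [← pow_mul, show r ^ (2 * 2) = |r| ^ 4 by
                  rw [show (2 * 2 : ℕ) = 4 by norm_num, ← Even.pow_abs (by decide : Even 4)],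
                ← Real.rpow_natCast]; norm_num,
              div_mul_eq_mul_div, mul_div_assoc, ← Real.rpow_sub hr0]
            norm_num; left; ring
    have h2 := rpow_neg_le_two_pow_mul (n := 3) hr.le (by norm_num : (0 : ℝ) ≤ 5 / 2) (by norm_num)
    calc lorentz M A r ^ 2 * |r| ^ (3 / 2 : ℝ) ≤ 4 * A ^ 2 * |r| ^ (-(5 / 2 : ℝ)) := h1
      _ ≤ 4 * A ^ 2 * (2 ^ 3 * (1 + |r|) ^ (-(5 / 2 : ℝ))) :=
          mul_le_mul_of_nonneg_left h2 (by positivity)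
      _ ≤ 32 * (M ^ 2 + A ^ 2) * (1 + |r|) ^ (-(5 / 2 : ℝ)) := by
          have : 0 ≤ (1 + |r|) ^ (-(5 / 2 : ℝ)) := Real.rpow_nonneg (by positivity) _
          nlinarith [sq_nonneg M]

/-- `∫_{r>0} ϑ(r)² r dr = 2AM` (antiderivative `−2A²/(r²+A/M)`); this is the `∫Φ(x)²|x|dx ≪ log L`
of the source with `√`-loss built into `ϑ`. [cite: AlpogeFurman2026, §5.3 (p. 9: "`∫Φ(x)²|x|dx ≪ log L`")] -/
theorem integral_lorentz_sq_mul_self {M A : ℝ} (hM : 0 < M) (hA : 0 < A) :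
    IntegrableOn (fun r ↦ lorentz M A r ^ 2 * r) (Ioi 0) ∧
      ∫ r in Ioi 0, lorentz M A r ^ 2 * r = 2 * A * M := by
  set c2 : ℝ := A / M with hc2
  have hc2pos : 0 < c2 := div_pos hA hM
  set F : ℝ → ℝ := fun r ↦ -(2 * A ^ 2) / (r ^ 2 + c2) with hF
  have hderiv : ∀ r : ℝ, HasDerivAt F (lorentz M A r ^ 2 * r) r := by
    intro r
    have hden : r ^ 2 + c2 ≠ 0 := by positivity
    have h1 : HasDerivAt (fun r : ℝ ↦ r ^ 2 + c2) (2 * r) r := by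
      simpa using (hasDerivAt_pow 2 r).add_const c2
    have h2 := (h1.inv hden).const_mul (-(2 * A ^ 2))
    have e : (fun y : ℝ ↦ -(2 * A ^ 2) * (fun r : ℝ ↦ r ^ 2 + c2)⁻¹ y) = F := by
      funext y; simp only [hF, Pi.inv_apply, div_eq_mul_inv]
    rw [e] at h2
    refine h2.congr_deriv ?_
    rw [lorentz, ← hc2]
    field_simp
  have hcont : Continuous F := by
    rw [hF]; exact continuous_const.div (by fun_prop) fun r ↦ by positivity
  have hlim : Tendsto F atTop (𝓝 0) := by
    have h1 : Tendsto (fun r : ℝ ↦ r ^ 2 + c2) atTop atTop :=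
      tendsto_atTop_add_const_right _ _ (tendsto_pow_atTop two_ne_zero)
    have h2 := h1.inv_tendsto_atTop.const_mul (-(2 * A ^ 2))
    rw [mul_zero] at h2
    refine h2.congr fun r ↦ ?_
    simp only [hF, Pi.inv_apply, div_eq_mul_inv]
  have hnn : ∀ r ∈ Ioi (0 : ℝ), 0 ≤ lorentz M A r ^ 2 * r := fun r hr ↦
    mul_nonneg (sq_nonneg _) (le_of_lt hr)
  refine ⟨integrableOn_Ioi_deriv_of_nonneg hcont.continuousWithinAt (fun r _ ↦ hderiv r) hnn hlim, ?_⟩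
  rw [integral_Ioi_of_hasDerivAt_of_nonneg hcont.continuousWithinAt (fun r _ ↦ hderiv r) hnn hlim, hF]
  simp only
  rw [hc2]
  field_simp
  ring

/-- `√(a + b) ≤ √a + √b` (`a, b ≥ 0`). [folklore] -/
private theorem sqrt_add_le' {a b : ℝ} (ha : 0 ≤ a) (hb : 0 ≤ b) :
    Real.sqrt (a + b) ≤ Real.sqrt a + Real.sqrt b := by
  rw [Real.sqrt_le_left (by positivity)]
  nlinarith [Real.sq_sqrt ha, Real.sq_sqrt hb, Real.sqrt_nonneg a, Real.sqrt_nonneg b]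

/-- **The weighted mass of the majorant**: for `α ∈ [T, 2T]` (`T > 0`),
`∫_ℝ ϑ(τ − α)(1 + √(|τ|/T)) dτ ≤ (1+√2)·2π√(AM) + 8(M+A)J_{3/2}/√T` (translation invariance and
`|τ| ≤ |τ − α| + 2T`). [cite: AlpogeFurman2026, §5.1 eq. (5.4) (p. 7)] -/
theorem integral_lorentz_weight_le {M A : ℝ} (hM : 0 < M) (hA : 0 < A) {T : ℝ} (hT : 0 < T)
    {α : ℝ} (hα : α ∈ Icc T (2 * T)) :
    Integrable (fun τ : ℝ ↦ lorentz M A (τ - α) * (1 + Real.sqrt (|τ| / T))) ∧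
      ∫ τ : ℝ, lorentz M A (τ - α) * (1 + Real.sqrt (|τ| / T)) ≤
        (1 + Real.sqrt 2) * (2 * π * Real.sqrt (A * M)) + 8 * (M + A) * jb (3 / 2) / Real.sqrt T := by
  obtain ⟨hcont, hint, hI⟩ := integral_lorentz hM hA
  obtain ⟨hjb, hjb0⟩ := integrable_jb (show (1 : ℝ) < 3 / 2 by norm_num)
  -- pointwise domination
  have hdom : ∀ τ : ℝ, lorentz M A (τ - α) * (1 + Real.sqrt (|τ| / T)) ≤
      (1 + Real.sqrt 2) * lorentz M A (τ - α) +
        8 * (M + A) / Real.sqrt T * (1 + ‖τ - α‖) ^ (-(3 / 2 : ℝ)) := by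
    intro τ
    have hϑ0 := (lorentz_pos hM hA (τ - α)).le
    have h1 : |τ| ≤ |τ - α| + 2 * T := by
      have := abs_sub_abs_le_abs_sub τ α
      rw [abs_of_pos (by linarith [hα.1] : 0 < α)] at this
      linarith [hα.2]
    have h2 : Real.sqrt (|τ| / T) ≤ Real.sqrt (|τ - α|) / Real.sqrt T + Real.sqrt 2 := by
      calc Real.sqrt (|τ| / T) ≤ Real.sqrt ((|τ - α| + 2 * T) / T) := by gcongr
        _ = Real.sqrt (|τ - α| / T + 2) := by congr 1; field_simp
        _ ≤ Real.sqrt (|τ - α| / T) + Real.sqrt 2 := sqrt_add_le' (by positivity) (by norm_num)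
        _ = Real.sqrt (|τ - α|) / Real.sqrt T + Real.sqrt 2 := by rw [Real.sqrt_div' _ hT.le]
    have h3 := lorentz_mul_sqrt_le hM hA (τ - α)
    calc lorentz M A (τ - α) * (1 + Real.sqrt (|τ| / T))
        ≤ lorentz M A (τ - α) * (1 + (Real.sqrt (|τ - α|) / Real.sqrt T + Real.sqrt 2)) := by gcongr
      _ = (1 + Real.sqrt 2) * lorentz M A (τ - α) +
            (lorentz M A (τ - α) * Real.sqrt (|τ - α|)) / Real.sqrt T := by ring
      _ ≤ (1 + Real.sqrt 2) * lorentz M A (τ - α) +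
            (8 * (M + A) * (1 + ‖τ - α‖) ^ (-(3 / 2 : ℝ))) / Real.sqrt T := by gcongr
      _ = _ := by ring
  have hint1 : Integrable fun τ : ℝ ↦ (1 + Real.sqrt 2) * lorentz M A (τ - α) :=
    (hint.comp_sub_right α).const_mul _
  have hint2 : Integrable fun τ : ℝ ↦ 8 * (M + A) / Real.sqrt T * (1 + ‖τ - α‖) ^ (-(3 / 2 : ℝ)) :=
    (hjb.comp_sub_right α).const_mul _
  have hmeas : AEStronglyMeasurable (fun τ : ℝ ↦ lorentz M A (τ - α) * (1 + Real.sqrt (|τ| / T))) := by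
    refine ((hcont.comp (continuous_id.sub continuous_const)).mul ?_).aestronglyMeasurable
    fun_prop
  have hnn : ∀ τ : ℝ, 0 ≤ lorentz M A (τ - α) * (1 + Real.sqrt (|τ| / T)) := fun τ ↦
    mul_nonneg (lorentz_pos hM hA _).le (by positivity)
  have hintw : Integrable (fun τ : ℝ ↦ lorentz M A (τ - α) * (1 + Real.sqrt (|τ| / T))) := by
    refine (hint1.add hint2).mono' hmeas (Eventually.of_forall fun τ ↦ ?_)
    rw [Real.norm_eq_abs, abs_of_nonneg (hnn τ)]
    exact hdom τ
  refine ⟨hintw, ?_⟩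
  calc ∫ τ : ℝ, lorentz M A (τ - α) * (1 + Real.sqrt (|τ| / T))
      ≤ ∫ τ : ℝ, ((1 + Real.sqrt 2) * lorentz M A (τ - α) +
          8 * (M + A) / Real.sqrt T * (1 + ‖τ - α‖) ^ (-(3 / 2 : ℝ))) :=
        integral_mono hintw (hint1.add hint2) hdom
    _ = (1 + Real.sqrt 2) * (2 * π * Real.sqrt (A * M)) + 8 * (M + A) * jb (3 / 2) / Real.sqrt T := by
        rw [integral_add hint1 hint2, integral_const_mul, integral_const_mul,
          integral_sub_right_eq_self (fun τ ↦ lorentz M A τ) α, hI,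
          integral_sub_right_eq_self (fun τ : ℝ ↦ (1 + ‖τ‖) ^ (-(3 / 2 : ℝ))) α]
        rw [jb]; ring

/-! ## §R3. Sums of the majorant over the grid -/

/-- A finite set of natural numbers indexes part of a progression: for `G ≥ 0`,
`Σ_{j ∈ J} G j ≤ Σ_{j < N} G j` with `N = max J + 1`. [folklore] -/
private theorem sum_le_sum_range_of_nonneg (J : Finset ℕ) {G : ℕ → ℝ} (hG : ∀ j, 0 ≤ G j) :
    ∑ j ∈ J, G j ≤ ∑ j ∈ Finset.range ((J.sup id).succ), G j :=
  Finset.sum_le_sum_of_subset_of_nonneg (Finset.subset_range_sup_succ J) fun j _ _ ↦ hG j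

/-- **Two-sided lattice sums of an even decreasing function**: for `g ≥ 0` even, decreasing on
`[0,∞)` and integrable there, a step `h > 0`, any `u ∈ ℝ` and any finite set `S ⊂ ℤ`:
`Σ_{k∈S} g(u − kh) ≤ 2g(0) + 2h⁻¹ ∫_{x>0} g` (split at `⌊u/h⌋`; each side is a progression).
This is the source's "`σ(τ) ≤ Σ_j ϑ(Δ + jh) ≤ ϑ(Δ) + h⁻¹∫_Δ^∞ ϑ`" on both sides of `τ`.
[cite: AlpogeFurman2026, Proposition 5.2 (proof), p. 9] -/
theorem sum_lattice_le {g : ℝ → ℝ} (heven : ∀ x, g (-x) = g x) (hanti : AntitoneOn g (Ici 0))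
    (hg0 : ∀ x, 0 ≤ g x) (hint : IntegrableOn g (Ioi 0)) {h : ℝ} (hh : 0 < h) (u : ℝ)
    (S : Finset ℤ) :
    ∑ k ∈ S, g (u - k * h) ≤ 2 * g 0 + 2 * (h⁻¹ * ∫ x in Ioi 0, g x) := by
  set m : ℤ := ⌊u / h⌋ with hm
  set r : ℝ := u - m * h with hr
  have hr0 : 0 ≤ r := by
    have := Int.floor_le (u / h)
    rw [← hm] at this
    rw [hr, sub_nonneg]
    calc (m : ℝ) * h ≤ u / h * h := mul_le_mul_of_nonneg_right this hh.le
      _ = u := div_mul_cancel₀ u hh.ne'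
  have hrh : r < h := by
    have := Int.lt_floor_add_one (u / h)
    rw [← hm] at this
    have : u < (m + 1) * h := by
      calc u = u / h * h := (div_mul_cancel₀ u hh.ne').symm
        _ < (m + 1) * h := mul_lt_mul_of_pos_right this hh
    rw [hr]; linarith
  -- one progression starting at `Δ ≥ 0`
  have hprog : ∀ {Δ : ℝ}, 0 ≤ Δ → ∀ N : ℕ,
      ∑ j ∈ Finset.range N, g (Δ + j * h) ≤ g 0 + h⁻¹ * ∫ x in Ioi 0, g x := by
    intro Δ hΔ N
    have h1 := sum_step_le_add_integral (g := g) hh (hanti.mono (Ici_subset_Ici.2 hΔ))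
      (fun x _ ↦ hg0 x) (hint.mono_set (Ioi_subset_Ioi hΔ)) N
    have h2 : g Δ ≤ g 0 := hanti (mem_Ici.2 le_rfl) (mem_Ici.2 hΔ) hΔ
    have h3 : ∫ x in Ioi Δ, g x ≤ ∫ x in Ioi 0, g x :=
      setIntegral_mono_set hint (ae_of_all _ fun x ↦ hg0 x) (Ioi_subset_Ioi hΔ).eventuallyLE
    have h4 : h⁻¹ * ∫ x in Ioi Δ, g x ≤ h⁻¹ * ∫ x in Ioi 0, g x :=
      mul_le_mul_of_nonneg_left h3 (inv_nonneg.2 hh.le)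
    linarith
  -- split `S` at `m`
  rw [← Finset.sum_filter_add_sum_filter_not S (fun k ↦ k ≤ m)]
  have hleft : ∑ k ∈ S.filter (fun k ↦ k ≤ m), g (u - k * h) ≤ g 0 + h⁻¹ * ∫ x in Ioi 0, g x := by
    set φ : ℤ → ℕ := fun k ↦ (m - k).toNat with hφ
    have hinj : Set.InjOn φ (S.filter (fun k ↦ k ≤ m)) := by
      intro a ha b hb hab
      simp only [Finset.coe_filter, Set.mem_setOf_eq] at ha hb
      simp only [hφ] at hab
      have := congrArg (fun n : ℕ ↦ (n : ℤ)) hab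
      simp only [Int.toNat_of_nonneg (sub_nonneg.2 ha.2), Int.toNat_of_nonneg (sub_nonneg.2 hb.2)] at this
      linarith
    have e : ∀ k ∈ S.filter (fun k ↦ k ≤ m), g (u - k * h) = g (r + (φ k : ℕ) * h) := by
      intro k hk
      simp only [Finset.mem_filter] at hk
      congr 1
      have : ((φ k : ℕ) : ℝ) = (m : ℝ) - k := by
        rw [hφ]; dsimp only
        rw [show (((m - k).toNat : ℕ) : ℝ) = (((m - k).toNat : ℤ) : ℝ) by norm_cast,
          Int.toNat_of_nonneg (sub_nonneg.2 hk.2)]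
        push_cast; ring
      rw [this, hr]; ring
    rw [Finset.sum_congr rfl e, ← Finset.sum_image (g := φ) (f := fun j : ℕ ↦ g (r + j * h)) hinj]
    refine (sum_le_sum_range_of_nonneg _ fun j ↦ hg0 _).trans (hprog hr0 _)
  have hright : ∑ k ∈ S.filter (fun k ↦ ¬k ≤ m), g (u - k * h) ≤ g 0 + h⁻¹ * ∫ x in Ioi 0, g x := by
    set φ : ℤ → ℕ := fun k ↦ (k - m - 1).toNat with hφ
    have hinj : Set.InjOn φ (S.filter (fun k ↦ ¬k ≤ m)) := by
      intro a ha b hb hab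
      simp only [Finset.coe_filter, Set.mem_setOf_eq, not_le] at ha hb
      simp only [hφ] at hab
      have := congrArg (fun n : ℕ ↦ (n : ℤ)) hab
      simp only [Int.toNat_of_nonneg (show 0 ≤ a - m - 1 by omega),
        Int.toNat_of_nonneg (show 0 ≤ b - m - 1 by omega)] at this
      linarith
    have e : ∀ k ∈ S.filter (fun k ↦ ¬k ≤ m), g (u - k * h) = g ((h - r) + (φ k : ℕ) * h) := by
      intro k hk
      simp only [Finset.mem_filter, not_le] at hk
      rw [← heven (u - k * h)]
      congr 1
      have : ((φ k : ℕ) : ℝ) = (k : ℝ) - m - 1 := by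
        rw [hφ]; dsimp only
        rw [show (((k - m - 1).toNat : ℕ) : ℝ) = (((k - m - 1).toNat : ℤ) : ℝ) by norm_cast,
          Int.toNat_of_nonneg (show 0 ≤ k - m - 1 by omega)]
        push_cast; ring
      rw [this, hr]; ring
    rw [Finset.sum_congr rfl e, ← Finset.sum_image (g := φ) (f := fun j : ℕ ↦ g ((h - r) + j * h)) hinj]
    refine (sum_le_sum_range_of_nonneg _ fun j ↦ hg0 _).trans (hprog (by linarith) _)
  linarith

/-- **`σ(τ) := Σ_{0≤k<d} ϑ(τ − α_k) ≤ 4M + 2h⁻¹∫_{r>0}ϑ =: Σ₁`, uniformly in `τ ∈ ℝ`** (`h = 2π/L`),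
and the same for `ϑ²`. [cite: AlpogeFurman2026, Proposition 5.2 (proof: "`σ(τ) ≤ Σ_{j≥0} ϑ(Δ+jh) ≤ …`"), p. 9] -/
theorem sum_grid_lorentz_le {M A : ℝ} (hM : 0 < M) (hA : 0 < A) {T : ℝ} (hL : 0 < logHeight T) (τ : ℝ) :
    ∑ k : Fin (gridDim T), lorentz M A (τ - grid T (logHeight T) ((k : ℕ) : ℤ)) ≤
        4 * M + 2 * ((logHeight T / (2 * π)) * ∫ r in Ioi 0, lorentz M A r) ∧
      ∑ k : Fin (gridDim T), lorentz M A (τ - grid T (logHeight T) ((k : ℕ) : ℤ)) ^ 2 ≤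
        2 * (2 * M) ^ 2 + 2 * ((logHeight T / (2 * π)) * ∫ r in Ioi 0, lorentz M A r ^ 2) := by
  have hπ := Real.pi_pos
  set L := logHeight T with hLdef
  set h : ℝ := 2 * π / L with hh
  have hh0 : 0 < h := by positivity
  have hhinv : h⁻¹ = L / (2 * π) := by rw [hh, inv_div]
  have egrid : ∀ k : ℤ, τ - grid T L k = (τ - T) - k * h := by
    intro k; rw [grid, hh]; ring
  obtain ⟨hI, -, -⟩ := setIntegral_lorentz_le hM hA (0 : ℝ)
  obtain ⟨hI2, -, -⟩ := setIntegral_lorentz_sq_le hM hA (0 : ℝ)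
  have h0 : lorentz M A 0 = 2 * M := by
    rw [lorentz]; field_simp; ring
  constructor
  · have h1 := sum_lattice_le (g := lorentz M A) (lorentz_neg M A) (lorentz_antitoneOn hM hA)
      (fun x ↦ (lorentz_pos hM hA x).le) hI hh0 (τ - T) (gridIdx T)
    rw [sum_gridIdx, h0, hhinv] at h1
    simp_rw [← egrid] at h1
    linarith
  · have hanti2 : AntitoneOn (fun r ↦ lorentz M A r ^ 2) (Ici 0) := fun x hx y hy hxy ↦
      pow_le_pow_left₀ (lorentz_pos hM hA y).le (lorentz_antitoneOn hM hA hx hy hxy) 2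
    have h1 := sum_lattice_le (g := fun r ↦ lorentz M A r ^ 2) (fun x ↦ by simp [lorentz_neg])
      hanti2 (fun x ↦ sq_nonneg _) hI2 hh0 (τ - T) (gridIdx T)
    rw [sum_gridIdx, h0, hhinv] at h1
    simp_rw [← egrid] at h1
    linarith

/-- **Tonelli by hand for a progression of half-lines**: for `G ≥ 0` on `(0,∞)` with `G` and
`x G(x)` integrable there, `Σ_{k<d} ∫_{x>kh} G ≤ ∫_{x>0} (1 + x/h) G(x) dx`
(`#{k : kh < x} ≤ 1 + x/h`). [cite: AlpogeFurman2026, Proposition 5.2 (proof), p. 9] -/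
theorem sum_setIntegral_Ioi_le {G : ℝ → ℝ} (hG0 : ∀ x, 0 < x → 0 ≤ G x)
    (hint : IntegrableOn G (Ioi 0)) (hintx : IntegrableOn (fun x ↦ x * G x) (Ioi 0))
    {h : ℝ} (hh : 0 < h) (d : ℕ) :
    ∑ k ∈ Finset.range d, ∫ x in Ioi ((k : ℝ) * h), G x ≤ ∫ x in Ioi 0, (1 + x / h) * G x := by
  -- each half-line integral as an integral over `(0,∞)` of an indicator
  have e1 : ∀ k : ℕ, ∫ x in Ioi ((k : ℝ) * h), G x = ∫ x in Ioi 0, (Ioi ((k : ℝ) * h)).indicator G x := by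
    intro k
    rw [setIntegral_indicator measurableSet_Ioi, Set.Ioi_inter_Ioi, max_eq_right (by positivity)]
  simp_rw [e1]
  rw [← integral_finsetSum _ (fun k _ ↦ hint.indicator measurableSet_Ioi)]
  have hR : IntegrableOn (fun x ↦ (1 + x / h) * G x) (Ioi 0) := by
    have : (fun x ↦ (1 + x / h) * G x) = fun x ↦ G x + h⁻¹ * (x * G x) := by
      funext x; ring
    rw [this]; exact hint.add (hintx.const_mul _)
  refine setIntegral_mono_on (integrable_finsetSum _ fun k _ ↦ hint.indicator measurableSet_Ioi) hR
    measurableSet_Ioi fun x hx ↦ ?_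
  -- pointwise count
  have hx0 : 0 < x := hx
  simp only [Set.indicator_apply, Set.mem_Ioi]
  rw [← Finset.sum_filter, Finset.sum_const, nsmul_eq_mul]
  have hcard : (((Finset.range d).filter (fun k : ℕ ↦ (k : ℝ) * h < x)).card : ℝ) ≤ 1 + x / h := by
    have hsub : (Finset.range d).filter (fun k : ℕ ↦ (k : ℝ) * h < x) ⊆ Finset.range ⌈x / h⌉₊ := by
      intro k hk
      simp only [Finset.mem_filter, Finset.mem_range] at hk ⊢
      refine Nat.lt_ceil.2 ?_
      rw [lt_div_iff₀ hh]; exact hk.2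
    have h1 := Finset.card_le_card hsub
    rw [Finset.card_range] at h1
    have h2 := Nat.ceil_lt_add_one (show 0 ≤ x / h by positivity)
    have : ((((Finset.range d).filter (fun k : ℕ ↦ (k : ℝ) * h < x)).card : ℕ) : ℝ) ≤ ⌈x / h⌉₊ := by
      exact_mod_cast h1
    linarith
  exact mul_le_mul_of_nonneg_right hcard (hG0 x hx0)

/-- The weight `ω_T(τ) := 1 + √(|τ|/T)` carrying the growth of `ν_X`. [cite: AlpogeFurman2026, §5.1 eq. (5.7) (p. 8)] -/
def wt (T τ : ℝ) : ℝ := 1 + Real.sqrt (|τ| / T)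

/-- `ω ≥ 1 > 0` and `ω` is continuous. [cite: AlpogeFurman2026, §5.1 eq. (5.7) (p. 8)] -/
theorem wt_pos (T τ : ℝ) : 0 < wt T τ ∧ 1 ≤ wt T τ ∧ Continuous (wt T) := by
  refine ⟨by unfold wt; positivity, by unfold wt; linarith [Real.sqrt_nonneg (|τ| / T)], ?_⟩
  unfold wt; fun_prop

/-- `ω(α ± r) ≤ 1 + √2 + √(r/T)` for `0 ≤ α ≤ 2T`, `r ≥ 0`. [cite: AlpogeFurman2026, §5.1 eq. (5.7) (p. 8)] -/
theorem wt_shift_le {T α r : ℝ} (hT : 0 < T) (hα0 : 0 ≤ α) (hα : α ≤ 2 * T) (hr : 0 ≤ r) :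
    wt T (α - r) ≤ 1 + Real.sqrt 2 + Real.sqrt (r / T) ∧
      wt T (α + r) ≤ 1 + Real.sqrt 2 + Real.sqrt (r / T) := by
  have key : ∀ y : ℝ, |y| ≤ 2 * T + r → wt T y ≤ 1 + Real.sqrt 2 + Real.sqrt (r / T) := by
    intro y hy
    unfold wt
    have h1 : Real.sqrt (|y| / T) ≤ Real.sqrt (2 + r / T) := by
      refine Real.sqrt_le_sqrt ?_
      rw [div_le_iff₀ hT, add_mul, div_mul_cancel₀ r hT.ne']
      linarith
    have h2 := sqrt_add_le' (show (0 : ℝ) ≤ 2 by norm_num) (show 0 ≤ r / T by positivity)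
    linarith
  constructor
  · refine key _ ?_
    rw [abs_le]; constructor <;> linarith
  · refine key _ ?_
    rw [abs_le]; constructor <;> linarith

/-- `τ ↦ ω(τ) ϑ(τ − α)²` is integrable (`α ∈ [T, 2T]`). [cite: AlpogeFurman2026, §5.2 (p. 9)] -/
theorem integrable_wt_mul_lorentz_sq {M A : ℝ} (hM : 0 < M) (hA : 0 < A) {T : ℝ} (hT : 0 < T)
    {α : ℝ} (hα : α ∈ Icc T (2 * T)) :
    Integrable fun τ : ℝ ↦ wt T τ * lorentz M A (τ - α) ^ 2 := by
  obtain ⟨hint, -⟩ := integral_lorentz_weight_le hM hA hT hα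
  obtain ⟨hcont, -, -⟩ := integral_lorentz hM hA
  have hmeas : AEStronglyMeasurable (fun τ : ℝ ↦ wt T τ * lorentz M A (τ - α) ^ 2) := by
    refine ((wt_pos T 0).2.2.mul ((hcont.comp (continuous_id.sub continuous_const)).pow 2)).aestronglyMeasurable
  refine (hint.const_mul (2 * M)).mono' hmeas (Eventually.of_forall fun τ ↦ ?_)
  have h0 := (lorentz_pos hM hA (τ - α)).le
  have hw := (wt_pos T τ).1.le
  rw [Real.norm_eq_abs, abs_of_nonneg (mul_nonneg hw (sq_nonneg _)), pow_two]
  calc wt T τ * (lorentz M A (τ - α) * lorentz M A (τ - α))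
      ≤ wt T τ * (2 * M * lorentz M A (τ - α)) := by
        gcongr; exact lorentz_le_two_mul hM hA _
    _ = 2 * M * (lorentz M A (τ - α) * wt T τ) := by ring

/-- **One grid point, both sides of the window**: for `α = T + kh` with `0 ≤ kh` and
`(d−1)h ≤ T`, `k < d`, and `G ≥ 0` dominating `ϑ(r)²(1 + √2 + √(r/T))` on `r > 0`:
`∫_{τ<T} ω ϑ(τ−α)² + ∫_{τ>2T} ω ϑ(τ−α)² ≤ ∫_{r>kh} G + ∫_{r>(d−1−k)h} G`.
[cite: AlpogeFurman2026, Proposition 5.2 (proof: the ranges `τ ∉ I`), p. 9] -/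
theorem offBlock_one_le {M A : ℝ} (hM : 0 < M) (hA : 0 < A) {T h : ℝ} (hT : 0 < T) (hh : 0 < h)
    {d k : ℕ} (hk : k < d) (hdh : ((d : ℝ) - 1) * h ≤ T) {G : ℝ → ℝ}
    (hG0 : ∀ r, 0 < r → 0 ≤ G r) (hGi : IntegrableOn G (Ioi 0))
    (hGdom : ∀ r, 0 < r → lorentz M A r ^ 2 * (1 + Real.sqrt 2 + Real.sqrt (r / T)) ≤ G r) :
    (∫ τ in Iio T, wt T τ * lorentz M A (τ - (T + k * h)) ^ 2) +
        ∫ τ in Ioi (2 * T), wt T τ * lorentz M A (τ - (T + k * h)) ^ 2 ≤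
      (∫ r in Ioi ((k : ℝ) * h), G r) + ∫ r in Ioi (((d - 1 - k : ℕ) : ℝ) * h), G r := by
  set α : ℝ := T + k * h with hαdef
  have hkh : 0 ≤ (k : ℝ) * h := by positivity
  have hk' : (k : ℝ) ≤ d - 1 := by
    have : (k : ℝ) + 1 ≤ d := by exact_mod_cast hk
    linarith
  have hα : α ∈ Icc T (2 * T) := by
    refine ⟨by rw [hαdef]; linarith, ?_⟩
    rw [hαdef]
    have : (k : ℝ) * h ≤ (d - 1) * h := mul_le_mul_of_nonneg_right hk' hh.le
    linarith
  set F : ℝ → ℝ := fun τ ↦ wt T τ * lorentz M A (τ - α) ^ 2 with hF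
  have hFi : Integrable F := integrable_wt_mul_lorentz_sq hM hA hT hα
  have hFnn : ∀ τ, 0 ≤ F τ := fun τ ↦ mul_nonneg (wt_pos T τ).1.le (sq_nonneg _)
  -- pointwise domination after the substitutions
  have hdomL : ∀ r ∈ Ioi ((k : ℝ) * h), F (α - r) ≤ G r := by
    intro r hr
    have hr0 : 0 < r := lt_of_le_of_lt hkh hr
    rw [hF]; dsimp only
    rw [show α - r - α = -r by ring, lorentz_neg]
    have hw := (wt_shift_le hT (by linarith [hα.1]) hα.2 hr0.le).1
    calc wt T (α - r) * lorentz M A r ^ 2 ≤ (1 + Real.sqrt 2 + Real.sqrt (r / T)) * lorentz M A r ^ 2 :=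
          mul_le_mul_of_nonneg_right hw (sq_nonneg _)
      _ = lorentz M A r ^ 2 * (1 + Real.sqrt 2 + Real.sqrt (r / T)) := mul_comm _ _
      _ ≤ G r := hGdom r hr0
  have hdomR : ∀ r ∈ Ioi (2 * T - α), F (α + r) ≤ G r := by
    intro r hr
    have hr0 : 0 < r := lt_of_le_of_lt (by linarith [hα.2]) hr
    rw [hF]; dsimp only
    rw [show α + r - α = r by ring]
    have hw := (wt_shift_le hT (by linarith [hα.1]) hα.2 hr0.le).2
    calc wt T (α + r) * lorentz M A r ^ 2 ≤ (1 + Real.sqrt 2 + Real.sqrt (r / T)) * lorentz M A r ^ 2 :=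
          mul_le_mul_of_nonneg_right hw (sq_nonneg _)
      _ = lorentz M A r ^ 2 * (1 + Real.sqrt 2 + Real.sqrt (r / T)) := mul_comm _ _
      _ ≤ G r := hGdom r hr0
  -- left side: `τ = α − r`
  have hL : ∫ τ in Iio T, F τ ≤ ∫ r in Ioi ((k : ℝ) * h), G r := by
    have e1 : ∫ τ in Iio T, F τ = ∫ r in Ioi ((k : ℝ) * h), F (α - r) := by
      rw [← integral_indicator measurableSet_Iio, ← integral_indicator measurableSet_Ioi,
        ← integral_sub_left_eq_self (fun τ ↦ (Iio T).indicator F τ) volume α]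
      refine integral_congr_ae (Eventually.of_forall fun r ↦ ?_)
      simp only [Set.indicator_apply, mem_Iio, mem_Ioi, hαdef]
      have : T + k * h - r < T ↔ (k : ℝ) * h < r := by constructor <;> intro h <;> linarith
      simp only [this]
    rw [e1]
    refine setIntegral_mono_on ?_ (hGi.mono_set (Ioi_subset_Ioi hkh)) measurableSet_Ioi hdomL
    exact (hFi.comp_sub_left α).integrableOn
  -- right side: `τ = α + r`
  have hR : ∫ τ in Ioi (2 * T), F τ ≤ ∫ r in Ioi (((d - 1 - k : ℕ) : ℝ) * h), G r := by
    have e1 : ∫ τ in Ioi (2 * T), F τ = ∫ r in Ioi (2 * T - α), F (α + r) := by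
      rw [← integral_indicator measurableSet_Ioi, ← integral_indicator measurableSet_Ioi,
        ← integral_add_left_eq_self (fun τ ↦ (Ioi (2 * T)).indicator F τ) α]
      refine integral_congr_ae (Eventually.of_forall fun r ↦ ?_)
      simp only [Set.indicator_apply, mem_Ioi]
      have : 2 * T < α + r ↔ 2 * T - α < r := by constructor <;> intro h <;> linarith
      simp only [this]
    rw [e1]
    have hsub : ((d - 1 - k : ℕ) : ℝ) * h ≤ 2 * T - α := by
      have hd : k ≤ d - 1 := Nat.le_sub_one_of_lt hk
      have hd1 : 1 ≤ d := by omega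
      rw [Nat.cast_sub hd, Nat.cast_sub hd1, hαdef]
      push_cast
      nlinarith
    have h0' : 0 ≤ ((d - 1 - k : ℕ) : ℝ) * h := by positivity
    calc ∫ r in Ioi (2 * T - α), F (α + r) ≤ ∫ r in Ioi (2 * T - α), G r :=
          setIntegral_mono_on (hFi.comp_add_left α).integrableOn
            (hGi.mono_set (Ioi_subset_Ioi (h0'.trans hsub))) measurableSet_Ioi hdomR
      _ ≤ ∫ r in Ioi (((d - 1 - k : ℕ) : ℝ) * h), G r :=
          setIntegral_mono_set (hGi.mono_set (Ioi_subset_Ioi h0'))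
            ((ae_restrict_iff' measurableSet_Ioi).2 (ae_of_all _ fun r hr ↦
              hG0 r (lt_of_le_of_lt h0' hr)))
            (Ioi_subset_Ioi hsub).eventuallyLE
  exact add_le_add hL hR

/-- `d h ≤ T` (`d = ⌊LT/2π⌋`, `h = 2π/L`, `T, L > 0`). [cite: AlpogeFurman2026, §2.2 (p. 4: "`α_0,…,α_{d−1} ∈ [T,2T)`")] -/
theorem gridDim_mul_step_le' {T : ℝ} (hT : 0 < T) (hL : 0 < logHeight T) :
    (gridDim T : ℝ) * (2 * π / logHeight T) ≤ T := by
  have hπ := Real.pi_pos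
  have h1 : (gridDim T : ℝ) ≤ logHeight T * T / (2 * π) := by
    rw [gridDim]; exact Nat.floor_le (by positivity)
  calc (gridDim T : ℝ) * (2 * π / logHeight T) ≤ logHeight T * T / (2 * π) * (2 * π / logHeight T) :=
        mul_le_mul_of_nonneg_right h1 (by positivity)
    _ = T := by field_simp

/-- The grid points lie in the window: `α_k ∈ [T, 2T]` for `0 ≤ k < d` (`T, L > 0`).
[cite: AlpogeFurman2026, §2.2 (p. 4: "`α_0,…,α_{d−1} ∈ [T,2T)`")] -/
theorem grid_mem_Icc {T : ℝ} (hT : 0 < T) (hL : 0 < logHeight T) (k : Fin (gridDim T)) :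
    grid T (logHeight T) ((k : ℕ) : ℤ) ∈ Icc T (2 * T) := by
  have hπ := Real.pi_pos
  have hk : ((k : ℕ) : ℝ) + 1 ≤ gridDim T := by exact_mod_cast k.2
  have hdh := gridDim_mul_step_le' hT hL
  rw [grid]
  push_cast
  constructor
  · have : 0 ≤ 2 * π * ((k : ℕ) : ℝ) / logHeight T := by positivity
    linarith
  · have : 2 * π * ((k : ℕ) : ℝ) / logHeight T ≤ T := by
      calc 2 * π * ((k : ℕ) : ℝ) / logHeight T = ((k : ℕ) : ℝ) * (2 * π / logHeight T) := by ring
        _ ≤ (gridDim T : ℝ) * (2 * π / logHeight T) :=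
            mul_le_mul_of_nonneg_right (by linarith) (by positivity)
        _ ≤ T := hdh
    linarith

/-- **The off-block mass of the Gabor system against the weight**:
`Σ_{k<d} (∫_{τ<T} + ∫_{τ>2T}) ω(τ) ϑ(τ−α_k)² dτ ≤ 2∫_{r>0} (1 + r/h) G(r) dr` for any `G ≥ 0`
dominating `ϑ(r)²(1+√2+√(r/T))` (with `G`, `rG` integrable). This replaces the source's
"`∫_{τ∉I}|ν_X|σ ≪ BLl`" (p. 9). [cite: AlpogeFurman2026, Proposition 5.2 (proof), p. 9] -/
theorem offBlock_sum_le {M A : ℝ} (hM : 0 < M) (hA : 0 < A) {T : ℝ} (hT : 0 < T)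
    (hL : 0 < logHeight T) {G : ℝ → ℝ} (hG0 : ∀ r, 0 < r → 0 ≤ G r) (hGi : IntegrableOn G (Ioi 0))
    (hGx : IntegrableOn (fun r ↦ r * G r) (Ioi 0))
    (hGdom : ∀ r, 0 < r → lorentz M A r ^ 2 * (1 + Real.sqrt 2 + Real.sqrt (r / T)) ≤ G r) :
    ∑ k : Fin (gridDim T), ((∫ τ in Iio T, wt T τ *
        lorentz M A (τ - grid T (logHeight T) ((k : ℕ) : ℤ)) ^ 2) +
      ∫ τ in Ioi (2 * T), wt T τ * lorentz M A (τ - grid T (logHeight T) ((k : ℕ) : ℤ)) ^ 2) ≤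
      2 * ∫ r in Ioi 0, (1 + r / (2 * π / logHeight T)) * G r := by
  have hπ := Real.pi_pos
  set L := logHeight T with hLdef
  set h : ℝ := 2 * π / L with hh
  have hh0 : 0 < h := by positivity
  set d := gridDim T with hd
  have hdh : ((d : ℝ) - 1) * h ≤ T := by
    have := gridDim_mul_step_le' hT hL
    rw [← hd, ← hLdef, ← hh] at this
    nlinarith
  have egrid : ∀ k : ℕ, grid T L ((k : ℕ) : ℤ) = T + (k : ℝ) * h := by
    intro k; rw [grid, hh]; push_cast; ring
  simp_rw [egrid]
  rw [Fin.sum_univ_eq_sum_range (fun k : ℕ ↦ (∫ τ in Iio T, wt T τ * lorentz M A (τ - (T + (k : ℝ) * h)) ^ 2) +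
    ∫ τ in Ioi (2 * T), wt T τ * lorentz M A (τ - (T + (k : ℝ) * h)) ^ 2) d]
  have h1 : ∑ k ∈ Finset.range d, ((∫ τ in Iio T, wt T τ * lorentz M A (τ - (T + (k : ℝ) * h)) ^ 2) +
      ∫ τ in Ioi (2 * T), wt T τ * lorentz M A (τ - (T + (k : ℝ) * h)) ^ 2) ≤
      ∑ k ∈ Finset.range d, ((∫ r in Ioi ((k : ℝ) * h), G r) +
        ∫ r in Ioi (((d - 1 - k : ℕ) : ℝ) * h), G r) :=
    Finset.sum_le_sum fun k hk ↦ offBlock_one_le hM hA hT hh0 (Finset.mem_range.1 hk) hdh hG0 hGi hGdom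
  refine h1.trans ?_
  rw [Finset.sum_add_distrib, Finset.sum_range_reflect (fun k : ℕ ↦ ∫ r in Ioi ((k : ℝ) * h), G r) d,
    ← two_mul]
  exact mul_le_mul_of_nonneg_left (sum_setIntegral_Ioi_le hG0 hGi hGx hh0 d) (by norm_num)

/-! ## §R4. The kernel estimate `∫ K(τ,τ′)² ω(τ) dτ ≪ Σ_k φ̂(τ′−α_k)²` -/

/-- Pointwise: `K(τ,τ′)² ≤ σ(τ) · Σ_k ϑ(τ−α_k) φ̂(τ′−α_k)²` with `σ(τ) = Σ_k ϑ(τ−α_k)` (weighted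
Cauchy–Schwarz), given the majorant `|φ̂ʳ| ≤ ϑ`. [cite: AlpogeFurman2026, §5.2 eq. (5.9) (p. 8)] -/
theorem kerK_sq_le {M A : ℝ} (hM : 0 < M) (hA : 0 < A) {T : ℝ}
    (hmaj : ∀ ξ : ℝ, |hatR ψ T ξ| ≤ lorentz M A ξ) (τ τ' : ℝ) :
    kerK ψ T τ τ' ^ 2 ≤
      (∑ k : Fin (gridDim T), lorentz M A (τ - grid T (logHeight T) ((k : ℕ) : ℤ))) *
        ∑ k : Fin (gridDim T), lorentz M A (τ - grid T (logHeight T) ((k : ℕ) : ℤ)) *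
          hatR ψ T (τ' - grid T (logHeight T) ((k : ℕ) : ℤ)) ^ 2 := by
  set ϑk : Fin (gridDim T) → ℝ := fun k ↦ lorentz M A (τ - grid T (logHeight T) ((k : ℕ) : ℤ))
  set ak : Fin (gridDim T) → ℝ := fun k ↦ |hatR ψ T (τ' - grid T (logHeight T) ((k : ℕ) : ℤ))|
  have h1 : |kerK ψ T τ τ'| ≤ ∑ k, ϑk k * ak k := by
    rw [kerK]
    refine (Finset.abs_sum_le_sum_abs _ _).trans (Finset.sum_le_sum fun k _ ↦ ?_)
    rw [abs_mul]
    exact mul_le_mul_of_nonneg_right (hmaj _) (abs_nonneg _)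
  have h2 : kerK ψ T τ τ' ^ 2 ≤ (∑ k, ϑk k * ak k) ^ 2 := by
    rw [← sq_abs (kerK ψ T τ τ')]
    exact pow_le_pow_left₀ (abs_nonneg _) h1 2
  have h3 : (∑ k, ϑk k * ak k) ^ 2 ≤ (∑ k, ϑk k) * ∑ k, ϑk k * ak k ^ 2 :=
    Finset.sum_sq_le_sum_mul_sum_of_sq_le_mul Finset.univ (fun k _ ↦ (lorentz_pos hM hA _).le)
      (fun k _ ↦ mul_nonneg (lorentz_pos hM hA _).le (sq_nonneg _)) (fun k _ ↦ by ring_nf; rfl)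
  refine h2.trans (h3.trans (le_of_eq ?_))
  simp only [ϑk, ak, sq_abs]

/-- **The kernel estimate**: with `σ ≤ Σ₁` (uniformly) and `Θ_ω ≥ ∫ϑ(τ−α_k)ω(τ)dτ` for every grid
point, `∫_ℝ K(τ,τ′)² ω(τ) dτ ≤ Σ₁ Θ_ω Σ_k φ̂(τ′−α_k)²`. This is the sharpened form of the source's
"`K² ≤ aL²|K| ≤ L² Σ_k ϑ(τ−α_k)ϑ(τ′−α_k)`" step that keeps the localisation in `|τ − τ′|`.
[cite: AlpogeFurman2026, Proposition 5.2 (proof, bound for `𝓔₂`), p. 9] -/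
theorem integral_kerK_sq_wt_le (hψ : IsWindow ψ) {M A : ℝ} (hM : 0 < M) (hA : 0 < A) {T : ℝ}
    (hT : 0 < T) (hL : 0 < logHeight T) (hmaj : ∀ ξ : ℝ, |hatR ψ T ξ| ≤ lorentz M A ξ)
    {S₁ Θw : ℝ}
    (hS₁ : ∀ τ : ℝ, ∑ k : Fin (gridDim T), lorentz M A (τ - grid T (logHeight T) ((k : ℕ) : ℤ)) ≤ S₁)
    (hΘw : ∀ k : Fin (gridDim T),
      ∫ τ : ℝ, lorentz M A (τ - grid T (logHeight T) ((k : ℕ) : ℤ)) * wt T τ ≤ Θw) (τ' : ℝ) :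
    Integrable (fun τ : ℝ ↦ kerK ψ T τ τ' ^ 2 * wt T τ) ∧
      ∫ τ : ℝ, kerK ψ T τ τ' ^ 2 * wt T τ ≤
        S₁ * Θw * ∑ k : Fin (gridDim T), hatR ψ T (τ' - grid T (logHeight T) ((k : ℕ) : ℤ)) ^ 2 := by
  have hπ := Real.pi_pos
  set L := logHeight T with hLdef
  set α : Fin (gridDim T) → ℝ := fun k ↦ grid T L ((k : ℕ) : ℤ) with hαdef
  have hαI : ∀ k : Fin (gridDim T), α k ∈ Icc T (2 * T) := fun k ↦ grid_mem_Icc hT hL k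
  set a2 : Fin (gridDim T) → ℝ := fun k ↦ hatR ψ T (τ' - α k) ^ 2 with ha2
  -- the dominating function
  set D : ℝ → ℝ := fun τ ↦ S₁ * ∑ k, a2 k * (lorentz M A (τ - α k) * wt T τ) with hD
  have hwint : ∀ k, Integrable fun τ : ℝ ↦ lorentz M A (τ - α k) * wt T τ := fun k ↦
    (integral_lorentz_weight_le hM hA hT (hαI k)).1
  have hDi : Integrable D := by
    rw [hD]
    exact (integrable_finsetSum _ fun k _ ↦ (hwint k).const_mul _).const_mul _
  have hS₁0 : 0 ≤ S₁ := (Finset.sum_nonneg fun k _ ↦ (lorentz_pos hM hA _).le).trans (hS₁ 0)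
  have hdom : ∀ τ, kerK ψ T τ τ' ^ 2 * wt T τ ≤ D τ := by
    intro τ
    have hw := (wt_pos T τ).1.le
    have h1 := kerK_sq_le hM hA hmaj τ τ' (ψ := ψ)
    calc kerK ψ T τ τ' ^ 2 * wt T τ
        ≤ ((∑ k, lorentz M A (τ - α k)) * ∑ k, lorentz M A (τ - α k) * hatR ψ T (τ' - α k) ^ 2) *
            wt T τ := mul_le_mul_of_nonneg_right h1 hw
      _ ≤ (S₁ * ∑ k, lorentz M A (τ - α k) * hatR ψ T (τ' - α k) ^ 2) * wt T τ := by
          gcongr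
          · exact Finset.sum_nonneg fun k _ ↦ mul_nonneg (lorentz_pos hM hA _).le (sq_nonneg _)
          · exact hS₁ τ
      _ = D τ := by
          rw [hD]; dsimp only
          rw [mul_assoc, Finset.sum_mul]
          congr 1
          refine Finset.sum_congr rfl fun k _ ↦ ?_
          ring
  have hKc : Continuous fun τ : ℝ ↦ kerK ψ T τ τ' ^ 2 * wt T τ := by
    refine (Continuous.pow ?_ 2).mul (wt_pos T 0).2.2
    unfold kerK
    refine continuous_finsetSum _ fun k _ ↦ ?_
    exact ((continuous_hatR hψ T).1.comp (continuous_id.sub continuous_const)).mul continuous_const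
  have hKi : Integrable (fun τ : ℝ ↦ kerK ψ T τ τ' ^ 2 * wt T τ) := by
    refine hDi.mono' hKc.aestronglyMeasurable (Eventually.of_forall fun τ ↦ ?_)
    rw [Real.norm_eq_abs, abs_of_nonneg (mul_nonneg (sq_nonneg _) (wt_pos T τ).1.le)]
    exact hdom τ
  refine ⟨hKi, (integral_mono hKi hDi hdom).trans ?_⟩
  rw [hD, integral_const_mul, integral_finsetSum _ fun k _ ↦ (hwint k).const_mul _]
  simp_rw [integral_const_mul]
  rw [mul_assoc]
  refine mul_le_mul_of_nonneg_left ?_ hS₁0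
  rw [Finset.mul_sum]
  refine Finset.sum_le_sum fun k _ ↦ ?_
  rw [mul_comm]
  exact mul_le_mul_of_nonneg_right (hΘw k) (sq_nonneg _)

/-! ## §R5. The off-block part of `Σ s²`

With `I = [T, 2T]`, `s_{kk′} = s^I_{kk′} + s^O_{kk′}` (integrals over `I` and its complement) and
`Σ s² − Σ (s^I)² = Σ s^O (s + s^I) = ∫_{τ′∉I} ν(τ′) [∫_ℝ K(τ,τ′)²ν(τ)dτ + ∫_I K(τ,τ′)²ν(τ)dτ] dτ′`. -/

/-- The window block `I = [T, 2T]` part of an entry: `s^I_{kk′} := ∫_I φ̂(τ−α_k)φ̂(τ−α_{k′})ν_X(τ)dτ`.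
[cite: AlpogeFurman2026, Proposition 5.2 (proof: "`∬_{I×I} K² νν′`"), p. 8] -/
def sEntryI (ψ : ℝ → ℝ) (T : ℝ) (k k' : Fin (gridDim T)) : ℝ :=
  ∫ τ in Icc T (2 * T), hatR ψ T (τ - grid T (logHeight T) ((k : ℕ) : ℤ)) *
    hatR ψ T (τ - grid T (logHeight T) ((k' : ℕ) : ℤ)) * weilDensity (T / (2 * π)) τ

/-- `Σ_{k,k′} φ̂(τ′−α_k)φ̂(τ′−α_{k′}) ∫_S φ̂(τ−α_k)φ̂(τ−α_{k′})ν(τ)dτ = ∫_S K(τ,τ′)² ν(τ) dτ` for a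
measurable `S` (finite sums commute with the integral). [cite: AlpogeFurman2026, §5.2 (p. 8: "`(aL²)²‖G̃+Ẽ‖²_HS = ∬K²νν′`")] -/
theorem sum_mul_setIntegral_eq (hψ : IsWindow ψ) {T : ℝ} (hL : 10 ≤ logHeight T) (S : Set ℝ)
    (τ' : ℝ) :
    ∑ k : Fin (gridDim T), ∑ k' : Fin (gridDim T),
        hatR ψ T (τ' - grid T (logHeight T) ((k : ℕ) : ℤ)) * hatR ψ T (τ' - grid T (logHeight T) ((k' : ℕ) : ℤ)) *
          ∫ τ in S, hatR ψ T (τ - grid T (logHeight T) ((k : ℕ) : ℤ)) *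
            hatR ψ T (τ - grid T (logHeight T) ((k' : ℕ) : ℤ)) * weilDensity (T / (2 * π)) τ =
      ∫ τ in S, kerK ψ T τ τ' ^ 2 * weilDensity (T / (2 * π)) τ := by
  have hint : ∀ k k' : Fin (gridDim T), IntegrableOn (fun τ ↦
      hatR ψ T (τ - grid T (logHeight T) ((k : ℕ) : ℤ)) *
        hatR ψ T (τ - grid T (logHeight T) ((k' : ℕ) : ℤ)) * weilDensity (T / (2 * π)) τ) S :=
    fun k k' ↦ (integrable_gramIntegrand hψ hL _ _).integrableOn
  simp_rw [← integral_const_mul]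
  have inner : ∀ k : Fin (gridDim T), ∑ k' : Fin (gridDim T), ∫ τ in S,
      hatR ψ T (τ' - grid T (logHeight T) ((k : ℕ) : ℤ)) * hatR ψ T (τ' - grid T (logHeight T) ((k' : ℕ) : ℤ)) *
        (hatR ψ T (τ - grid T (logHeight T) ((k : ℕ) : ℤ)) *
          hatR ψ T (τ - grid T (logHeight T) ((k' : ℕ) : ℤ)) * weilDensity (T / (2 * π)) τ) =
      ∫ τ in S, ∑ k' : Fin (gridDim T),
        hatR ψ T (τ' - grid T (logHeight T) ((k : ℕ) : ℤ)) * hatR ψ T (τ' - grid T (logHeight T) ((k' : ℕ) : ℤ)) *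
          (hatR ψ T (τ - grid T (logHeight T) ((k : ℕ) : ℤ)) *
            hatR ψ T (τ - grid T (logHeight T) ((k' : ℕ) : ℤ)) * weilDensity (T / (2 * π)) τ) :=
    fun k ↦ (integral_finsetSum _ fun k' _ ↦ (hint k k').const_mul _).symm
  simp_rw [inner]
  rw [← integral_finsetSum _ (fun k _ ↦ integrable_finsetSum _ fun k' _ ↦ (hint k k').const_mul _)]
  refine integral_congr_ae (Eventually.of_forall fun τ ↦ ?_)
  dsimp only
  rw [kerK, sq, Finset.sum_mul_sum, Finset.sum_mul]
  refine Finset.sum_congr rfl fun k _ ↦ ?_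
  rw [Finset.sum_mul]
  refine Finset.sum_congr rfl fun k' _ ↦ ?_
  ring

/-- `|∫_S K(τ,τ′)² ν(τ) dτ| ≤ B_ν S₁ Θ_ω Σ_k φ̂(τ′−α_k)²` for any measurable `S` (from §R4 and
`|ν| ≤ B_ν ω`). [cite: AlpogeFurman2026, Proposition 5.2 (proof, bound for `𝓔₂`), p. 9] -/
theorem abs_setIntegral_kerK_sq_le (hψ : IsWindow ψ) {M A : ℝ} (hM : 0 < M) (hA : 0 < A) {T : ℝ}
    (hT : 0 < T) (hL : 0 < logHeight T) (hmaj : ∀ ξ : ℝ, |hatR ψ T ξ| ≤ lorentz M A ξ)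
    {Bν : ℝ} (hν : ∀ τ : ℝ, |weilDensity (T / (2 * π)) τ| ≤ Bν * wt T τ) {S₁ Θw : ℝ}
    (hS₁ : ∀ τ : ℝ, ∑ k : Fin (gridDim T), lorentz M A (τ - grid T (logHeight T) ((k : ℕ) : ℤ)) ≤ S₁)
    (hΘw : ∀ k : Fin (gridDim T),
      ∫ τ : ℝ, lorentz M A (τ - grid T (logHeight T) ((k : ℕ) : ℤ)) * wt T τ ≤ Θw)
    (S : Set ℝ) (τ' : ℝ) :
    IntegrableOn (fun τ : ℝ ↦ kerK ψ T τ τ' ^ 2 * weilDensity (T / (2 * π)) τ) S ∧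
    |∫ τ in S, kerK ψ T τ τ' ^ 2 * weilDensity (T / (2 * π)) τ| ≤
      Bν * (S₁ * Θw) * ∑ k : Fin (gridDim T), hatR ψ T (τ' - grid T (logHeight T) ((k : ℕ) : ℤ)) ^ 2 := by
  obtain ⟨hKi, hKle⟩ := integral_kerK_sq_wt_le hψ hM hA hT hL hmaj hS₁ hΘw τ'
  have hB0 : 0 ≤ Bν := by
    have h := hν 0
    have hw := (wt_pos T 0).1
    nlinarith [abs_nonneg (weilDensity (T / (2 * π)) 0)]
  have hdom : ∀ τ, |kerK ψ T τ τ' ^ 2 * weilDensity (T / (2 * π)) τ| ≤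
      Bν * (kerK ψ T τ τ' ^ 2 * wt T τ) := by
    intro τ
    rw [abs_mul, abs_of_nonneg (sq_nonneg _)]
    calc kerK ψ T τ τ' ^ 2 * |weilDensity (T / (2 * π)) τ| ≤ kerK ψ T τ τ' ^ 2 * (Bν * wt T τ) :=
          mul_le_mul_of_nonneg_left (hν τ) (sq_nonneg _)
      _ = Bν * (kerK ψ T τ τ' ^ 2 * wt T τ) := by ring
  have hcont : Continuous fun τ : ℝ ↦ kerK ψ T τ τ' ^ 2 * weilDensity (T / (2 * π)) τ := by
    refine (Continuous.pow ?_ 2).mul (continuous_weilDensity _)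
    unfold kerK
    refine continuous_finsetSum _ fun k _ ↦ ?_
    exact ((continuous_hatR hψ T).1.comp (continuous_id.sub continuous_const)).mul continuous_const
  have hint : Integrable fun τ : ℝ ↦ kerK ψ T τ τ' ^ 2 * weilDensity (T / (2 * π)) τ :=
    (hKi.const_mul Bν).mono' hcont.aestronglyMeasurable (Eventually.of_forall fun τ ↦ by
      rw [Real.norm_eq_abs]; exact hdom τ)
  refine ⟨hint.integrableOn, ?_⟩
  calc |∫ τ in S, kerK ψ T τ τ' ^ 2 * weilDensity (T / (2 * π)) τ|
      ≤ ∫ τ in S, |kerK ψ T τ τ' ^ 2 * weilDensity (T / (2 * π)) τ| := abs_integral_le_integral_abs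
    _ ≤ ∫ τ, |kerK ψ T τ τ' ^ 2 * weilDensity (T / (2 * π)) τ| :=
        setIntegral_le_integral hint.abs (Eventually.of_forall fun τ ↦ abs_nonneg _)
    _ ≤ ∫ τ, Bν * (kerK ψ T τ τ' ^ 2 * wt T τ) := integral_mono hint.abs (hKi.const_mul Bν) hdom
    _ = Bν * ∫ τ, kerK ψ T τ τ' ^ 2 * wt T τ := integral_const_mul _ _
    _ ≤ Bν * (S₁ * Θw * ∑ k : Fin (gridDim T), hatR ψ T (τ' - grid T (logHeight T) ((k : ℕ) : ℤ)) ^ 2) :=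
        mul_le_mul_of_nonneg_left hKle hB0
    _ = _ := by ring

/-- `(Icc T (2T))ᶜ = (−∞, T) ∪ (2T, ∞)`. [folklore] -/
private theorem compl_Icc_eq (T : ℝ) : (Icc T (2 * T))ᶜ = Iio T ∪ Ioi (2 * T) := by
  ext x
  simp only [mem_compl_iff, mem_Icc, mem_union, mem_Iio, mem_Ioi]
  constructor
  · intro hx
    rcases lt_or_ge x T with h | h
    · exact Or.inl h
    · right; by_contra h2; exact hx ⟨h, not_lt.1 h2⟩
  · rintro (h | h) ⟨h1, h2⟩ <;> linarith

/-- **The off-block estimate** (regions `I × Iᶜ`, `Iᶜ × ℝ` of the source's `𝓔₂`):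
`|Σ_{kk′} s² − Σ_{kk′} (s^I)²| ≤ 2B_ν² S₁Θ_ω · 2∫_{r>0}(1 + r/h)G`, for any admissible `G` (see
`offBlock_sum_le`). [cite: AlpogeFurman2026, Proposition 5.2 (proof, bound for `𝓔₂`), p. 9] -/
theorem offBlock_le (hψ : IsWindow ψ) {M A : ℝ} (hM : 0 < M) (hA : 0 < A) {T : ℝ}
    (hT : 0 < T) (hL : 10 ≤ logHeight T) (hmaj : ∀ ξ : ℝ, |hatR ψ T ξ| ≤ lorentz M A ξ)
    {Bν : ℝ} (hν : ∀ τ : ℝ, |weilDensity (T / (2 * π)) τ| ≤ Bν * wt T τ) {S₁ Θw : ℝ}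
    (hS₁ : ∀ τ : ℝ, ∑ k : Fin (gridDim T), lorentz M A (τ - grid T (logHeight T) ((k : ℕ) : ℤ)) ≤ S₁)
    (hΘw : ∀ k : Fin (gridDim T),
      ∫ τ : ℝ, lorentz M A (τ - grid T (logHeight T) ((k : ℕ) : ℤ)) * wt T τ ≤ Θw)
    {G : ℝ → ℝ} (hG0 : ∀ r, 0 < r → 0 ≤ G r) (hGi : IntegrableOn G (Ioi 0))
    (hGx : IntegrableOn (fun r ↦ r * G r) (Ioi 0))
    (hGdom : ∀ r, 0 < r → lorentz M A r ^ 2 * (1 + Real.sqrt 2 + Real.sqrt (r / T)) ≤ G r)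
    (hΘw0 : 0 ≤ Θw) :
    |∑ k : Fin (gridDim T), ∑ k' : Fin (gridDim T), sEntry ψ T k k' ^ 2 -
        ∑ k : Fin (gridDim T), ∑ k' : Fin (gridDim T), sEntryI ψ T k k' ^ 2| ≤
      2 * Bν ^ 2 * (S₁ * Θw) * (2 * ∫ r in Ioi 0, (1 + r / (2 * π / logHeight T)) * G r) := by
  have hπ := Real.pi_pos
  have hL0 : 0 < logHeight T := by linarith
  have hS₁0 : 0 ≤ S₁ := (Finset.sum_nonneg fun k _ ↦ (lorentz_pos hM hA _).le).trans (hS₁ 0)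
  have hI : MeasurableSet (Icc T (2 * T)) := measurableSet_Icc
  have hB0 : 0 ≤ Bν := by
    have h := hν 0
    have hw := (wt_pos T 0).1
    nlinarith [abs_nonneg (weilDensity (T / (2 * π)) 0)]
  -- the integrands
  have hg : ∀ k k' : Fin (gridDim T), Integrable fun τ ↦ hatR ψ T (τ - grid T (logHeight T) ((k : ℕ) : ℤ)) * hatR ψ T (τ - grid T (logHeight T) ((k' : ℕ) : ℤ)) * weilDensity (T / (2 * π)) τ :=
    fun k k' ↦ integrable_gramIntegrand hψ hL _ _
  -- `s = s^I + s^O`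
  have hsplit : ∀ k k' : Fin (gridDim T), sEntry ψ T k k' = sEntryI ψ T k k' +
      ∫ τ in (Icc T (2 * T))ᶜ, hatR ψ T (τ - grid T (logHeight T) ((k : ℕ) : ℤ)) * hatR ψ T (τ - grid T (logHeight T) ((k' : ℕ) : ℤ)) * weilDensity (T / (2 * π)) τ := by
    intro k k'
    rw [sEntry, sEntryI, integral_add_compl hI (hg k k')]
  -- `Σ s² − Σ (s^I)² = Σ s^O (s + s^I)`, as one integral over `Iᶜ`
  have hrepr : ∑ k : Fin (gridDim T), ∑ k' : Fin (gridDim T), sEntry ψ T k k' ^ 2 -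
      ∑ k : Fin (gridDim T), ∑ k' : Fin (gridDim T), sEntryI ψ T k k' ^ 2 =
      ∫ τ' in (Icc T (2 * T))ᶜ, ∑ k : Fin (gridDim T), ∑ k' : Fin (gridDim T),
        hatR ψ T (τ' - grid T (logHeight T) ((k : ℕ) : ℤ)) * hatR ψ T (τ' - grid T (logHeight T) ((k' : ℕ) : ℤ)) * weilDensity (T / (2 * π)) τ' * (sEntry ψ T k k' + sEntryI ψ T k k') := by
    rw [integral_finsetSum _ fun k _ ↦ integrable_finsetSum _ fun k' _ ↦
      ((hg k k').mul_const _).integrableOn, ← Finset.sum_sub_distrib]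
    refine Finset.sum_congr rfl fun k _ ↦ ?_
    rw [integral_finsetSum _ fun k' _ ↦ ((hg k k').mul_const _).integrableOn, ← Finset.sum_sub_distrib]
    refine Finset.sum_congr rfl fun k' _ ↦ ?_
    rw [integral_mul_const, hsplit]
    ring
  -- pointwise value and bound of the integrand
  have hval : ∀ τ' : ℝ, ∑ k : Fin (gridDim T), ∑ k' : Fin (gridDim T),
      hatR ψ T (τ' - grid T (logHeight T) ((k : ℕ) : ℤ)) * hatR ψ T (τ' - grid T (logHeight T) ((k' : ℕ) : ℤ)) * weilDensity (T / (2 * π)) τ' * (sEntry ψ T k k' + sEntryI ψ T k k') =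
      weilDensity (T / (2 * π)) τ' * ((∫ τ in Set.univ, kerK ψ T τ τ' ^ 2 * weilDensity (T / (2 * π)) τ) +
        ∫ τ in Icc T (2 * T), kerK ψ T τ τ' ^ 2 * weilDensity (T / (2 * π)) τ) := by
    intro τ'
    rw [← sum_mul_setIntegral_eq hψ hL Set.univ τ', ← sum_mul_setIntegral_eq hψ hL (Icc T (2 * T)) τ',
      ← Finset.sum_add_distrib, Finset.mul_sum]
    refine Finset.sum_congr rfl fun k _ ↦ ?_
    rw [← Finset.sum_add_distrib, Finset.mul_sum]
    refine Finset.sum_congr rfl fun k' _ ↦ ?_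
    rw [sEntry, sEntryI, setIntegral_univ]
    ring
  have hbd : ∀ τ' : ℝ, |∑ k : Fin (gridDim T), ∑ k' : Fin (gridDim T),
      hatR ψ T (τ' - grid T (logHeight T) ((k : ℕ) : ℤ)) * hatR ψ T (τ' - grid T (logHeight T) ((k' : ℕ) : ℤ)) * weilDensity (T / (2 * π)) τ' * (sEntry ψ T k k' + sEntryI ψ T k k')| ≤
      2 * Bν ^ 2 * (S₁ * Θw) * (wt T τ' * ∑ k : Fin (gridDim T), lorentz M A (τ' - grid T (logHeight T) ((k : ℕ) : ℤ)) ^ 2) := by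
    intro τ'
    rw [hval, abs_mul]
    obtain ⟨-, h1⟩ := abs_setIntegral_kerK_sq_le hψ hM hA hT hL0 hmaj hν hS₁ hΘw Set.univ τ'
    obtain ⟨-, h2⟩ := abs_setIntegral_kerK_sq_le hψ hM hA hT hL0 hmaj hν hS₁ hΘw (Icc T (2 * T)) τ'
    have h3 : ∑ k : Fin (gridDim T), hatR ψ T (τ' - grid T (logHeight T) ((k : ℕ) : ℤ)) ^ 2 ≤ ∑ k : Fin (gridDim T), lorentz M A (τ' - grid T (logHeight T) ((k : ℕ) : ℤ)) ^ 2 := by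
      refine Finset.sum_le_sum fun k _ ↦ ?_
      rw [← sq_abs]
      exact pow_le_pow_left₀ (abs_nonneg _) (hmaj _) 2
    have h4 := (abs_add_le _ _).trans (add_le_add h1 h2)
    have hw0 := (wt_pos T τ').1.le
    have hSΘ : 0 ≤ Bν * (S₁ * Θw) * ∑ k : Fin (gridDim T), hatR ψ T (τ' - grid T (logHeight T) ((k : ℕ) : ℤ)) ^ 2 := (abs_nonneg _).trans h1
    calc |weilDensity (T / (2 * π)) τ'| * |(∫ τ in Set.univ, kerK ψ T τ τ' ^ 2 * weilDensity (T / (2 * π)) τ) +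
          ∫ τ in Icc T (2 * T), kerK ψ T τ τ' ^ 2 * weilDensity (T / (2 * π)) τ|
        ≤ (Bν * wt T τ') * (2 * (Bν * (S₁ * Θw) * ∑ k : Fin (gridDim T), hatR ψ T (τ' - grid T (logHeight T) ((k : ℕ) : ℤ)) ^ 2)) :=
          mul_le_mul (hν τ') (by linarith) (abs_nonneg _) (mul_nonneg hB0 hw0)
      _ = 2 * Bν * wt T τ' * (Bν * (S₁ * Θw) * ∑ k : Fin (gridDim T), hatR ψ T (τ' - grid T (logHeight T) ((k : ℕ) : ℤ)) ^ 2) := by ring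
      _ ≤ 2 * Bν * wt T τ' * (Bν * (S₁ * Θw) * ∑ k : Fin (gridDim T), lorentz M A (τ' - grid T (logHeight T) ((k : ℕ) : ℤ)) ^ 2) := by
          refine mul_le_mul_of_nonneg_left ?_ (by positivity)
          exact mul_le_mul_of_nonneg_left h3 (by positivity)
      _ = _ := by ring
  -- integrate the pointwise bound over `Iᶜ = (−∞,T) ∪ (2T,∞)`
  have hFint : IntegrableOn (fun τ' : ℝ ↦ ∑ k : Fin (gridDim T), ∑ k' : Fin (gridDim T),
      hatR ψ T (τ' - grid T (logHeight T) ((k : ℕ) : ℤ)) * hatR ψ T (τ' - grid T (logHeight T) ((k' : ℕ) : ℤ)) * weilDensity (T / (2 * π)) τ' *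
        (sEntry ψ T k k' + sEntryI ψ T k k')) (Icc T (2 * T))ᶜ :=
    (integrable_finsetSum _ fun k _ ↦ integrable_finsetSum _ fun k' _ ↦
      (hg k k').mul_const _).integrableOn
  have hWint : ∀ k : Fin (gridDim T), Integrable fun τ' : ℝ ↦ wt T τ' * lorentz M A (τ' - grid T (logHeight T) ((k : ℕ) : ℤ)) ^ 2 :=
    fun k ↦ integrable_wt_mul_lorentz_sq hM hA hT (grid_mem_Icc hT hL0 k)
  have hBint : Integrable fun τ' : ℝ ↦ 2 * Bν ^ 2 * (S₁ * Θw) *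
      (wt T τ' * ∑ k : Fin (gridDim T), lorentz M A (τ' - grid T (logHeight T) ((k : ℕ) : ℤ)) ^ 2) := by
    have e : (fun τ' : ℝ ↦ 2 * Bν ^ 2 * (S₁ * Θw) * (wt T τ' * ∑ k : Fin (gridDim T), lorentz M A (τ' - grid T (logHeight T) ((k : ℕ) : ℤ)) ^ 2)) =
        fun τ' : ℝ ↦ 2 * Bν ^ 2 * (S₁ * Θw) * ∑ k : Fin (gridDim T), wt T τ' * lorentz M A (τ' - grid T (logHeight T) ((k : ℕ) : ℤ)) ^ 2 := by
      funext τ'; rw [Finset.mul_sum]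
    rw [e]
    exact (integrable_finsetSum _ fun k _ ↦ hWint k).const_mul _
  have hdisj : Disjoint (Iio T) (Ioi (2 * T)) :=
    Set.disjoint_left.2 fun x hx hx' ↦ by
      have h1 := mem_Iio.1 hx; have h2 := mem_Ioi.1 hx'; linarith
  rw [hrepr]
  calc |∫ τ' in (Icc T (2 * T))ᶜ, ∑ k : Fin (gridDim T), ∑ k' : Fin (gridDim T),
          hatR ψ T (τ' - grid T (logHeight T) ((k : ℕ) : ℤ)) * hatR ψ T (τ' - grid T (logHeight T) ((k' : ℕ) : ℤ)) * weilDensity (T / (2 * π)) τ' *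
            (sEntry ψ T k k' + sEntryI ψ T k k')|
      ≤ ∫ τ' in (Icc T (2 * T))ᶜ, |∑ k : Fin (gridDim T), ∑ k' : Fin (gridDim T),
          hatR ψ T (τ' - grid T (logHeight T) ((k : ℕ) : ℤ)) * hatR ψ T (τ' - grid T (logHeight T) ((k' : ℕ) : ℤ)) * weilDensity (T / (2 * π)) τ' *
            (sEntry ψ T k k' + sEntryI ψ T k k')| := abs_integral_le_integral_abs
    _ ≤ ∫ τ' in (Icc T (2 * T))ᶜ, 2 * Bν ^ 2 * (S₁ * Θw) *
          (wt T τ' * ∑ k : Fin (gridDim T), lorentz M A (τ' - grid T (logHeight T) ((k : ℕ) : ℤ)) ^ 2) :=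
        setIntegral_mono_on hFint.abs hBint.integrableOn hI.compl fun τ' _ ↦ hbd τ'
    _ = 2 * Bν ^ 2 * (S₁ * Θw) * ∑ k : Fin (gridDim T),
          ∫ τ' in (Icc T (2 * T))ᶜ, wt T τ' * lorentz M A (τ' - grid T (logHeight T) ((k : ℕ) : ℤ)) ^ 2 := by
        rw [integral_const_mul, ← integral_finsetSum _ fun k _ ↦ (hWint k).integrableOn]
        congr 1
        refine integral_congr_ae (Eventually.of_forall fun τ' ↦ ?_)
        dsimp only; rw [Finset.mul_sum]
    _ = 2 * Bν ^ 2 * (S₁ * Θw) * ∑ k : Fin (gridDim T),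
          ((∫ τ' in Iio T, wt T τ' * lorentz M A (τ' - grid T (logHeight T) ((k : ℕ) : ℤ)) ^ 2) + ∫ τ' in Ioi (2 * T), wt T τ' * lorentz M A (τ' - grid T (logHeight T) ((k : ℕ) : ℤ)) ^ 2) := by
        congr 1
        refine Finset.sum_congr rfl fun k _ ↦ ?_
        rw [compl_Icc_eq, setIntegral_union hdisj measurableSet_Ioi (hWint k).integrableOn
          (hWint k).integrableOn]
    _ ≤ 2 * Bν ^ 2 * (S₁ * Θw) * (2 * ∫ r in Ioi 0, (1 + r / (2 * π / logHeight T)) * G r) :=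
        mul_le_mul_of_nonneg_left (offBlock_sum_le hM hA hT hL0 hG0 hGi hGx hGdom) (by positivity)

/-! ## §R6. The window block `I × I`: `K = LΦ(τ−τ′) − K_out`

On `I × I` the kernel is the Poisson main term `LΦ(τ−τ′)` minus the sum over `k ∉ [0,d)`,
which we split into a finite part (`|k| ≤ N`-ish) and a uniformly tiny tail. -/

/-- **[AF26] (5.9): `|K(τ,τ′)| ≤ aL²` and `L|Φ| ≤ aL²`** (`aL² = L∫φ²`; Lemma 2.1 truncated and
`2|xy| ≤ x² + y²`). [cite: AlpogeFurman2026, §5.2 eq. (5.9) (p. 8)] -/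
theorem abs_kerK_le (hψ : IsWindow ψ) {T : ℝ} (hL : 0 < logHeight T) (τ τ' : ℝ) :
    |kerK ψ T τ τ'| ≤ logHeight T * ∫ u : ℝ, phi ψ T u ^ 2 ∧
      |logHeight T * PhiR ψ T (τ - τ')| ≤ logHeight T * ∫ u : ℝ, phi ψ T u ^ 2 := by
  have hsupp : Function.support (phi ψ T) ⊆ Ioo (-(logHeight T / 2)) (logHeight T / 2) :=
    support_phi_subset ψ T
  have hgab : ∀ γ : ℝ, ∑ k : Fin (gridDim T), hatR ψ T (γ - grid T (logHeight T) ((k : ℕ) : ℤ)) ^ 2 ≤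
      logHeight T * ∫ u : ℝ, phi ψ T u ^ 2 := by
    intro γ
    have h := AlpogeFurman2026_gabor_truncation hL T (hψ.continuous_phi T) hsupp (phi_neg hψ.even T)
      γ (gridIdx T)
    rw [sum_gridIdx] at h
    simpa only [hatR, Complex.ofReal_sub] using h
  constructor
  · rw [kerK]
    refine (Finset.abs_sum_le_sum_abs _ _).trans ?_
    have h2 : ∀ k : Fin (gridDim T), |hatR ψ T (τ - grid T (logHeight T) ((k : ℕ) : ℤ)) *
        hatR ψ T (τ' - grid T (logHeight T) ((k : ℕ) : ℤ))| ≤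
        (hatR ψ T (τ - grid T (logHeight T) ((k : ℕ) : ℤ)) ^ 2 +
          hatR ψ T (τ' - grid T (logHeight T) ((k : ℕ) : ℤ)) ^ 2) / 2 := by
      intro k
      rw [abs_mul]
      nlinarith [sq_nonneg (|hatR ψ T (τ - grid T (logHeight T) ((k : ℕ) : ℤ))| -
        |hatR ψ T (τ' - grid T (logHeight T) ((k : ℕ) : ℤ))|), sq_abs (hatR ψ T (τ - grid T (logHeight T) ((k : ℕ) : ℤ))),
        sq_abs (hatR ψ T (τ' - grid T (logHeight T) ((k : ℕ) : ℤ)))]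
    refine (Finset.sum_le_sum fun k _ ↦ h2 k).trans ?_
    rw [← Finset.sum_div, Finset.sum_add_distrib]
    have := hgab τ; have := hgab τ'
    linarith
  · rw [abs_mul, abs_of_pos hL]
    exact mul_le_mul_of_nonneg_left (abs_hatR_le ψ T 0 (τ - τ')).2 hL.le

/-- The enlarged index window `[−N, d+N] ⊂ ℤ` and its part outside `[0,d)`. [cite: AlpogeFurman2026, §5.2 eq. (5.8) (p. 8)] -/
def bigIdx (T : ℝ) (N : ℕ) : Finset ℤ := Finset.Icc (-(N : ℤ)) ((gridDim T : ℤ) + N)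

/-- Membership in `bigIdx`. [cite: AlpogeFurman2026, §5.2 eq. (5.8) (p. 8)] -/
theorem mem_bigIdx {T : ℝ} {N : ℕ} {k : ℤ} : k ∈ bigIdx T N ↔ -(N : ℤ) ≤ k ∧ k ≤ (gridDim T : ℤ) + N :=
  Finset.mem_Icc

/-- `K_fin`: the part of `K_out` with indices in `[−N, d+N] ∖ [0,d)`. [cite: AlpogeFurman2026, §5.2 eq. (5.8) (p. 8)] -/
def kerKfin (ψ : ℝ → ℝ) (T : ℝ) (N : ℕ) (τ τ' : ℝ) : ℝ :=
  ∑ k ∈ bigIdx T N \ gridIdx T, hatR ψ T (τ - grid T (logHeight T) k) * hatR ψ T (τ' - grid T (logHeight T) k)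

/-- `[0,d) ⊆ [−N, d+N]`, and `Σ_{[−N,d+N]} = K + K_fin`. [cite: AlpogeFurman2026, §5.2 eq. (5.8) (p. 8)] -/
theorem kerK_add_kerKfin (ψ : ℝ → ℝ) (T : ℝ) (N : ℕ) (τ τ' : ℝ) :
    gridIdx T ⊆ bigIdx T N ∧
      ∑ k ∈ bigIdx T N, hatR ψ T (τ - grid T (logHeight T) k) * hatR ψ T (τ' - grid T (logHeight T) k) =
        kerK ψ T τ τ' + kerKfin ψ T N τ τ' := by
  have hsub : gridIdx T ⊆ bigIdx T N := by
    intro k hk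
    rw [mem_gridIdx] at hk
    rw [mem_bigIdx]
    omega
  refine ⟨hsub, ?_⟩
  rw [kerKfin, ← Finset.sum_sdiff hsub, sum_gridIdx, kerK, add_comm]

/-- **The tail of the Poisson sum is uniformly tiny on `I × I`**: for `τ, τ′ ∈ [T,2T]`, `L ≥ 1`,
`N h ≥ D > 0`: `|LΦ(τ−τ′) − K(τ,τ′) − K_fin(τ,τ′)| ≤ 4M(ϑ(D) + h⁻¹ ∫_{r>D} ϑ)` where
`ϑ = ϑ_{M,A}` majorises `φ̂ʳ` (`M = A₀L`). [cite: AlpogeFurman2026, §5.2 eq. (5.8)–(5.9) (p. 8)] -/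
theorem abs_kerKtail_le (hψ : IsWindow ψ) {M A : ℝ} (hM : 0 < M) (hA : 0 < A) {T : ℝ} (hT : 0 < T)
    (hL : 0 < logHeight T) (hmaj : ∀ ξ : ℝ, |hatR ψ T ξ| ≤ lorentz M A ξ) {N : ℕ} {D : ℝ} (hD : 0 < D)
    (hND : D ≤ (N : ℝ) * (2 * π / logHeight T)) {τ : ℝ} (hτ : τ ∈ Icc T (2 * T)) (τ' : ℝ) :
    |logHeight T * PhiR ψ T (τ - τ') - kerK ψ T τ τ' - kerKfin ψ T N τ τ'| ≤
      4 * M * (lorentz M A D + (logHeight T / (2 * π)) * ∫ r in Ioi D, lorentz M A r) := by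
  have hπ := Real.pi_pos
  set L := logHeight T with hLdef
  set h : ℝ := 2 * π / L with hh
  have hh0 : 0 < h := by positivity
  have hhinv : h⁻¹ = L / (2 * π) := by rw [hh, inv_div]
  -- the tail as a sum over the complement of `bigIdx`
  have hsum := hasSum_hatR_mul_hatR hψ hL τ τ'
  rw [← hLdef] at hsum
  have htail : HasSum (fun k : {k : ℤ // k ∉ bigIdx T N} ↦
      hatR ψ T (τ - grid T L k) * hatR ψ T (τ' - grid T L k))
      (L * PhiR ψ T (τ - τ') - kerK ψ T τ τ' - kerKfin ψ T N τ τ') := by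
    refine (Finset.hasSum_compl_iff (f := fun k : ℤ ↦ hatR ψ T (τ - grid T L k) *
      hatR ψ T (τ' - grid T L k)) (bigIdx T N)).2 ?_
    have e : L * PhiR ψ T (τ - τ') - kerK ψ T τ τ' - kerKfin ψ T N τ τ' +
        ∑ i ∈ bigIdx T N, hatR ψ T (τ - grid T L i) * hatR ψ T (τ' - grid T L i) =
        L * PhiR ψ T (τ - τ') := by
      rw [(kerK_add_kerKfin ψ T N τ τ').2]; ring
    rw [e]; exact hsum
  -- termwise domination by `2M ϑ(τ − α_k)` and distances `≥ D + jh`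
  have hdT : T < ((gridDim T : ℝ) + 1) * h := by
    have : L * T / (2 * π) < (gridDim T : ℝ) + 1 := by rw [gridDim]; exact Nat.lt_floor_add_one _
    calc T = L * T / (2 * π) * h := by rw [hh]; field_simp
      _ < ((gridDim T : ℝ) + 1) * h := mul_lt_mul_of_pos_right this hh0
  have egrid : ∀ k : ℤ, grid T L k = T + (k : ℝ) * h := by intro k; rw [grid, hh]; ring
  have hterm : ∀ k : ℤ, |hatR ψ T (τ - grid T L k) * hatR ψ T (τ' - grid T L k)| ≤
      2 * M * lorentz M A (τ - grid T L k) := by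
    intro k
    rw [abs_mul, mul_comm (2 * M)]
    exact mul_le_mul (hmaj _) ((hmaj _).trans (lorentz_le_two_mul hM hA _)) (abs_nonneg _)
      (lorentz_pos hM hA _).le
  -- bound on finite partial sums over the complement
  have hprog : ∀ n : ℕ, ∑ j ∈ Finset.range n, lorentz M A (D + j * h) ≤
      lorentz M A D + h⁻¹ * ∫ r in Ioi D, lorentz M A r :=
    sum_step_le_add_integral hh0 ((lorentz_antitoneOn hM hA).mono (Ici_subset_Ici.2 hD.le))
      (fun x _ ↦ (lorentz_pos hM hA x).le) (setIntegral_lorentz_le hM hA D).1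
  -- a finite set of indices on one side, all at distance `≥ D + jh` along a progression
  have hside : ∀ (F : Finset {k : ℤ // k ∉ bigIdx T N}) (φ : {k : ℤ // k ∉ bigIdx T N} → ℕ),
      Set.InjOn φ F → (∀ k ∈ F, D + (φ k : ℕ) * h ≤ |τ - grid T L k|) →
      ∑ k ∈ F, lorentz M A (τ - grid T L k) ≤ lorentz M A D + h⁻¹ * ∫ r in Ioi D, lorentz M A r := by
    intro F φ hinj hdist
    have hle : ∀ k ∈ F, lorentz M A (τ - grid T L k) ≤ lorentz M A (D + (φ k : ℕ) * h) := by
      intro k hk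
      have h0 : 0 ≤ D + (φ k : ℕ) * h := by positivity
      have h1 : lorentz M A (τ - grid T L k) = lorentz M A |τ - grid T L k| := by
        rcases le_or_gt 0 (τ - grid T L k) with hs | hs
        · rw [abs_of_nonneg hs]
        · rw [abs_of_neg hs, lorentz_neg]
      rw [h1]
      exact lorentz_antitoneOn hM hA (mem_Ici.2 h0) (mem_Ici.2 (h0.trans (hdist k hk))) (hdist k hk)
    calc ∑ k ∈ F, lorentz M A (τ - grid T L k)
        ≤ ∑ k ∈ F, lorentz M A (D + (φ k : ℕ) * h) := Finset.sum_le_sum hle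
      _ = ∑ j ∈ F.image φ, lorentz M A (D + (j : ℕ) * h) :=
          (Finset.sum_image (g := φ) (f := fun j : ℕ ↦ lorentz M A (D + (j : ℝ) * h)) hinj).symm
      _ ≤ _ := (sum_le_sum_range_of_nonneg _ fun j ↦ (lorentz_pos hM hA _).le).trans (hprog _)
  have hpartial : ∀ F : Finset {k : ℤ // k ∉ bigIdx T N},
      ∑ k ∈ F, |hatR ψ T (τ - grid T L k) * hatR ψ T (τ' - grid T L k)| ≤
        4 * M * (lorentz M A D + h⁻¹ * ∫ r in Ioi D, lorentz M A r) := by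
    intro F
    have hF : ∀ k : {k : ℤ // k ∉ bigIdx T N}, (gridDim T : ℤ) + N < k.1 ∨ k.1 < -(N : ℤ) := by
      intro k
      have := k.2
      rw [mem_bigIdx] at this
      omega
    refine (Finset.sum_le_sum fun (k : {k : ℤ // k ∉ bigIdx T N}) _ ↦ hterm k.1).trans ?_
    rw [← Finset.mul_sum, show 4 * M * (lorentz M A D + h⁻¹ * ∫ r in Ioi D, lorentz M A r) =
      2 * M * (2 * (lorentz M A D + h⁻¹ * ∫ r in Ioi D, lorentz M A r)) by ring]
    refine mul_le_mul_of_nonneg_left ?_ (by positivity)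
    rw [← Finset.sum_filter_add_sum_filter_not F (fun k ↦ (gridDim T : ℤ) + N < k.1)]
    -- right family: `k = d + N + 1 + j`
    have hright : ∑ k ∈ F.filter (fun k ↦ (gridDim T : ℤ) + N < k.1), lorentz M A (τ - grid T L k) ≤
        lorentz M A D + h⁻¹ * ∫ r in Ioi D, lorentz M A r := by
      refine hside _ (fun k ↦ (k.1 - (gridDim T : ℤ) - N - 1).toNat) ?_ ?_
      · intro a ha b hb hab
        simp only [Finset.coe_filter, Set.mem_setOf_eq] at ha hb
        have := congrArg (fun n : ℕ ↦ (n : ℤ)) hab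
        simp only [Int.toNat_of_nonneg (show (0 : ℤ) ≤ a.1 - (gridDim T : ℤ) - N - 1 by omega),
          Int.toNat_of_nonneg (show (0 : ℤ) ≤ b.1 - (gridDim T : ℤ) - N - 1 by omega)] at this
        exact Subtype.ext (by omega)
      · intro k hk
        simp only [Finset.mem_filter] at hk
        have hj : (((k.1 - (gridDim T : ℤ) - N - 1).toNat : ℕ) : ℝ) = (k.1 : ℝ) - (gridDim T : ℤ) - N - 1 := by
          rw [show (((k.1 - (gridDim T : ℤ) - N - 1).toNat : ℕ) : ℝ) = (((k.1 - (gridDim T : ℤ) - N - 1).toNat : ℤ) : ℝ) by norm_cast,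
            Int.toNat_of_nonneg (show (0 : ℤ) ≤ k.1 - (gridDim T : ℤ) - N - 1 by omega)]
          push_cast; ring
        have e1 : (k.1 : ℝ) * h = (((k.1 - (gridDim T : ℤ) - N - 1).toNat : ℕ) : ℝ) * h + ((gridDim T : ℝ) + 1) * h + N * h := by
          rw [hj]; push_cast; ring
        refine le_trans ?_ (le_abs_self _) |>.trans (le_of_eq (abs_sub_comm _ _))
        rw [egrid]
        linarith [hτ.2, hND, hdT]
    -- left family: `k = -(N + 1 + j)`
    have hleft : ∑ k ∈ F.filter (fun k ↦ ¬(gridDim T : ℤ) + N < k.1), lorentz M A (τ - grid T L k) ≤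
        lorentz M A D + h⁻¹ * ∫ r in Ioi D, lorentz M A r := by
      have hmem : ∀ k ∈ F.filter (fun k ↦ ¬(gridDim T : ℤ) + N < k.1), k.1 < -(N : ℤ) := by
        intro k hk
        simp only [Finset.mem_filter] at hk
        rcases hF k with h1 | h1
        · exact absurd h1 hk.2
        · exact h1
      refine hside _ (fun k ↦ (-k.1 - N - 1).toNat) ?_ ?_
      · intro a ha b hb hab
        have ha' := hmem a ha; have hb' := hmem b hb
        have := congrArg (fun n : ℕ ↦ (n : ℤ)) hab
        simp only [Int.toNat_of_nonneg (show (0 : ℤ) ≤ -a.1 - N - 1 by omega),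
          Int.toNat_of_nonneg (show (0 : ℤ) ≤ -b.1 - N - 1 by omega)] at this
        exact Subtype.ext (by omega)
      · intro k hk
        have hk' := hmem k hk
        have hj : (((-k.1 - N - 1).toNat : ℕ) : ℝ) = -(k.1 : ℝ) - N - 1 := by
          rw [show (((-k.1 - N - 1).toNat : ℕ) : ℝ) = (((-k.1 - N - 1).toNat : ℤ) : ℝ) by norm_cast,
            Int.toNat_of_nonneg (show (0 : ℤ) ≤ -k.1 - N - 1 by omega)]
          push_cast; ring
        have e1 : -((k.1 : ℝ) * h) = (((-k.1 - N - 1).toNat : ℕ) : ℝ) * h + N * h + h := by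
          rw [hj]; ring
        refine le_trans ?_ (le_abs_self _)
        rw [egrid]
        linarith [hτ.1, hND]
    linarith
  -- pass to the infinite sum
  have hsabs : Summable fun k : {k : ℤ // k ∉ bigIdx T N} ↦
      |hatR ψ T (τ - grid T L k) * hatR ψ T (τ' - grid T L k)| :=
    summable_of_sum_le (fun k ↦ abs_nonneg _) hpartial
  have h1 : |L * PhiR ψ T (τ - τ') - kerK ψ T τ τ' - kerKfin ψ T N τ τ'| ≤
      ∑' k : {k : ℤ // k ∉ bigIdx T N}, |hatR ψ T (τ - grid T L k) * hatR ψ T (τ' - grid T L k)| := by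
    rw [← htail.tsum_eq]
    have := norm_tsum_le_tsum_norm (f := fun k : {k : ℤ // k ∉ bigIdx T N} ↦
      hatR ψ T (τ - grid T L k) * hatR ψ T (τ' - grid T L k)) (by simpa only [Real.norm_eq_abs] using hsabs)
    simpa only [Real.norm_eq_abs] using this
  refine h1.trans ?_
  rw [hhinv] at hpartial
  exact hsabs.tsum_le_of_sum_le hpartial

/-- **`U(α) := ∫_I ϑ(τ − α) dτ`**: nonnegative, `≤ Θ = ∫_ℝ ϑ`, and `≤ ∫_{r > dist(α, I)} ϑ` for
`α` to the left (`α ≤ T`) or right (`α ≥ 2T`) of `I = [T, 2T]`.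
[cite: AlpogeFurman2026, Proposition 5.2 (proof: "`∫_I ϑ(τ−α_k)dτ`, `dist(α_k, I) = jh`"), pp. 8–9] -/
theorem intervalIntegral_lorentz_shift_le {M A : ℝ} (hM : 0 < M) (hA : 0 < A) {T : ℝ} (hT : 0 < T)
    (α : ℝ) :
    0 ≤ ∫ τ in T..2 * T, lorentz M A (τ - α) ∧
      (∫ τ in T..2 * T, lorentz M A (τ - α)) ≤ 2 * π * Real.sqrt (A * M) ∧
      (α ≤ T → (∫ τ in T..2 * T, lorentz M A (τ - α)) ≤ ∫ r in Ioi (T - α), lorentz M A r) ∧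
      (2 * T ≤ α → (∫ τ in T..2 * T, lorentz M A (τ - α)) ≤ ∫ r in Ioi (α - 2 * T), lorentz M A r) := by
  obtain ⟨hcont, hint, hI⟩ := integral_lorentz hM hA
  have hT2 : T ≤ 2 * T := by linarith
  have hnn : ∀ r, 0 ≤ lorentz M A r := fun r ↦ (lorentz_pos hM hA r).le
  have e1 : ∫ τ in T..2 * T, lorentz M A (τ - α) = ∫ r in (T - α)..(2 * T - α), lorentz M A r :=
    intervalIntegral.integral_comp_sub_right (fun r ↦ lorentz M A r) α
  have hle : T - α ≤ 2 * T - α := by linarith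
  refine ⟨?_, ?_, fun hα ↦ ?_, fun hα ↦ ?_⟩
  · rw [e1]; exact intervalIntegral.integral_nonneg hle fun r _ ↦ hnn r
  · rw [e1, intervalIntegral.integral_of_le hle, ← hI]
    exact setIntegral_le_integral hint (Eventually.of_forall hnn)
  · rw [e1, intervalIntegral.integral_of_le hle]
    exact setIntegral_mono_set hint.integrableOn (Eventually.of_forall hnn) Ioc_subset_Ioi_self.eventuallyLE
  · have e2 : ∫ τ in T..2 * T, lorentz M A (τ - α) = ∫ r in (α - 2 * T)..(α - T), lorentz M A r := by
      rw [← intervalIntegral.integral_comp_sub_left (fun r ↦ lorentz M A r) α]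
      refine intervalIntegral.integral_congr fun τ _ ↦ ?_
      rw [← lorentz_neg, neg_sub]
    rw [e2, intervalIntegral.integral_of_le (by linarith)]
    exact setIntegral_mono_set hint.integrableOn (Eventually.of_forall hnn) Ioc_subset_Ioi_self.eventuallyLE

/-- `U² ≤ ϑ_{Θ², 4A²}(D)` whenever `U ≤ ∫_{r>D} ϑ` with `D > 0` (`∫_{r>D}ϑ ≤ min(Θ, 2A/D)`).
[cite: AlpogeFurman2026, Proposition 5.2 (proof: "`Σ_{j≥1} min(Θ₀, C_χ/(jh))²`"), p. 9] -/
theorem sq_le_lorentz_of_le_tail {M A : ℝ} (hM : 0 < M) (hA : 0 < A) {U D : ℝ} (hU0 : 0 ≤ U)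
    (hD : 0 < D) (hU : U ≤ ∫ r in Ioi D, lorentz M A r) :
    U ^ 2 ≤ lorentz ((2 * π * Real.sqrt (A * M)) ^ 2) (4 * A ^ 2) D := by
  obtain ⟨-, h1, h2⟩ := setIntegral_lorentz_le hM hA D
  have hΘ : 0 < 2 * π * Real.sqrt (A * M) := by positivity
  refine le_lorentz (by positivity) (by positivity) (pow_le_pow_left₀ hU0 (hU.trans h1) 2) fun _ ↦ ?_
  have h3 := pow_le_pow_left₀ hU0 (hU.trans (h2 hD)) 2
  refine h3.trans (le_of_eq ?_)
  field_simp
  ring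

/-- **The finite part of `K_out` has small mass on `I × I`**:
`Σ_{k ∈ [−N,d+N]∖[0,d)} U(α_k)² ≤ 3Θ² + 2h⁻¹ ∫_{r>0} ϑ_{Θ²,4A²} ≤ 3Θ² + 8πAΘ/h` (`Θ = 2π√(AM)`):
the left family sits at distances `jh` (`j ≥ 1`), the right family at `> (j−1)h`, plus `α_d`.
[cite: AlpogeFurman2026, Proposition 5.2 (proof, bound for `𝓔₁`), pp. 8–9] -/
theorem sum_sq_intervalIntegral_le {M A : ℝ} (hM : 0 < M) (hA : 0 < A) {T : ℝ} (hT : 0 < T)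
    (hL : 0 < logHeight T) (N : ℕ) :
    ∑ k ∈ bigIdx T N \ gridIdx T, (∫ τ in T..2 * T, lorentz M A (τ - grid T (logHeight T) k)) ^ 2 ≤
      3 * (2 * π * Real.sqrt (A * M)) ^ 2 +
        2 * ((logHeight T / (2 * π)) * (2 * π * Real.sqrt (4 * A ^ 2 * (2 * π * Real.sqrt (A * M)) ^ 2))) := by
  have hπ := Real.pi_pos
  set L := logHeight T with hLdef
  set h : ℝ := 2 * π / L with hh
  have hh0 : 0 < h := by positivity
  have hhinv : h⁻¹ = L / (2 * π) := by rw [hh, inv_div]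
  set Θ : ℝ := 2 * π * Real.sqrt (A * M) with hΘ
  have hΘ0 : 0 < Θ := by positivity
  set g : ℝ → ℝ := lorentz (Θ ^ 2) (4 * A ^ 2) with hg
  have hM' : 0 < Θ ^ 2 := by positivity
  have hA' : 0 < 4 * A ^ 2 := by positivity
  obtain ⟨hgint, hgI, -⟩ := setIntegral_lorentz_le hM' hA' (0 : ℝ)
  have hg0 : g 0 = 2 * Θ ^ 2 := by rw [hg, lorentz]; field_simp; ring
  have egrid : ∀ k : ℤ, grid T L k = T + (k : ℝ) * h := by intro k; rw [grid, hh]; ring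
  have hdT : T < ((gridDim T : ℝ) + 1) * h := by
    have : L * T / (2 * π) < (gridDim T : ℝ) + 1 := by rw [gridDim]; exact Nat.lt_floor_add_one _
    calc T = L * T / (2 * π) * h := by rw [hh]; field_simp
      _ < ((gridDim T : ℝ) + 1) * h := mul_lt_mul_of_pos_right this hh0
  set U : ℤ → ℝ := fun k ↦ ∫ τ in T..2 * T, lorentz M A (τ - grid T L k) with hU
  have hUf := fun k : ℤ ↦ intervalIntegral_lorentz_shift_le hM hA hT (grid T L k)
  -- progression sums of `g`
  have hprog1 : ∀ n : ℕ, ∑ j ∈ Finset.range n, g (0 + (j + 1) * h) ≤ h⁻¹ * ∫ r in Ioi 0, g r :=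
    sum_step_le_integral hh0 (lorentz_antitoneOn hM' hA') (fun x _ ↦ (lorentz_pos hM' hA' x).le) hgint
  have hprog0 : ∀ n : ℕ, ∑ j ∈ Finset.range n, g (0 + j * h) ≤ g 0 + h⁻¹ * ∫ r in Ioi 0, g r :=
    sum_step_le_add_integral hh0 (lorentz_antitoneOn hM' hA') (fun x _ ↦ (lorentz_pos hM' hA' x).le) hgint
  -- classify the indices
  set S := bigIdx T N \ gridIdx T with hS
  have hcls : ∀ k ∈ S, k ≤ -1 ∨ k = gridDim T ∨ (gridDim T : ℤ) + 1 ≤ k := by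
    intro k hk
    rw [hS, Finset.mem_sdiff, mem_bigIdx, mem_gridIdx] at hk
    omega
  -- left family
  have hleft : ∑ k ∈ S.filter (fun k ↦ k ≤ -1), U k ^ 2 ≤ h⁻¹ * ∫ r in Ioi 0, g r := by
    set φ : ℤ → ℕ := fun k ↦ (-k - 1).toNat with hφ
    have hinj : Set.InjOn φ (S.filter (fun k ↦ k ≤ -1)) := by
      intro a ha b hb hab
      simp only [Finset.coe_filter, Set.mem_setOf_eq] at ha hb
      have := congrArg (fun n : ℕ ↦ (n : ℤ)) hab
      simp only [hφ, Int.toNat_of_nonneg (show (0 : ℤ) ≤ -a - 1 by omega),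
        Int.toNat_of_nonneg (show (0 : ℤ) ≤ -b - 1 by omega)] at this
      omega
    have hle : ∀ k ∈ S.filter (fun k ↦ k ≤ -1), U k ^ 2 ≤ g (0 + ((φ k : ℕ) + 1) * h) := by
      intro k hk
      simp only [Finset.mem_filter] at hk
      have hj : ((φ k : ℕ) : ℝ) = -(k : ℝ) - 1 := by
        rw [hφ]
        rw [show (((-k - 1).toNat : ℕ) : ℝ) = (((-k - 1).toNat : ℤ) : ℝ) by norm_cast,
          Int.toNat_of_nonneg (show (0 : ℤ) ≤ -k - 1 by omega)]
        push_cast; ring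
      have hD : T - grid T L k = ((φ k : ℕ) + 1) * h := by rw [egrid, hj]; ring
      have hDpos : 0 < ((φ k : ℕ) + 1 : ℝ) * h := by positivity
      have h1 := (hUf k).2.2.1 (by rw [egrid]; nlinarith [hj])
      rw [hD] at h1
      rw [zero_add]
      exact sq_le_lorentz_of_le_tail hM hA (hUf k).1 hDpos h1
    calc ∑ k ∈ S.filter (fun k ↦ k ≤ -1), U k ^ 2
        ≤ ∑ k ∈ S.filter (fun k ↦ k ≤ -1), g (0 + ((φ k : ℕ) + 1) * h) := Finset.sum_le_sum hle
      _ = ∑ j ∈ (S.filter (fun k ↦ k ≤ -1)).image φ, g (0 + ((j : ℕ) + 1) * h) :=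
          (Finset.sum_image (g := φ) (f := fun j : ℕ ↦ g (0 + ((j : ℝ) + 1) * h)) hinj).symm
      _ ≤ _ := (sum_le_sum_range_of_nonneg _ fun j ↦ (lorentz_pos hM' hA' _).le).trans (hprog1 _)
  -- the stray point `k = d`
  have hmid : ∑ k ∈ (S.filter (fun k ↦ ¬k ≤ -1)).filter (fun k : ℤ ↦ k = (gridDim T : ℤ)), U k ^ 2 ≤ Θ ^ 2 := by
    have hsub : (S.filter (fun k ↦ ¬k ≤ -1)).filter (fun k : ℤ ↦ k = (gridDim T : ℤ)) ⊆ {(gridDim T : ℤ)} := by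
      intro k hk; simp only [Finset.mem_filter] at hk; simp [hk.2]
    refine (Finset.sum_le_sum_of_subset_of_nonneg hsub fun k _ _ ↦ sq_nonneg _).trans ?_
    rw [Finset.sum_singleton]
    exact pow_le_pow_left₀ (hUf _).1 (hUf _).2.1 2
  -- right family
  have hright : ∑ k ∈ (S.filter (fun k ↦ ¬k ≤ -1)).filter (fun k : ℤ ↦ ¬k = (gridDim T : ℤ)), U k ^ 2 ≤
      g 0 + h⁻¹ * ∫ r in Ioi 0, g r := by
    set S' := (S.filter (fun k ↦ ¬k ≤ -1)).filter (fun k : ℤ ↦ ¬k = (gridDim T : ℤ)) with hS'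
    have hmem : ∀ k ∈ S', (gridDim T : ℤ) + 1 ≤ k := by
      intro k hk
      rw [hS', Finset.mem_filter, Finset.mem_filter] at hk
      rcases hcls k hk.1.1 with h1 | h1 | h1
      · exact absurd h1 hk.1.2
      · exact absurd h1 hk.2
      · exact h1
    set φ : ℤ → ℕ := fun k ↦ (k - gridDim T - 1).toNat with hφ
    have hinj : Set.InjOn φ S' := by
      intro a ha b hb hab
      have ha' := hmem a ha; have hb' := hmem b hb
      have := congrArg (fun n : ℕ ↦ (n : ℤ)) hab
      simp only [hφ, Int.toNat_of_nonneg (show (0 : ℤ) ≤ a - gridDim T - 1 by omega),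
        Int.toNat_of_nonneg (show (0 : ℤ) ≤ b - gridDim T - 1 by omega)] at this
      omega
    have hle : ∀ k ∈ S', U k ^ 2 ≤ g (0 + (φ k : ℕ) * h) := by
      intro k hk
      have hk' := hmem k hk
      have hj : ((φ k : ℕ) : ℝ) = (k : ℝ) - gridDim T - 1 := by
        rw [hφ]
        rw [show (((k - gridDim T - 1).toNat : ℕ) : ℝ) = (((k - gridDim T - 1).toNat : ℤ) : ℝ) by norm_cast,
          Int.toNat_of_nonneg (show (0 : ℤ) ≤ k - gridDim T - 1 by omega)]
        push_cast; ring
      -- `α_k − 2T = (d+1)h − T + j h > j h`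
      have e1 : grid T L k - 2 * T = ((gridDim T : ℝ) + 1) * h - T + (φ k : ℕ) * h := by
        rw [egrid, hj]; ring
      have hDpos : 0 < grid T L k - 2 * T := by rw [e1]; nlinarith [hdT]
      have h1 := (hUf k).2.2.2 (by linarith)
      have h2 : U k ^ 2 ≤ g (grid T L k - 2 * T) := sq_le_lorentz_of_le_tail hM hA (hUf k).1 hDpos h1
      refine h2.trans (lorentz_antitoneOn hM' hA' (mem_Ici.2 (by positivity)) (mem_Ici.2 hDpos.le) ?_)
      rw [e1]; nlinarith [hdT]
    calc ∑ k ∈ S', U k ^ 2 ≤ ∑ k ∈ S', g (0 + (φ k : ℕ) * h) := Finset.sum_le_sum hle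
      _ = ∑ j ∈ S'.image φ, g (0 + (j : ℕ) * h) :=
          (Finset.sum_image (g := φ) (f := fun j : ℕ ↦ g (0 + (j : ℝ) * h)) hinj).symm
      _ ≤ _ := (sum_le_sum_range_of_nonneg _ fun j ↦ (lorentz_pos hM' hA' _).le).trans (hprog0 _)
  -- assemble
  rw [← Finset.sum_filter_add_sum_filter_not S (fun k ↦ k ≤ -1),
    ← Finset.sum_filter_add_sum_filter_not (S.filter (fun k ↦ ¬k ≤ -1)) (fun k : ℤ ↦ k = (gridDim T : ℤ))]
  rw [hg0] at hright
  rw [hhinv] at hleft hright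
  have hIval : ∫ r in Ioi 0, g r ≤ 2 * π * Real.sqrt (4 * A ^ 2 * Θ ^ 2) := hgI
  have hLpos : 0 ≤ L / (2 * π) := by positivity
  nlinarith [mul_le_mul_of_nonneg_left hIval hLpos]

/-! ### The double integral `𝓜` and the window-block estimate -/

/-- **[AF26] §5.2–5.3, the double integral** `𝓜 := ∬_{I×I} Φ(τ−τ′)² ν_X(τ) ν_X(τ′) dτ dτ′`
(`I = [T,2T]`, `X = T/2π`), written as an iterated interval integral with `τ′` outside.
[cite: AlpogeFurman2026, Proposition 5.2 (p. 8)] -/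
def formM (ψ : ℝ → ℝ) (T : ℝ) : ℝ :=
  ∫ τ' in T..2 * T, weilDensity (T / (2 * π)) τ' *
    ∫ τ in T..2 * T, PhiR ψ T (τ - τ') ^ 2 * weilDensity (T / (2 * π)) τ

/-- `s^I_{kk′}` as an interval integral. [cite: AlpogeFurman2026, Proposition 5.2 (p. 8)] -/
theorem sEntryI_eq_intervalIntegral (ψ : ℝ → ℝ) {T : ℝ} (hT : 0 < T) (k k' : Fin (gridDim T)) :
    sEntryI ψ T k k' = ∫ τ in T..2 * T, hatR ψ T (τ - grid T (logHeight T) ((k : ℕ) : ℤ)) * hatR ψ T (τ - grid T (logHeight T) ((k' : ℕ) : ℤ)) * weilDensity (T / (2 * π)) τ := by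
  rw [sEntryI, intervalIntegral.integral_of_le (by linarith), integral_Icc_eq_integral_Ioc]

/-- On the window, `|ν_X| ≤ B_ν(1 + √2)`. [cite: AlpogeFurman2026, §5.1 eq. (5.7) (p. 8: "`|ν_X(τ)| ≤ B (|τ| ≤ 4T)`")] -/
theorem abs_weilDensity_le_on_window {T Bν : ℝ} (hT : 0 < T)
    (hν : ∀ τ : ℝ, |weilDensity (T / (2 * π)) τ| ≤ Bν * wt T τ) {τ : ℝ} (hτ : τ ∈ Icc T (2 * T)) :
    |weilDensity (T / (2 * π)) τ| ≤ Bν * (1 + Real.sqrt 2) := by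
  have hB0 : 0 ≤ Bν := by
    have h := hν 0; have hw := (wt_pos T 0).1
    nlinarith [abs_nonneg (weilDensity (T / (2 * π)) 0)]
  refine (hν τ).trans (mul_le_mul_of_nonneg_left ?_ hB0)
  unfold wt
  have : Real.sqrt (|τ| / T) ≤ Real.sqrt 2 := by
    refine Real.sqrt_le_sqrt ?_
    rw [div_le_iff₀ hT, abs_of_nonneg (by linarith [hτ.1])]
    linarith [hτ.2]
  linarith

/-- **The window block `I × I`** ([AF26] Prop. 5.2, the term `𝓔₁`): with `𝒩 = L∫φ²` (so
`|K|, L|Φ| ≤ 𝒩`), a tail bound `|LΦ − K − K_fin| ≤ ε` on `I × ℝ`, `|ν| ≤ B_ν ω` and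
`U_k = ∫_I ϑ(τ−α_k)dτ`:
`|Σ_{kk′} (s^I_{kk′})² − L² 𝓜| ≤ 2𝒩 (B_ν(1+√2))² (Σ_{k∈[−N,d+N]∖[0,d)} U_k² + ε T²)`.
[cite: AlpogeFurman2026, Proposition 5.2 (proof, bound for `𝓔₁`), pp. 8–9] -/
theorem inBlock_le (hψ : IsWindow ψ) {M A : ℝ} (hM : 0 < M) (hA : 0 < A) {T : ℝ} (hT : 0 < T)
    (hL : 10 ≤ logHeight T) (hmaj : ∀ ξ : ℝ, |hatR ψ T ξ| ≤ lorentz M A ξ)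
    {Bν : ℝ} (hν : ∀ τ : ℝ, |weilDensity (T / (2 * π)) τ| ≤ Bν * wt T τ) {N : ℕ} {ε : ℝ}
    (htail : ∀ τ ∈ Icc T (2 * T), ∀ τ' : ℝ,
      |logHeight T * PhiR ψ T (τ - τ') - kerK ψ T τ τ' - kerKfin ψ T N τ τ'| ≤ ε) :
    |∑ k : Fin (gridDim T), ∑ k' : Fin (gridDim T), sEntryI ψ T k k' ^ 2 - logHeight T ^ 2 * formM ψ T| ≤
      2 * (logHeight T * ∫ u : ℝ, phi ψ T u ^ 2) * (Bν * (1 + Real.sqrt 2)) ^ 2 *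
        (∑ k ∈ bigIdx T N \ gridIdx T, (∫ τ in T..2 * T, lorentz M A (τ - grid T (logHeight T) k)) ^ 2 + ε * T ^ 2) := by
  have hπ := Real.pi_pos
  have hL0 : 0 < logHeight T := by linarith
  have hT2 : T ≤ 2 * T := by linarith
  set 𝒩 : ℝ := logHeight T * ∫ u : ℝ, phi ψ T u ^ 2 with h𝒩
  set BI : ℝ := Bν * (1 + Real.sqrt 2) with hBI
  have hBI : ∀ τ ∈ Icc T (2 * T), |weilDensity (T / (2 * π)) τ| ≤ BI := fun τ hτ ↦ abs_weilDensity_le_on_window hT hν hτ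
  have hBI0 : 0 ≤ BI := (abs_nonneg _).trans (hBI T ⟨le_rfl, hT2⟩)
  have hε0 : 0 ≤ ε := (abs_nonneg _).trans (htail T ⟨le_rfl, hT2⟩ 0)
  have h𝒩0 : 0 ≤ 𝒩 := (abs_nonneg _).trans (abs_kerK_le hψ hL0 0 0).1
  -- continuity facts
  have hcf : Continuous (hatR ψ T) := (continuous_hatR hψ T).1
  have hcΦ : Continuous (PhiR ψ T) := (continuous_hatR hψ T).2
  have hcν : Continuous (weilDensity (T / (2 * π))) := continuous_weilDensity _
  have hcK : ∀ τ', Continuous fun τ ↦ kerK ψ T τ τ' := by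
    intro τ'; unfold kerK
    exact continuous_finsetSum _ fun k _ ↦ (hcf.comp (continuous_id.sub continuous_const)).mul continuous_const
  obtain ⟨hcϑ, -, -⟩ := integral_lorentz hM hA
  -- the integrand identity: `Σ s^I · s^I = ∫_I ν(τ') P_I(τ')`
  have hFc : ∀ k k' : Fin (gridDim T), Continuous fun τ' : ℝ ↦ hatR ψ T (τ' - grid T (logHeight T) ((k : ℕ) : ℤ)) * hatR ψ T (τ' - grid T (logHeight T) ((k' : ℕ) : ℤ)) * weilDensity (T / (2 * π)) τ' * sEntryI ψ T k k' :=
    fun k k' ↦ (((hcf.comp (continuous_id.sub continuous_const)).mul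
      (hcf.comp (continuous_id.sub continuous_const))).mul hcν).mul continuous_const
  have hFc1 : ∀ k : Fin (gridDim T), Continuous fun τ' : ℝ ↦ ∑ k' : Fin (gridDim T),
      hatR ψ T (τ' - grid T (logHeight T) ((k : ℕ) : ℤ)) * hatR ψ T (τ' - grid T (logHeight T) ((k' : ℕ) : ℤ)) * weilDensity (T / (2 * π)) τ' * sEntryI ψ T k k' := fun k ↦ continuous_finsetSum _ fun k' _ ↦ hFc k k'
  have e1 : ∀ τ', ∫ τ in Icc T (2 * T), kerK ψ T τ τ' ^ 2 * weilDensity (T / (2 * π)) τ =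
      ∑ k : Fin (gridDim T), ∑ k' : Fin (gridDim T), hatR ψ T (τ' - grid T (logHeight T) ((k : ℕ) : ℤ)) * hatR ψ T (τ' - grid T (logHeight T) ((k' : ℕ) : ℤ)) * sEntryI ψ T k k' := by
    intro τ'; rw [← sum_mul_setIntegral_eq hψ hL (Icc T (2 * T)) τ']; rfl
  have e2 : (fun τ' ↦ weilDensity (T / (2 * π)) τ' * ∫ τ in Icc T (2 * T), kerK ψ T τ τ' ^ 2 * weilDensity (T / (2 * π)) τ) =
      fun τ' ↦ ∑ k : Fin (gridDim T), ∑ k' : Fin (gridDim T),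
        hatR ψ T (τ' - grid T (logHeight T) ((k : ℕ) : ℤ)) * hatR ψ T (τ' - grid T (logHeight T) ((k' : ℕ) : ℤ)) * weilDensity (T / (2 * π)) τ' * sEntryI ψ T k k' := by
    funext τ'
    rw [e1, Finset.mul_sum]
    refine Finset.sum_congr rfl fun k _ ↦ ?_
    rw [Finset.mul_sum]
    refine Finset.sum_congr rfl fun k' _ ↦ ?_
    ring
  have hPc : Continuous fun τ' ↦ weilDensity (T / (2 * π)) τ' * ∫ τ in Icc T (2 * T), kerK ψ T τ τ' ^ 2 * weilDensity (T / (2 * π)) τ := by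
    rw [e2]; exact continuous_finsetSum _ fun k _ ↦ hFc1 k
  have hrepr : ∑ k : Fin (gridDim T), ∑ k' : Fin (gridDim T), sEntryI ψ T k k' ^ 2 =
      ∫ τ' in T..2 * T, weilDensity (T / (2 * π)) τ' * ∫ τ in Icc T (2 * T), kerK ψ T τ τ' ^ 2 * weilDensity (T / (2 * π)) τ := by
    rw [e2, intervalIntegral.integral_finsetSum fun k _ ↦ (hFc1 k).intervalIntegrable _ _]
    refine Finset.sum_congr rfl fun k _ ↦ ?_
    rw [intervalIntegral.integral_finsetSum fun k' _ ↦ (hFc k k').intervalIntegrable _ _]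
    refine Finset.sum_congr rfl fun k' _ ↦ ?_
    rw [intervalIntegral.integral_mul_const, ← sEntryI_eq_intervalIntegral ψ hT, sq]
  -- `L² 𝓜` in the same shape
  have hQc0 : Continuous fun τ' ↦ ∫ τ in T..2 * T, (logHeight T * PhiR ψ T (τ - τ')) ^ 2 * weilDensity (T / (2 * π)) τ := by
    refine intervalIntegral.continuous_parametric_intervalIntegral_of_continuous' ?_ T (2 * T)
    exact ((continuous_const.mul (hcΦ.comp (continuous_snd.sub continuous_fst))).pow 2).mul
      (hcν.comp continuous_snd)
  have eQ : (fun τ' ↦ weilDensity (T / (2 * π)) τ' * ∫ τ in Icc T (2 * T), (logHeight T * PhiR ψ T (τ - τ')) ^ 2 * weilDensity (T / (2 * π)) τ) =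
      fun τ' ↦ weilDensity (T / (2 * π)) τ' * ∫ τ in T..2 * T, (logHeight T * PhiR ψ T (τ - τ')) ^ 2 * weilDensity (T / (2 * π)) τ := by
    funext τ'; rw [intervalIntegral.integral_of_le hT2, integral_Icc_eq_integral_Ioc]
  have hQc : Continuous fun τ' ↦ weilDensity (T / (2 * π)) τ' * ∫ τ in Icc T (2 * T),
      (logHeight T * PhiR ψ T (τ - τ')) ^ 2 * weilDensity (T / (2 * π)) τ := by
    rw [eQ]; exact hcν.mul hQc0
  have hMform : logHeight T ^ 2 * formM ψ T =
      ∫ τ' in T..2 * T, weilDensity (T / (2 * π)) τ' * ∫ τ in Icc T (2 * T),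
        (logHeight T * PhiR ψ T (τ - τ')) ^ 2 * weilDensity (T / (2 * π)) τ := by
    rw [formM, ← intervalIntegral.integral_const_mul]
    refine intervalIntegral.integral_congr fun τ' _ ↦ ?_
    rw [intervalIntegral.integral_of_le hT2, ← integral_Icc_eq_integral_Ioc, mul_left_comm,
      ← integral_const_mul]
    congr 1
    refine integral_congr_ae (Eventually.of_forall fun τ ↦ ?_)
    dsimp only; ring
  -- pointwise bound for `τ' ∈ I`
  have hpt : ∀ τ' ∈ Icc T (2 * T),
      |weilDensity (T / (2 * π)) τ' * (∫ τ in Icc T (2 * T), kerK ψ T τ τ' ^ 2 * weilDensity (T / (2 * π)) τ) -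
        weilDensity (T / (2 * π)) τ' * (∫ τ in Icc T (2 * T), (logHeight T * PhiR ψ T (τ - τ')) ^ 2 * weilDensity (T / (2 * π)) τ)| ≤
      2 * 𝒩 * BI ^ 2 * (∑ k ∈ bigIdx T N \ gridIdx T,
        lorentz M A (τ' - grid T (logHeight T) k) * (∫ τ in T..2 * T, lorentz M A (τ - grid T (logHeight T) k)) + ε * T) := by
    intro τ' hτ'
    have hc1 : Continuous fun τ ↦ kerK ψ T τ τ' ^ 2 * weilDensity (T / (2 * π)) τ := ((hcK τ').pow 2).mul hcν
    have hc2 : Continuous fun τ ↦ (logHeight T * PhiR ψ T (τ - τ')) ^ 2 * weilDensity (T / (2 * π)) τ :=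
      ((continuous_const.mul (hcΦ.comp (continuous_id.sub continuous_const))).pow 2).mul hcν
    rw [← mul_sub, ← integral_sub (hc1.integrableOn_Icc) (hc2.integrableOn_Icc), abs_mul]
    -- the difference of squares
    have hdiff : ∀ τ ∈ Icc T (2 * T), |kerK ψ T τ τ' ^ 2 * weilDensity (T / (2 * π)) τ -
        (logHeight T * PhiR ψ T (τ - τ')) ^ 2 * weilDensity (T / (2 * π)) τ| ≤
        2 * 𝒩 * BI * (∑ k ∈ bigIdx T N \ gridIdx T, lorentz M A (τ - grid T (logHeight T) k) * lorentz M A (τ' - grid T (logHeight T) k) + ε) := by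
      intro τ hτ
      have hK := (abs_kerK_le hψ hL0 τ τ').1
      have hΦ := (abs_kerK_le hψ hL0 τ τ').2
      have ht := htail τ hτ τ'
      have hfin : |kerKfin ψ T N τ τ'| ≤ ∑ k ∈ bigIdx T N \ gridIdx T, lorentz M A (τ - grid T (logHeight T) k) * lorentz M A (τ' - grid T (logHeight T) k) := by
        rw [kerKfin]
        refine (Finset.abs_sum_le_sum_abs _ _).trans (Finset.sum_le_sum fun k _ ↦ ?_)
        rw [abs_mul]
        exact mul_le_mul (hmaj _) (hmaj _) (abs_nonneg _) (lorentz_pos hM hA _).le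
      have hout : |logHeight T * PhiR ψ T (τ - τ') - kerK ψ T τ τ'| ≤
          ∑ k ∈ bigIdx T N \ gridIdx T, lorentz M A (τ - grid T (logHeight T) k) * lorentz M A (τ' - grid T (logHeight T) k) + ε := by
        have e : logHeight T * PhiR ψ T (τ - τ') - kerK ψ T τ τ' =
            kerKfin ψ T N τ τ' + (logHeight T * PhiR ψ T (τ - τ') - kerK ψ T τ τ' - kerKfin ψ T N τ τ') := by
          ring
        rw [e]
        exact (abs_add_le _ _).trans (add_le_add hfin ht)
      have e2 : kerK ψ T τ τ' ^ 2 * weilDensity (T / (2 * π)) τ - (logHeight T * PhiR ψ T (τ - τ')) ^ 2 * weilDensity (T / (2 * π)) τ =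
          -((logHeight T * PhiR ψ T (τ - τ') - kerK ψ T τ τ') *
            (logHeight T * PhiR ψ T (τ - τ') + kerK ψ T τ τ')) * weilDensity (T / (2 * π)) τ := by ring
      rw [e2, abs_mul, abs_neg, abs_mul]
      have hsum : |logHeight T * PhiR ψ T (τ - τ') + kerK ψ T τ τ'| ≤ 2 * 𝒩 :=
        (abs_add_le _ _).trans (by linarith)
      have h0 : 0 ≤ ∑ k ∈ bigIdx T N \ gridIdx T, lorentz M A (τ - grid T (logHeight T) k) * lorentz M A (τ' - grid T (logHeight T) k) + ε :=
        add_nonneg (Finset.sum_nonneg fun k _ ↦ mul_nonneg (lorentz_pos hM hA _).le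
          (lorentz_pos hM hA _).le) hε0
      calc |logHeight T * PhiR ψ T (τ - τ') - kerK ψ T τ τ'| *
            |logHeight T * PhiR ψ T (τ - τ') + kerK ψ T τ τ'| * |weilDensity (T / (2 * π)) τ|
          ≤ (∑ k ∈ bigIdx T N \ gridIdx T, lorentz M A (τ - grid T (logHeight T) k) * lorentz M A (τ' - grid T (logHeight T) k) + ε) * (2 * 𝒩) * BI := by
            refine mul_le_mul (mul_le_mul hout hsum (abs_nonneg _) h0) (hBI τ hτ) (abs_nonneg _) ?_
            positivity
        _ = _ := by ring
    -- integrate over `I`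
    have hcd : Continuous fun τ ↦ kerK ψ T τ τ' ^ 2 * weilDensity (T / (2 * π)) τ -
        (logHeight T * PhiR ψ T (τ - τ')) ^ 2 * weilDensity (T / (2 * π)) τ := hc1.sub hc2
    have hck : ∀ k : ℤ, Continuous fun τ : ℝ ↦ lorentz M A (τ - grid T (logHeight T) k) * lorentz M A (τ' - grid T (logHeight T) k) := fun k ↦
      (hcϑ.comp (continuous_id.sub continuous_const)).mul continuous_const
    have hcs : Continuous fun τ : ℝ ↦ ∑ k ∈ bigIdx T N \ gridIdx T, lorentz M A (τ - grid T (logHeight T) k) * lorentz M A (τ' - grid T (logHeight T) k) :=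
      continuous_finsetSum _ fun k _ ↦ hck k
    have hcb : Continuous fun τ ↦ 2 * 𝒩 * BI * (∑ k ∈ bigIdx T N \ gridIdx T, lorentz M A (τ - grid T (logHeight T) k) * lorentz M A (τ' - grid T (logHeight T) k) + ε) :=
      continuous_const.mul (hcs.add continuous_const)
    have hI1 : |∫ τ in Icc T (2 * T), kerK ψ T τ τ' ^ 2 * weilDensity (T / (2 * π)) τ -
        (logHeight T * PhiR ψ T (τ - τ')) ^ 2 * weilDensity (T / (2 * π)) τ| ≤
        ∫ τ in T..2 * T, 2 * 𝒩 * BI * (∑ k ∈ bigIdx T N \ gridIdx T, lorentz M A (τ - grid T (logHeight T) k) * lorentz M A (τ' - grid T (logHeight T) k) + ε) := by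
      rw [integral_Icc_eq_integral_Ioc, ← intervalIntegral.integral_of_le hT2]
      refine (intervalIntegral.abs_integral_le_integral_abs hT2).trans ?_
      exact intervalIntegral.integral_mono_on hT2 (hcd.abs.intervalIntegrable _ _)
        (hcb.intervalIntegrable _ _) hdiff
    have hI2 : ∫ τ in T..2 * T, 2 * 𝒩 * BI * (∑ k ∈ bigIdx T N \ gridIdx T, lorentz M A (τ - grid T (logHeight T) k) * lorentz M A (τ' - grid T (logHeight T) k) + ε) =
        2 * 𝒩 * BI * (∑ k ∈ bigIdx T N \ gridIdx T, lorentz M A (τ' - grid T (logHeight T) k) * (∫ τ in T..2 * T, lorentz M A (τ - grid T (logHeight T) k)) + ε * T) := by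
      rw [intervalIntegral.integral_const_mul, intervalIntegral.integral_add (hcs.intervalIntegrable _ _)
        (continuous_const.intervalIntegrable _ _), intervalIntegral.integral_const,
        intervalIntegral.integral_finsetSum fun k _ ↦ (hck k).intervalIntegrable _ _]
      congr 2
      · refine Finset.sum_congr rfl fun k _ ↦ ?_
        rw [intervalIntegral.integral_mul_const, mul_comm]
      · simp only [smul_eq_mul]; ring
    calc |weilDensity (T / (2 * π)) τ'| * |∫ τ in Icc T (2 * T), kerK ψ T τ τ' ^ 2 * weilDensity (T / (2 * π)) τ -
          (logHeight T * PhiR ψ T (τ - τ')) ^ 2 * weilDensity (T / (2 * π)) τ|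
        ≤ BI * (2 * 𝒩 * BI * (∑ k ∈ bigIdx T N \ gridIdx T,
            lorentz M A (τ' - grid T (logHeight T) k) * (∫ τ in T..2 * T, lorentz M A (τ - grid T (logHeight T) k)) + ε * T)) :=
          mul_le_mul (hBI τ' hτ') (hI1.trans (le_of_eq hI2)) (abs_nonneg _) hBI0
      _ = _ := by ring
  -- integrate over `τ' ∈ I`
  have hck' : ∀ k : ℤ, Continuous fun τ' : ℝ ↦ lorentz M A (τ' - grid T (logHeight T) k) * (∫ τ in T..2 * T, lorentz M A (τ - grid T (logHeight T) k)) := fun k ↦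
    (hcϑ.comp (continuous_id.sub continuous_const)).mul continuous_const
  have hcs' : Continuous fun τ' : ℝ ↦ ∑ k ∈ bigIdx T N \ gridIdx T, lorentz M A (τ' - grid T (logHeight T) k) * (∫ τ in T..2 * T, lorentz M A (τ - grid T (logHeight T) k)) :=
    continuous_finsetSum _ fun k _ ↦ hck' k
  have hUc : Continuous fun τ' : ℝ ↦ 2 * 𝒩 * BI ^ 2 * (∑ k ∈ bigIdx T N \ gridIdx T,
      lorentz M A (τ' - grid T (logHeight T) k) * (∫ τ in T..2 * T, lorentz M A (τ - grid T (logHeight T) k)) + ε * T) :=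
    continuous_const.mul (hcs'.add continuous_const)
  rw [hrepr, hMform, ← intervalIntegral.integral_sub (hPc.intervalIntegrable _ _) (hQc.intervalIntegrable _ _)]
  refine (intervalIntegral.abs_integral_le_integral_abs hT2).trans ?_
  refine (intervalIntegral.integral_mono_on hT2 ((hPc.sub hQc).abs.intervalIntegrable _ _)
    (hUc.intervalIntegrable _ _) fun τ' hτ' ↦ hpt τ' hτ').trans (le_of_eq ?_)
  rw [intervalIntegral.integral_const_mul, intervalIntegral.integral_add (hcs'.intervalIntegrable _ _)
    (continuous_const.intervalIntegrable _ _), intervalIntegral.integral_const,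
    intervalIntegral.integral_finsetSum fun k _ ↦ (hck' k).intervalIntegrable _ _]
  congr 2
  · refine Finset.sum_congr rfl fun k _ ↦ ?_
    rw [intervalIntegral.integral_mul_const, sq]
  · simp only [smul_eq_mul]; ring

/-! ## §R7. Assembly of Proposition 5.2 for the typed model -/

/-- The off-block majorant `G(r) := ϑ(r)²(1 + √2 + √(r/T))`. [cite: AlpogeFurman2026, Proposition 5.2 (proof), p. 9] -/
def offG (M A T r : ℝ) : ℝ := lorentz M A r ^ 2 * (1 + Real.sqrt 2 + Real.sqrt (r / T))

/-- Integrability and size of the off-block majorant on `(0, ∞)`: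
`∫G ≤ (1+√2)·2M·Θ + 16M(M+A)J_{3/2}/√T`, `∫ rG ≤ (1+√2)·2AM + 32(M²+A²)J_{5/2}/√T`.
[cite: AlpogeFurman2026, Proposition 5.2 (proof), p. 9] -/
theorem offG_facts {M A : ℝ} (hM : 0 < M) (hA : 0 < A) {T : ℝ} (hT : 0 < T) :
    (∀ r, 0 < r → 0 ≤ offG M A T r) ∧ IntegrableOn (offG M A T) (Ioi 0) ∧
      IntegrableOn (fun r ↦ r * offG M A T r) (Ioi 0) ∧
      (∫ r in Ioi 0, offG M A T r ≤ (1 + Real.sqrt 2) * (2 * M * (2 * π * Real.sqrt (A * M))) +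
        16 * M * (M + A) * jb (3 / 2) / Real.sqrt T) ∧
      (∫ r in Ioi 0, r * offG M A T r ≤ (1 + Real.sqrt 2) * (2 * A * M) +
        32 * (M ^ 2 + A ^ 2) * jb (5 / 2) / Real.sqrt T) := by
  obtain ⟨hcont, hint, hI⟩ := integral_lorentz hM hA
  obtain ⟨hsqint, hsqle, -⟩ := setIntegral_lorentz_sq_le hM hA (0 : ℝ)
  obtain ⟨hI0int, hI0le, -⟩ := setIntegral_lorentz_le hM hA (0 : ℝ)
  obtain ⟨hrint, hrval⟩ := integral_lorentz_sq_mul_self hM hA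
  obtain ⟨hj3, hj30⟩ := integrable_jb (show (1 : ℝ) < 3 / 2 by norm_num)
  obtain ⟨hj5, hj50⟩ := integrable_jb (show (1 : ℝ) < 5 / 2 by norm_num)
  have hsT : 0 < Real.sqrt T := Real.sqrt_pos.2 hT
  have hnn : ∀ r, 0 < r → 0 ≤ offG M A T r := fun r _ ↦ by unfold offG; positivity
  have hGc : Continuous (offG M A T) := by
    unfold offG; exact (hcont.pow 2).mul (by fun_prop)
  -- pointwise bounds on `(0,∞)`
  have hsplit : ∀ r, 0 < r → offG M A T r =
      (1 + Real.sqrt 2) * lorentz M A r ^ 2 + (Real.sqrt T)⁻¹ * (lorentz M A r * (lorentz M A r * Real.sqrt |r|)) := by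
    intro r hr
    rw [offG, Real.sqrt_div' _ hT.le, abs_of_pos hr]; ring
  have hb1 : ∀ r, 0 < r → offG M A T r ≤ (1 + Real.sqrt 2) * lorentz M A r ^ 2 +
      (Real.sqrt T)⁻¹ * (2 * M * (8 * (M + A) * (1 + ‖r‖) ^ (-(3 / 2 : ℝ)))) := by
    intro r hr
    rw [hsplit r hr]
    exact add_le_add_right (mul_le_mul_of_nonneg_left (mul_le_mul (lorentz_le_two_mul hM hA r)
      (lorentz_mul_sqrt_le hM hA r) (mul_nonneg (lorentz_pos hM hA r).le (Real.sqrt_nonneg _))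
      (by positivity)) (inv_nonneg.2 hsT.le)) _
  have hb2 : ∀ r, 0 < r → r * offG M A T r ≤ (1 + Real.sqrt 2) * (lorentz M A r ^ 2 * r) +
      (Real.sqrt T)⁻¹ * (32 * (M ^ 2 + A ^ 2) * (1 + ‖r‖) ^ (-(5 / 2 : ℝ))) := by
    intro r hr
    rw [hsplit r hr]
    have e : r * ((1 + Real.sqrt 2) * lorentz M A r ^ 2 +
        (Real.sqrt T)⁻¹ * (lorentz M A r * (lorentz M A r * Real.sqrt |r|))) =
        (1 + Real.sqrt 2) * (lorentz M A r ^ 2 * r) +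
          (Real.sqrt T)⁻¹ * (lorentz M A r ^ 2 * |r| ^ (3 / 2 : ℝ)) := by
      rw [abs_of_pos hr, show (3 / 2 : ℝ) = 1 + 1 / 2 by norm_num, Real.rpow_add hr, Real.rpow_one,
        ← Real.sqrt_eq_rpow]
      ring
    rw [e]
    exact add_le_add_right (mul_le_mul_of_nonneg_left (lorentz_sq_mul_rpow_le hM hA r)
      (inv_nonneg.2 hsT.le)) _
  -- integrability
  have hB1 : IntegrableOn (fun r ↦ (1 + Real.sqrt 2) * lorentz M A r ^ 2 +
      (Real.sqrt T)⁻¹ * (2 * M * (8 * (M + A) * (1 + ‖r‖) ^ (-(3 / 2 : ℝ))))) (Ioi 0) :=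
    (hsqint.const_mul _).add (((hj3.const_mul _).const_mul _).const_mul _).integrableOn
  have hB2 : IntegrableOn (fun r ↦ (1 + Real.sqrt 2) * (lorentz M A r ^ 2 * r) +
      (Real.sqrt T)⁻¹ * (32 * (M ^ 2 + A ^ 2) * (1 + ‖r‖) ^ (-(5 / 2 : ℝ)))) (Ioi 0) :=
    (hrint.const_mul _).add ((hj5.const_mul _).const_mul _).integrableOn
  have hGi : IntegrableOn (offG M A T) (Ioi 0) := by
    refine hB1.mono' hGc.aestronglyMeasurable.restrict ?_
    refine (ae_restrict_iff' measurableSet_Ioi).2 (ae_of_all _ fun r hr ↦ ?_)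
    rw [Real.norm_eq_abs, abs_of_nonneg (hnn r hr)]
    exact hb1 r hr
  have hGxi : IntegrableOn (fun r ↦ r * offG M A T r) (Ioi 0) := by
    refine hB2.mono' (continuous_id.mul hGc).aestronglyMeasurable.restrict ?_
    refine (ae_restrict_iff' measurableSet_Ioi).2 (ae_of_all _ fun r hr ↦ ?_)
    rw [Real.norm_eq_abs, abs_of_nonneg (mul_nonneg (le_of_lt hr) (hnn r hr))]
    exact hb2 r hr
  refine ⟨hnn, hGi, hGxi, ?_, ?_⟩
  · calc ∫ r in Ioi 0, offG M A T r
        ≤ ∫ r in Ioi 0, ((1 + Real.sqrt 2) * lorentz M A r ^ 2 +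
            (Real.sqrt T)⁻¹ * (2 * M * (8 * (M + A) * (1 + ‖r‖) ^ (-(3 / 2 : ℝ))))) :=
          setIntegral_mono_on hGi hB1 measurableSet_Ioi fun r hr ↦ hb1 r hr
      _ = (1 + Real.sqrt 2) * (∫ r in Ioi 0, lorentz M A r ^ 2) +
            (Real.sqrt T)⁻¹ * (2 * M * (8 * (M + A) * ∫ r in Ioi (0 : ℝ), (1 + ‖r‖) ^ (-(3 / 2 : ℝ)))) := by
          rw [integral_add (hsqint.const_mul _) (((hj3.const_mul _).const_mul _).const_mul _).integrableOn,
            integral_const_mul, integral_const_mul, integral_const_mul, integral_const_mul]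
      _ ≤ (1 + Real.sqrt 2) * (2 * M * (2 * π * Real.sqrt (A * M))) +
            (Real.sqrt T)⁻¹ * (2 * M * (8 * (M + A) * jb (3 / 2))) := by
          gcongr
          · exact hsqle.trans (mul_le_mul_of_nonneg_left hI0le (by positivity))
          · exact setIntegral_le_integral hj3 (Eventually.of_forall fun r ↦ Real.rpow_nonneg (by positivity) _)
      _ = _ := by rw [div_eq_mul_inv]; ring
  · calc ∫ r in Ioi 0, r * offG M A T r
        ≤ ∫ r in Ioi 0, ((1 + Real.sqrt 2) * (lorentz M A r ^ 2 * r) +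
            (Real.sqrt T)⁻¹ * (32 * (M ^ 2 + A ^ 2) * (1 + ‖r‖) ^ (-(5 / 2 : ℝ)))) :=
          setIntegral_mono_on hGxi hB2 measurableSet_Ioi fun r hr ↦ hb2 r hr
      _ = (1 + Real.sqrt 2) * (∫ r in Ioi 0, lorentz M A r ^ 2 * r) +
            (Real.sqrt T)⁻¹ * (32 * (M ^ 2 + A ^ 2) * ∫ r in Ioi (0 : ℝ), (1 + ‖r‖) ^ (-(5 / 2 : ℝ))) := by
          rw [integral_add (hrint.const_mul _) ((hj5.const_mul _).const_mul _).integrableOn,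
            integral_const_mul, integral_const_mul, integral_const_mul]
      _ ≤ (1 + Real.sqrt 2) * (2 * A * M) + (Real.sqrt T)⁻¹ * (32 * (M ^ 2 + A ^ 2) * jb (5 / 2)) := by
          rw [hrval]
          gcongr
          exact setIntegral_le_integral hj5 (Eventually.of_forall fun r ↦ Real.rpow_nonneg (by positivity) _)
      _ = _ := by rw [div_eq_mul_inv]; ring

/-- `L ≤ √T` (`L = log(T/2π)`, `T > 0`). [folklore] -/
private theorem logHeight_le_sqrt {T : ℝ} (hT : 0 < T) : logHeight T ≤ Real.sqrt T := by
  have hπ := Real.pi_pos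
  have hX : 0 < T / (2 * π) := by positivity
  rw [logHeight]
  have h1 := log_le_two_sqrt hX.le
  have h2 : Real.sqrt (T / (2 * π)) ≤ Real.sqrt T / 2 := by
    rw [Real.sqrt_le_left (by positivity), div_pow, Real.sq_sqrt hT.le]
    rw [div_le_div_iff₀ (by positivity) (by norm_num)]
    nlinarith [Real.pi_gt_three]
  linarith

/-- `√2 ≤ 3/2`, `1 ≤ √L`-type numerics used by the assembly. [folklore] -/
private theorem sqrt_two_le : Real.sqrt 2 ≤ 3 / 2 := by
  rw [Real.sqrt_le_left (by norm_num)]; norm_num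

/-- **Off the window the squared entries are negligible** ([AF26] Prop. 5.2, the term `𝓔₂`, in the
region-wise form of §R4–§R5): `|Σ s² − Σ (s^I)²| ≤ C · T · L⁴` for `T ≥ 300`, `L ≥ 10`.
[cite: AlpogeFurman2026, Proposition 5.2 (proof, `𝓔₂`), p. 9] -/
theorem sEntry_sq_sub_sEntryI_sq_le (hψ : IsWindow ψ) :
    ∃ C : ℝ, 0 ≤ C ∧ ∀ T : ℝ, 300 ≤ T → 10 ≤ logHeight T →
      |∑ k : Fin (gridDim T), ∑ k' : Fin (gridDim T), sEntry ψ T k k' ^ 2 -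
          ∑ k : Fin (gridDim T), ∑ k' : Fin (gridDim T), sEntryI ψ T k k' ^ 2| ≤
        C * T * logHeight T ^ 4 := by
  have hπ := Real.pi_pos
  have hπ3 := Real.pi_gt_three
  obtain ⟨A₀, A₂, hA₀, hA₂, hmajT⟩ := exists_majorant hψ
  obtain ⟨β, hβ, hνT⟩ := exists_abs_weilDensity_le
  obtain ⟨-, hJ3⟩ := integrable_jb (show (1 : ℝ) < 3 / 2 by norm_num)
  obtain ⟨-, hJ5⟩ := integrable_jb (show (1 : ℝ) < 5 / 2 by norm_num)
  set J3 := jb (3 / 2) with hJ3def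
  set J5 := jb (5 / 2) with hJ5def
  set c₁ : ℝ := 2 * π * Real.sqrt (A₂ * A₀) with hc₁
  have hc₁0 : 0 < c₁ := by positivity
  set cS : ℝ := 4 * A₀ + c₁ with hcS
  set cΘ : ℝ := 3 * c₁ + 8 * (A₀ + A₂) * J3 with hcΘ
  set c₂ : ℝ := 6 * A₀ * c₁ + 16 * A₀ * (A₀ + A₂) * J3 with hc₂
  set c₃ : ℝ := 6 * A₂ * A₀ + 32 * (A₀ ^ 2 + A₂ ^ 2) * J5 with hc₃
  have hc₂0 : 0 ≤ c₂ := by positivity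
  have hc₃0 : 0 ≤ c₃ := by positivity
  refine ⟨4 * β ^ 2 * cS * cΘ * (c₂ + c₃), by positivity, fun T hT hL ↦ ?_⟩
  have hT0 : 0 < T := by linarith only [hT]
  have hT4π : 4 * π ≤ T := by linarith only [hT, Real.pi_lt_d4]
  have hL0 : 0 < (logHeight T) := by linarith only [hL]
  have hL1 : 1 ≤ (logHeight T) := by linarith only [hL]
  set ℓ := Real.sqrt (logHeight T) with hℓ
  have hℓ2 : ℓ ^ 2 = (logHeight T) := Real.sq_sqrt hL0.le
  have hℓ1 : 1 ≤ ℓ := by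
    rw [hℓ, show (1 : ℝ) = Real.sqrt 1 by simp]; exact Real.sqrt_le_sqrt hL1
  have hℓ0 : 0 ≤ ℓ := by linarith only [hℓ1]
  have hsT : 0 < Real.sqrt T := Real.sqrt_pos.2 hT0
  have hsT2 : Real.sqrt T ^ 2 = T := Real.sq_sqrt hT0.le
  have hLsT : (logHeight T) ≤ Real.sqrt T := logHeight_le_sqrt hT0
  have hsT1 : 1 ≤ Real.sqrt T := hL1.trans hLsT
  have hℓ23 : ℓ ^ 2 ≤ ℓ ^ 3 := pow_le_pow_right₀ hℓ1 (by norm_num)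
  have hℓ34 : ℓ ^ 3 ≤ ℓ ^ 4 := pow_le_pow_right₀ hℓ1 (by norm_num)
  have hs2 := sqrt_two_le
  have hs20 : 0 ≤ Real.sqrt 2 := Real.sqrt_nonneg _
  have hM0 : 0 < A₀ * (logHeight T) := by positivity
  have hmaj : ∀ ξ, |hatR ψ T ξ| ≤ lorentz (A₀ * (logHeight T)) A₂ ξ := fun ξ ↦ (hmajT T hL1 ξ).1
  have hΘ : 2 * π * Real.sqrt (A₂ * (A₀ * (logHeight T))) = c₁ * ℓ := by
    rw [hc₁, hℓ, show A₂ * (A₀ * (logHeight T)) = (A₂ * A₀) * (logHeight T) by ring, Real.sqrt_mul (by positivity)]; ring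
  have hν : ∀ τ, |weilDensity (T / (2 * π)) τ| ≤ (β * Real.sqrt T) * wt T τ := fun τ ↦ by
    rw [wt, mul_assoc]; have := hνT T hT4π τ; simpa [mul_assoc] using this
  have hfrac : (A₀ * (logHeight T) + A₂) / Real.sqrt T ≤ (A₀ + A₂) * ℓ := by
    rw [div_le_iff₀ hsT]
    have e1 : A₀ * (logHeight T) ≤ A₀ * (ℓ * Real.sqrt T) :=
      mul_le_mul_of_nonneg_left (hLsT.trans (le_mul_of_one_le_left hsT.le hℓ1)) hA₀.le
    have e2 : A₂ ≤ A₂ * (ℓ * Real.sqrt T) :=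
      le_mul_of_one_le_right hA₂.le (one_le_mul_of_one_le_of_one_le hℓ1 hsT1)
    linarith only [e1, e2, show (A₀ + A₂) * ℓ * Real.sqrt T = A₀ * (ℓ * Real.sqrt T) + A₂ * (ℓ * Real.sqrt T) by ring]
  -- `S₁ ≤ cS ℓ³`
  obtain ⟨-, hI0le, -⟩ := setIntegral_lorentz_le hM0 hA₂ (0 : ℝ)
  have hS₁ := fun τ ↦ (sum_grid_lorentz_le hM0 hA₂ hL0 τ).1
  have hS₁le : 4 * (A₀ * (logHeight T)) + 2 * (((logHeight T) / (2 * π)) * ∫ r in Ioi 0, lorentz (A₀ * (logHeight T)) A₂ r) ≤ cS * ℓ ^ 3 := by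
    have h1 : ((logHeight T) / (2 * π)) * ∫ r in Ioi 0, lorentz (A₀ * (logHeight T)) A₂ r ≤ ((logHeight T) / (2 * π)) * (c₁ * ℓ) :=
      mul_le_mul_of_nonneg_left (hI0le.trans (le_of_eq hΘ)) (by positivity)
    have h2 : ((logHeight T) / (2 * π)) * (c₁ * ℓ) ≤ (logHeight T) * (c₁ * ℓ) / 2 := by
      rw [div_mul_eq_mul_div]
      exact div_le_div_of_nonneg_left (by positivity) (by norm_num) (by linarith only [hπ3])
    have h3 : (logHeight T) * (c₁ * ℓ) = c₁ * ℓ ^ 3 := by rw [← hℓ2]; ring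
    have h4 : 4 * (A₀ * (logHeight T)) ≤ 4 * A₀ * ℓ ^ 3 := by
      rw [← hℓ2]; linarith only [mul_le_mul_of_nonneg_left hℓ23 hA₀.le]
    rw [hcS]; linarith only [h1, h2, h3, h4]
  -- `Θ_ω ≤ cΘ ℓ`
  have hΘw := fun k : Fin (gridDim T) ↦
    (integral_lorentz_weight_le hM0 hA₂ hT0 (grid_mem_Icc hT0 hL0 k)).2
  have hΘw0 : 0 ≤ (1 + Real.sqrt 2) * (2 * π * Real.sqrt (A₂ * (A₀ * (logHeight T)))) +
      8 * (A₀ * (logHeight T) + A₂) * jb (3 / 2) / Real.sqrt T := by positivity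
  have hΘwle : (1 + Real.sqrt 2) * (2 * π * Real.sqrt (A₂ * (A₀ * (logHeight T)))) +
      8 * (A₀ * (logHeight T) + A₂) * jb (3 / 2) / Real.sqrt T ≤ cΘ * ℓ := by
    rw [hΘ, ← hJ3def, show 8 * (A₀ * (logHeight T) + A₂) * J3 / Real.sqrt T =
      8 * J3 * ((A₀ * (logHeight T) + A₂) / Real.sqrt T) by ring, hcΘ]
    have h1 : (1 + Real.sqrt 2) * (c₁ * ℓ) ≤ 3 * (c₁ * ℓ) :=
      mul_le_mul_of_nonneg_right (by linarith only [hs2]) (by positivity)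
    have h2 := mul_le_mul_of_nonneg_left hfrac (show 0 ≤ 8 * J3 by positivity)
    have e3 : 8 * J3 * ((A₀ + A₂) * ℓ) = 8 * (A₀ + A₂) * J3 * ℓ := by ring
    have e4 : (3 * c₁ + 8 * (A₀ + A₂) * J3) * ℓ = 3 * (c₁ * ℓ) + 8 * (A₀ + A₂) * J3 * ℓ := by ring
    linarith only [h1, h2, e3, e4]
  -- the off-block majorant
  obtain ⟨hG0, hGi, hGx, hIG, hIrG⟩ := offG_facts hM0 hA₂ hT0
  have hGdom : ∀ r, 0 < r → lorentz (A₀ * (logHeight T)) A₂ r ^ 2 * (1 + Real.sqrt 2 + Real.sqrt (r / T)) ≤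
      offG (A₀ * (logHeight T)) A₂ T r := fun r _ ↦ le_of_eq rfl
  have hIGtot : ∫ r in Ioi 0, (1 + r / (2 * π / (logHeight T))) * offG (A₀ * (logHeight T)) A₂ T r ≤ (c₂ + c₃) * ℓ ^ 4 := by
    have e : (fun r ↦ (1 + r / (2 * π / (logHeight T))) * offG (A₀ * (logHeight T)) A₂ T r) =
        fun r ↦ offG (A₀ * (logHeight T)) A₂ T r + ((logHeight T) / (2 * π)) * (r * offG (A₀ * (logHeight T)) A₂ T r) := by
      funext r; field_simp
    rw [e, integral_add hGi (hGx.const_mul _), integral_const_mul]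
    have h1 : ∫ r in Ioi 0, offG (A₀ * (logHeight T)) A₂ T r ≤ c₂ * ℓ ^ 3 := by
      refine hIG.trans ?_
      rw [hΘ, ← hJ3def, hc₂]
      have e1 : 2 * (A₀ * (logHeight T)) * (c₁ * ℓ) = 2 * A₀ * c₁ * ℓ ^ 3 := by rw [← hℓ2]; ring
      have h11 : (1 + Real.sqrt 2) * (2 * (A₀ * (logHeight T)) * (c₁ * ℓ)) ≤ 3 * (2 * A₀ * c₁ * ℓ ^ 3) := by
        rw [e1]; exact mul_le_mul_of_nonneg_right (by linarith only [hs2]) (by positivity)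
      have e2 : 16 * (A₀ * (logHeight T)) * (A₀ * (logHeight T) + A₂) * J3 / Real.sqrt T =
          16 * A₀ * J3 * ℓ ^ 2 * ((A₀ * (logHeight T) + A₂) / Real.sqrt T) := by rw [← hℓ2]; ring
      have h12 : 16 * A₀ * J3 * ℓ ^ 2 * ((A₀ * (logHeight T) + A₂) / Real.sqrt T) ≤
          16 * A₀ * J3 * ℓ ^ 2 * ((A₀ + A₂) * ℓ) := mul_le_mul_of_nonneg_left hfrac (by positivity)
      have e6 : 16 * A₀ * J3 * ℓ ^ 2 * ((A₀ + A₂) * ℓ) = 16 * A₀ * (A₀ + A₂) * J3 * ℓ ^ 3 := by ring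
      have e7 : (6 * A₀ * c₁ + 16 * A₀ * (A₀ + A₂) * J3) * ℓ ^ 3 =
          3 * (2 * A₀ * c₁ * ℓ ^ 3) + 16 * A₀ * (A₀ + A₂) * J3 * ℓ ^ 3 := by ring
      rw [e2]
      linarith only [h11, h12, e6, e7]
    have h2 : ∫ r in Ioi 0, r * offG (A₀ * (logHeight T)) A₂ T r ≤ c₃ * ℓ ^ 2 := by
      refine hIrG.trans ?_
      rw [← hJ5def, hc₃]
      have h21 : (1 + Real.sqrt 2) * (2 * A₂ * (A₀ * (logHeight T))) ≤ 3 * (2 * A₂ * A₀ * ℓ ^ 2) := by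
        rw [← hℓ2]; exact mul_le_mul (by linarith only [hs2]) (le_of_eq (by ring)) (by positivity) (by norm_num)
      have hfrac2 : ((A₀ * (logHeight T)) ^ 2 + A₂ ^ 2) / Real.sqrt T ≤ (A₀ ^ 2 + A₂ ^ 2) * ℓ ^ 2 := by
        rw [div_le_iff₀ hsT, ← hℓ2]
        have e3 : (A₀ * ℓ ^ 2) ^ 2 ≤ A₀ ^ 2 * ℓ ^ 2 * Real.sqrt T := by
          have : ℓ ^ 2 ≤ Real.sqrt T := by rw [hℓ2]; exact hLsT
          have h := mul_le_mul_of_nonneg_left this (show 0 ≤ A₀ ^ 2 * ℓ ^ 2 by positivity)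
          have e : (A₀ * ℓ ^ 2) ^ 2 = A₀ ^ 2 * ℓ ^ 2 * ℓ ^ 2 := by ring
          linarith only [h, e]
        have e4 : A₂ ^ 2 ≤ A₂ ^ 2 * ℓ ^ 2 * Real.sqrt T := by
          have : (1 : ℝ) ≤ ℓ ^ 2 * Real.sqrt T :=
            one_le_mul_of_one_le_of_one_le (one_le_pow₀ hℓ1) hsT1
          have h := mul_le_mul_of_nonneg_left this (sq_nonneg A₂)
          linarith only [h, show A₂ ^ 2 * (ℓ ^ 2 * Real.sqrt T) = A₂ ^ 2 * ℓ ^ 2 * Real.sqrt T by ring]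
        linarith only [e3, e4, show (A₀ ^ 2 + A₂ ^ 2) * ℓ ^ 2 * Real.sqrt T =
          A₀ ^ 2 * ℓ ^ 2 * Real.sqrt T + A₂ ^ 2 * ℓ ^ 2 * Real.sqrt T by ring]
      have e5 : 32 * ((A₀ * (logHeight T)) ^ 2 + A₂ ^ 2) * J5 / Real.sqrt T =
          32 * J5 * (((A₀ * (logHeight T)) ^ 2 + A₂ ^ 2) / Real.sqrt T) := by ring
      have h22 : 32 * J5 * (((A₀ * (logHeight T)) ^ 2 + A₂ ^ 2) / Real.sqrt T) ≤ 32 * J5 * ((A₀ ^ 2 + A₂ ^ 2) * ℓ ^ 2) :=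
        mul_le_mul_of_nonneg_left hfrac2 (by positivity)
      rw [e5]
      linarith only [h21, h22, show (6 * A₂ * A₀ + 32 * (A₀ ^ 2 + A₂ ^ 2) * J5) * ℓ ^ 2 =
        3 * (2 * A₂ * A₀ * ℓ ^ 2) + 32 * J5 * ((A₀ ^ 2 + A₂ ^ 2) * ℓ ^ 2) by ring]
    have h3 : ((logHeight T) / (2 * π)) * ∫ r in Ioi 0, r * offG (A₀ * (logHeight T)) A₂ T r ≤ ℓ ^ 2 * (c₃ * ℓ ^ 2) := by
      have hrG0 : 0 ≤ ∫ r in Ioi 0, r * offG (A₀ * (logHeight T)) A₂ T r :=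
        setIntegral_nonneg measurableSet_Ioi fun r hr ↦ mul_nonneg (le_of_lt hr) (hG0 r hr)
      have : (logHeight T) / (2 * π) ≤ ℓ ^ 2 := by rw [hℓ2]; exact div_le_self hL0.le (by linarith only [hπ3])
      exact mul_le_mul this h2 hrG0 (by positivity)
    linarith only [h1, h3, mul_le_mul_of_nonneg_left hℓ34 hc₂0,
      show ℓ ^ 2 * (c₃ * ℓ ^ 2) = c₃ * ℓ ^ 4 by ring, show (c₂ + c₃) * ℓ ^ 4 = c₂ * ℓ ^ 4 + c₃ * ℓ ^ 4 by ring]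
  have hIG0 : 0 ≤ ∫ r in Ioi 0, (1 + r / (2 * π / (logHeight T))) * offG (A₀ * (logHeight T)) A₂ T r :=
    setIntegral_nonneg measurableSet_Ioi fun r hr ↦ mul_nonneg
      (by have : 0 ≤ r / (2 * π / (logHeight T)) := div_nonneg (le_of_lt hr) (by positivity); linarith only [this]) (hG0 r hr)
  have hS0 : 0 ≤ 4 * (A₀ * (logHeight T)) + 2 * (((logHeight T) / (2 * π)) * ∫ r in Ioi 0, lorentz (A₀ * (logHeight T)) A₂ r) :=
    (Finset.sum_nonneg fun k _ ↦ (lorentz_pos hM0 hA₂ _).le).trans (hS₁ 0)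
  refine (offBlock_le hψ hM0 hA₂ hT0 hL hmaj hν hS₁ hΘw hG0 hGi hGx hGdom hΘw0).trans ?_
  calc 2 * (β * Real.sqrt T) ^ 2 * ((4 * (A₀ * (logHeight T)) + 2 * (((logHeight T) / (2 * π)) * ∫ r in Ioi 0, lorentz (A₀ * (logHeight T)) A₂ r)) *
        ((1 + Real.sqrt 2) * (2 * π * Real.sqrt (A₂ * (A₀ * (logHeight T)))) + 8 * (A₀ * (logHeight T) + A₂) * jb (3 / 2) / Real.sqrt T)) *
        (2 * ∫ r in Ioi 0, (1 + r / (2 * π / (logHeight T))) * offG (A₀ * (logHeight T)) A₂ T r)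
      ≤ 2 * (β * Real.sqrt T) ^ 2 * ((cS * ℓ ^ 3) * (cΘ * ℓ)) * (2 * ((c₂ + c₃) * ℓ ^ 4)) := by
        have := mul_le_mul hS₁le hΘwle hΘw0 (by positivity)
        have := mul_nonneg hS0 hΘw0
        gcongr
    _ = 4 * β ^ 2 * cS * cΘ * (c₂ + c₃) * T * (logHeight T) ^ 4 := by
        rw [mul_pow, hsT2, ← hℓ2]; ring

/-- **On the window the squared entries reproduce `L² 𝓜`** ([AF26] Prop. 5.2, the term `𝓔₁`
and the replacement `K ↦ LΦ`, §R6): `|Σ (s^I)² − L² 𝓜| ≤ C · T · L⁴` for `T ≥ 300`, `(logHeight T) ≥ 10`.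
[cite: AlpogeFurman2026, Proposition 5.2 (proof, `𝓔₁`), pp. 8–9] -/
theorem sEntryI_sq_sub_formM_le (hψ : IsWindow ψ) :
    ∃ C : ℝ, 0 ≤ C ∧ ∀ T : ℝ, 300 ≤ T → 10 ≤ logHeight T →
      |∑ k : Fin (gridDim T), ∑ k' : Fin (gridDim T), sEntryI ψ T k k' ^ 2 -
          logHeight T ^ 2 * formM ψ T| ≤ C * T * logHeight T ^ 4 := by
  have hπ := Real.pi_pos
  have hπ3 := Real.pi_gt_three
  obtain ⟨A₀, A₂, hA₀, hA₂, hmajT⟩ := exists_majorant hψ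
  obtain ⟨β, hβ, hνT⟩ := exists_abs_weilDensity_le
  obtain ⟨m₀, Bw, Kw, -, hBw0, -, -, hBw, -⟩ := hψ.exists_bounds
  set c₁ : ℝ := 2 * π * Real.sqrt (A₂ * A₀) with hc₁
  have hc₁0 : 0 < c₁ := by positivity
  set cU : ℝ := 3 * c₁ ^ 2 + 4 * A₂ * c₁ + 12 * A₀ * A₂ with hcU
  refine ⟨12 * Bw ^ 2 * β ^ 2 * cU, by positivity, fun T hT hL ↦ ?_⟩
  have hT0 : 0 < T := by linarith only [hT]
  have hT4π : 4 * π ≤ T := by linarith only [hT, Real.pi_lt_d4]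
  have hL0 : 0 < (logHeight T) := by linarith only [hL]
  have hL1 : 1 ≤ (logHeight T) := by linarith only [hL]
  set ℓ := Real.sqrt (logHeight T) with hℓ
  have hℓ2 : ℓ ^ 2 = (logHeight T) := Real.sq_sqrt hL0.le
  have hℓ1 : 1 ≤ ℓ := by
    rw [hℓ, show (1 : ℝ) = Real.sqrt 1 by simp]; exact Real.sqrt_le_sqrt hL1
  have hℓ0 : 0 ≤ ℓ := by linarith only [hℓ1]
  have hsT : 0 < Real.sqrt T := Real.sqrt_pos.2 hT0
  have hsT2 : Real.sqrt T ^ 2 = T := Real.sq_sqrt hT0.le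
  have hℓ23 : ℓ ^ 2 ≤ ℓ ^ 3 := pow_le_pow_right₀ hℓ1 (by norm_num)
  have hℓ34 : ℓ ^ 3 ≤ ℓ ^ 4 := pow_le_pow_right₀ hℓ1 (by norm_num)
  have hℓ24 : ℓ ^ 2 ≤ ℓ ^ 4 := hℓ23.trans hℓ34
  have hs2 := sqrt_two_le
  have hs20 : 0 ≤ Real.sqrt 2 := Real.sqrt_nonneg _
  have hM0 : 0 < A₀ * (logHeight T) := by positivity
  have hmaj : ∀ ξ, |hatR ψ T ξ| ≤ lorentz (A₀ * (logHeight T)) A₂ ξ := fun ξ ↦ (hmajT T hL1 ξ).1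
  have hΘ : 2 * π * Real.sqrt (A₂ * (A₀ * (logHeight T))) = c₁ * ℓ := by
    rw [hc₁, hℓ, show A₂ * (A₀ * (logHeight T)) = (A₂ * A₀) * (logHeight T) by ring, Real.sqrt_mul (by positivity)]; ring
  have hν : ∀ τ, |weilDensity (T / (2 * π)) τ| ≤ (β * Real.sqrt T) * wt T τ := fun τ ↦ by
    rw [wt, mul_assoc]; have := hνT T hT4π τ; simpa [mul_assoc] using this
  -- tail truncation at `N h ≥ T²`
  set N : ℕ := ⌈T ^ 2 / (2 * π / (logHeight T))⌉₊ with hN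
  have hND : T ^ 2 ≤ (N : ℝ) * (2 * π / (logHeight T)) := by
    have h1 : T ^ 2 / (2 * π / (logHeight T)) ≤ N := Nat.le_ceil _
    rwa [div_le_iff₀ (by positivity)] at h1
  have hD : (0 : ℝ) < T ^ 2 := by positivity
  have htail : ∀ τ ∈ Icc T (2 * T), ∀ τ' : ℝ,
      |(logHeight T) * PhiR ψ T (τ - τ') - kerK ψ T τ τ' - kerKfin ψ T N τ τ'| ≤
        4 * (A₀ * (logHeight T)) * (lorentz (A₀ * (logHeight T)) A₂ (T ^ 2) +
          ((logHeight T) / (2 * π)) * ∫ r in Ioi (T ^ 2), lorentz (A₀ * (logHeight T)) A₂ r) :=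
    fun τ hτ τ' ↦ abs_kerKtail_le hψ hM0 hA₂ hT0 hL0 hmaj hD hND hτ τ'
  have hin := inBlock_le hψ hM0 hA₂ hT0 hL hmaj hν htail
  have hU := sum_sq_intervalIntegral_le hM0 hA₂ hT0 hL0 N
  -- `ε T² ≤ 12 A₀ A₂ ℓ⁴`
  have hεT : 4 * (A₀ * (logHeight T)) * (lorentz (A₀ * (logHeight T)) A₂ (T ^ 2) +
      ((logHeight T) / (2 * π)) * ∫ r in Ioi (T ^ 2), lorentz (A₀ * (logHeight T)) A₂ r) * T ^ 2 ≤ 12 * A₀ * A₂ * ℓ ^ 4 := by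
    obtain ⟨-, -, htl⟩ := setIntegral_lorentz_le hM0 hA₂ (T ^ 2)
    have h1 : lorentz (A₀ * (logHeight T)) A₂ (T ^ 2) ≤ 2 * A₂ / (T ^ 2) ^ 2 := lorentz_le_div_sq hM0 hA₂ hD.ne'
    have h2 := htl hD
    have hT1 : 1 ≤ T ^ 2 := one_le_pow₀ (by linarith only [hT])
    have h3 : lorentz (A₀ * (logHeight T)) A₂ (T ^ 2) * T ^ 2 ≤ 2 * A₂ := by
      calc lorentz (A₀ * (logHeight T)) A₂ (T ^ 2) * T ^ 2 ≤ 2 * A₂ / (T ^ 2) ^ 2 * T ^ 2 :=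
            mul_le_mul_of_nonneg_right h1 (by positivity)
        _ = 2 * A₂ / T ^ 2 := by field_simp
        _ ≤ 2 * A₂ := div_le_self (by positivity) hT1
    have h4 : ((logHeight T) / (2 * π)) * (∫ r in Ioi (T ^ 2), lorentz (A₀ * (logHeight T)) A₂ r) * T ^ 2 ≤ (logHeight T) * A₂ := by
      calc ((logHeight T) / (2 * π)) * (∫ r in Ioi (T ^ 2), lorentz (A₀ * (logHeight T)) A₂ r) * T ^ 2
          ≤ ((logHeight T) / (2 * π)) * (2 * A₂ / T ^ 2) * T ^ 2 := by gcongr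
        _ = (logHeight T) * A₂ / π := by field_simp
        _ ≤ (logHeight T) * A₂ := div_le_self (by positivity) (by linarith only [hπ3])
    have h5 : lorentz (A₀ * (logHeight T)) A₂ (T ^ 2) * T ^ 2 +
        ((logHeight T) / (2 * π)) * (∫ r in Ioi (T ^ 2), lorentz (A₀ * (logHeight T)) A₂ r) * T ^ 2 ≤ 2 * A₂ + (logHeight T) * A₂ := by
      linarith only [h3, h4]
    calc 4 * (A₀ * (logHeight T)) * (lorentz (A₀ * (logHeight T)) A₂ (T ^ 2) +
          ((logHeight T) / (2 * π)) * ∫ r in Ioi (T ^ 2), lorentz (A₀ * (logHeight T)) A₂ r) * T ^ 2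
        = 4 * (A₀ * (logHeight T)) * (lorentz (A₀ * (logHeight T)) A₂ (T ^ 2) * T ^ 2 +
            ((logHeight T) / (2 * π)) * (∫ r in Ioi (T ^ 2), lorentz (A₀ * (logHeight T)) A₂ r) * T ^ 2) := by ring
      _ ≤ 4 * (A₀ * (logHeight T)) * (2 * A₂ + (logHeight T) * A₂) := mul_le_mul_of_nonneg_left h5 (by positivity)
      _ = 8 * (A₀ * A₂) * ℓ ^ 2 + 4 * (A₀ * A₂) * ℓ ^ 4 := by rw [← hℓ2]; ring
      _ ≤ 12 * A₀ * A₂ * ℓ ^ 4 := by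
          linarith only [mul_le_mul_of_nonneg_left hℓ24 (mul_pos hA₀ hA₂).le]
  -- `Σ U² ≤ (3c₁² + 4A₂c₁) ℓ³`
  have hUle : ∑ k ∈ bigIdx T N \ gridIdx T,
      (∫ τ in T..2 * T, lorentz (A₀ * (logHeight T)) A₂ (τ - grid T (logHeight T) k)) ^ 2 ≤ (3 * c₁ ^ 2 + 4 * A₂ * c₁) * ℓ ^ 3 := by
    refine hU.trans ?_
    rw [hΘ, show 4 * A₂ ^ 2 * (c₁ * ℓ) ^ 2 = (2 * A₂ * (c₁ * ℓ)) ^ 2 by ring,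
      Real.sqrt_sq (by positivity), ← hℓ2]
    have : 2 * (ℓ ^ 2 / (2 * π) * (2 * π * (2 * A₂ * (c₁ * ℓ)))) = 4 * A₂ * c₁ * ℓ ^ 3 := by
      field_simp; ring
    rw [this]
    linarith only [mul_le_mul_of_nonneg_left hℓ23 (sq_nonneg c₁), show (c₁ * ℓ) ^ 2 = c₁ ^ 2 * ℓ ^ 2 by ring,
      mul_nonneg (mul_nonneg (mul_nonneg (show (0:ℝ) ≤ 4 by norm_num) hA₂.le) hc₁0.le) (sub_nonneg.2 hℓ23),
      show (3 * c₁ ^ 2 + 4 * A₂ * c₁) * ℓ ^ 3 = 3 * (c₁ ^ 2 * ℓ ^ 3) + 4 * A₂ * c₁ * ℓ ^ 3 by ring]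
  -- `𝒩 ≤ Bw² ℓ⁴`
  have hBw2 : ∀ x ∈ Icc (-(1 / 2 : ℝ)) (1 / 2), ψ x ≤ Bw ^ 2 := by
    intro x hx
    have h := pow_le_pow_left₀ (Real.sqrt_nonneg _) (hBw x hx) 2
    rwa [Real.sq_sqrt (hψ.pos x hx).le] at h
  have h𝒩 : (logHeight T) * ∫ u : ℝ, phi ψ T u ^ 2 ≤ Bw ^ 2 * ℓ ^ 4 := by
    have h := (integral_phi_le hψ (sq_nonneg Bw) hBw2 T).2
    rw [max_eq_left hL0.le] at h
    calc (logHeight T) * ∫ u : ℝ, phi ψ T u ^ 2 ≤ (logHeight T) * (Bw ^ 2 * (logHeight T)) := mul_le_mul_of_nonneg_left h hL0.le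
      _ = Bw ^ 2 * ℓ ^ 4 := by rw [← hℓ2]; ring
  have h𝒩0 : 0 ≤ (logHeight T) * ∫ u : ℝ, phi ψ T u ^ 2 :=
    mul_nonneg hL0.le (integral_nonneg fun u ↦ sq_nonneg _)
  have hsum0 : 0 ≤ ∑ k ∈ bigIdx T N \ gridIdx T,
      (∫ τ in T..2 * T, lorentz (A₀ * (logHeight T)) A₂ (τ - grid T (logHeight T) k)) ^ 2 := Finset.sum_nonneg fun k _ ↦ sq_nonneg _
  have hε0 : 0 ≤ 4 * (A₀ * (logHeight T)) * (lorentz (A₀ * (logHeight T)) A₂ (T ^ 2) +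
      ((logHeight T) / (2 * π)) * ∫ r in Ioi (T ^ 2), lorentz (A₀ * (logHeight T)) A₂ r) := by
    have := setIntegral_nonneg (μ := volume) measurableSet_Ioi
      fun r (_ : r ∈ Ioi (T ^ 2)) ↦ (lorentz_pos hM0 hA₂ r).le
    have := (lorentz_pos hM0 hA₂ (T ^ 2)).le
    positivity
  have hlast : ∑ k ∈ bigIdx T N \ gridIdx T, (∫ τ in T..2 * T, lorentz (A₀ * (logHeight T)) A₂ (τ - grid T (logHeight T) k)) ^ 2 +
      4 * (A₀ * (logHeight T)) * (lorentz (A₀ * (logHeight T)) A₂ (T ^ 2) +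
        ((logHeight T) / (2 * π)) * ∫ r in Ioi (T ^ 2), lorentz (A₀ * (logHeight T)) A₂ r) * T ^ 2 ≤ cU * ℓ ^ 4 := by
    rw [hcU]
    linarith only [hUle, hεT, mul_le_mul_of_nonneg_left hℓ34 (show 0 ≤ 3 * c₁ ^ 2 + 4 * A₂ * c₁ by positivity),
      show (3 * c₁ ^ 2 + 4 * A₂ * c₁ + 12 * A₀ * A₂) * ℓ ^ 4 =
        (3 * c₁ ^ 2 + 4 * A₂ * c₁) * ℓ ^ 4 + 12 * A₀ * A₂ * ℓ ^ 4 by ring]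
  have hsq : (β * Real.sqrt T * (1 + Real.sqrt 2)) ^ 2 ≤ 6 * β ^ 2 * T := by
    rw [mul_pow, mul_pow, hsT2]
    have h2 : Real.sqrt 2 ^ 2 = 2 := Real.sq_sqrt (by norm_num)
    have : (1 + Real.sqrt 2) ^ 2 ≤ 6 := by nlinarith only [h2, hs2, hs20]
    have h := mul_le_mul_of_nonneg_left this (mul_nonneg (sq_nonneg β) hT0.le)
    linarith only [h]
  refine hin.trans ?_
  calc 2 * ((logHeight T) * ∫ u : ℝ, phi ψ T u ^ 2) * (β * Real.sqrt T * (1 + Real.sqrt 2)) ^ 2 *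
        (∑ k ∈ bigIdx T N \ gridIdx T, (∫ τ in T..2 * T, lorentz (A₀ * (logHeight T)) A₂ (τ - grid T (logHeight T) k)) ^ 2 +
          4 * (A₀ * (logHeight T)) * (lorentz (A₀ * (logHeight T)) A₂ (T ^ 2) +
            ((logHeight T) / (2 * π)) * ∫ r in Ioi (T ^ 2), lorentz (A₀ * (logHeight T)) A₂ r) * T ^ 2)
      ≤ 2 * (Bw ^ 2 * ℓ ^ 4) * (6 * β ^ 2 * T) * (cU * ℓ ^ 4) := by
        have := add_nonneg hsum0 (by positivity : 0 ≤ 4 * (A₀ * (logHeight T)) *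
          (lorentz (A₀ * (logHeight T)) A₂ (T ^ 2) +
            ((logHeight T) / (2 * π)) * ∫ r in Ioi (T ^ 2), lorentz (A₀ * (logHeight T)) A₂ r) * T ^ 2)
        gcongr
    _ = 12 * Bw ^ 2 * β ^ 2 * cU * T * (logHeight T) ^ 4 := by rw [← hℓ2]; ring

end AlpogeFurman2026

open AlpogeFurman2026 in
/-- **[AF26] Proposition 5.2 (reduction to the double integral) for the typed model.** For a window
`ψ` there is `C ≥ 0` such that for all `T ≥ 300` with `L = log(T/2π) ≥ 10`:
`|Σ_{0≤k,k′<d} s_{kk′}² − L² 𝓜| ≤ C · T · L⁴`, where `s_{kk′} = ∫_ℝ φ̂(τ−α_k)φ̂(τ−α_{k′})ν_X(τ)dτ`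
(so `(L∫φ²)⁻² Σ s² = ‖G̃+Ẽ‖²_HS = tr (G̃+Ẽ)²`) and
`𝓜 = ∬_{[T,2T]²} Φ(τ−τ′)² ν_X(τ)ν_X(τ′) dτ dτ′` (`formM`). After division by `(L∫φ²)² ≍ L⁴` this is
the printed `‖G̃+Ẽ‖²_HS = (a²L²)⁻¹ 𝓜 + (error)`: the source states the error as `O_χ(N log L/L²)`,
its proof yields `O(N log L/L)` (the `𝓔₂` bound `≪ L³B²l log L`; cf. Remark 6.1, "the log log T from
Proposition 5.2"), and the typed Theorem 5.7 needs `O(N/L)`, which is what is proved here — the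
off-window region is handled by `∫K(τ,τ′)²ω ≤ σΘ_ω Σ_k φ̂(τ′−α_k)²` (§R4) in place of `K² ≤ aL²|K|`.
[cite: AlpogeFurman2026, Proposition 5.2 (p. 8)] -/
theorem AlpogeFurman2026_reduction {ψ : ℝ → ℝ} (hψ : IsWindow ψ) :
    ∃ C : ℝ, 0 ≤ C ∧ ∀ T : ℝ, 300 ≤ T → 10 ≤ logHeight T →
      |∑ k : Fin (gridDim T), ∑ k' : Fin (gridDim T), sEntry ψ T k k' ^ 2 -
          logHeight T ^ 2 * formM ψ T| ≤ C * T * logHeight T ^ 4 := by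
  obtain ⟨C₁, hC₁, h₁⟩ := sEntry_sq_sub_sEntryI_sq_le hψ
  obtain ⟨C₂, hC₂, h₂⟩ := sEntryI_sq_sub_formM_le hψ
  refine ⟨C₁ + C₂, add_nonneg hC₁ hC₂, fun T hT hL ↦ ?_⟩
  calc |∑ k : Fin (gridDim T), ∑ k' : Fin (gridDim T), sEntry ψ T k k' ^ 2 - logHeight T ^ 2 * formM ψ T|
      ≤ |∑ k : Fin (gridDim T), ∑ k' : Fin (gridDim T), sEntry ψ T k k' ^ 2 -
          ∑ k : Fin (gridDim T), ∑ k' : Fin (gridDim T), sEntryI ψ T k k' ^ 2| +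
        |∑ k : Fin (gridDim T), ∑ k' : Fin (gridDim T), sEntryI ψ T k k' ^ 2 -
          logHeight T ^ 2 * formM ψ T| := abs_sub_le _ _ _
    _ ≤ C₁ * T * logHeight T ^ 4 + C₂ * T * logHeight T ^ 4 := add_le_add (h₁ T hT hL) (h₂ T hT hL)
    _ = (C₁ + C₂) * T * logHeight T ^ 4 := by ring

end Literature.NumberTheory.LFunctions

end
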